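import Literature.MathematicalPhysics.StatisticalMechanics.Theil2006ShortRangeResummation
import Literature.MathematicalPhysics.StatisticalMechanics.Theil2006SimplexDeficitCount
import Literature.MathematicalPhysics.StatisticalMechanics.Theil2006PeriodicFromFinite
import Literature.MathematicalPhysics.StatisticalMechanics.Theil2006GroundStatesFromMainEstimate
import Literature.MathematicalPhysics.StatisticalMechanics.Theil2006LocalGeometryFromReference
import Literature.MathematicalPhysics.StatisticalMechanics.Theil2006SimplexCover
import Literature.MathematicalPhysics.StatisticalMechanics.Theil2006ResummationWeighted
import Literature.MathematicalPhysics.StatisticalMechanics.Theil2006MeasureBookkeeping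
import Literature.MathematicalPhysics.StatisticalMechanics.Theil2006LongSimplexRigidity
import Literature.MathematicalPhysics.StatisticalMechanics.Theil2006ExistsReference
import Literature.MathematicalPhysics.StatisticalMechanics.Theil2006AdmissibleExample
import HarnessLib

/-!
# Theil 2006, Theorems 1.1, 1.2 (corrected: up to rotation) and Corollary 1.3 — PROVED

MERGED FILING (lit-1 g53, 2026-08-25): verbatim concatenation (only `import` lines merged, and one
private lemma of the second part renamed `mul_le_tenth_of_le_E` because the first part has a
private lemma of the same name) of the four separately lean-verified bricks staged as
`Theil2006FromGeometry` (row 5), `Theil2006FromReferences` (row 7 v6), `Theil2006FromExistence`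
(row E v3) and `Theil2006MainTheoremsHold` (row F v3) of the cell `pub-crystal3d` lit lane, filed as one module to
shorten the accept → build chain. The last part contains the hypothesis-free discharges
`Theil2006_groundStateEnergy_holds`, `Theil2006_periodicGroundStates_upToRotation_holds`,
`Theil2006_dirichletGroundStates_holds` of the tree's three named facts, and
`Theil2006_periodicGroundStates_false` (the printed translation-only wording of Theorem 1.2
refuted). Each part keeps its own module docstring below. [cite: Theil2006, §1 Thm 1.1, Thm 1.2,
Cor 1.3]
-/

/-! # Part: staged brick `Theil2006FromGeometry` (sha16 a74f81db55a4310a) — verbatim -/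

/-!
# Theil 2006: Theorems 1.1, 1.2 (corrected) and Corollary 1.3 from the geometry of Chapter 4

Topic `Literature/MathematicalPhysics/StatisticalMechanics`. Pure glue over
`Theil2006ShortRangeResummation.lean` ((9) for finite `X` from the Chapter-4 inputs,
`exists_mainLocalEstimate_finite`; Theorem 1.1 from them, `Theil2006_groundStateEnergy_of_geometry`),
`Theil2006PeriodicFromFinite.lean` ((44) from (9), `mainEstimate_periodic_of_finite`),
`Theil2006PeriodicLatticeStructure.lean` (Theorem 1.2 up to rotation from (44),
`Theil2006_periodicGroundStates_upToRotation_of_mainEstimate`) and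
`Theil2006DirichletLatticeStructure.lean` (Corollary 1.3 from (44),
`Theil2006_dirichletGroundStates_of_mainEstimate`). Everything here is PROVED (no `sorry`, no
named fact; D-0026).

## What is here

* `Theil2006.mainEstimate_periodic_of_geometry` — **(44) with the uniform constant `C = 2`**
  for all small `α`, all admissible `V`, all `L ≥ 1` and all `L`-periodic `(X, y)` with (13),
  from the finite Chapter-4 geometry package (the hypothesis of
  `Theil2006_groundStateEnergy_of_geometry`: for every finite configuration with (13) an
  enumeration of the long simplices with (25), Proposition 2.8 (1), (3), Proposition 2.9 (26),
  (27) and (34), constants `K, C₃₄, C₉, K₃`).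
* `Theil2006_mainTheorems_of_geometry` — **Theorem 1.1, Theorem 1.2 (corrected: up to a rigid
  motion, `Theil2006_periodicGroundStates_upToRotation`) and Corollary 1.3
  (`Theil2006_dirichletGroundStates`)** from: the finite Chapter-4 geometry package, the existence
  of relaxed periodic minimizers (hypothesis of the tree's Theorem-1.2 reduction) and the existence
  of relaxed Dirichlet minimizers (hypothesis of the Corollary-1.3 reduction; proved for `V`
  continuous on `[0, ∞)` in `Theil2006DirichletMinimumDistance`).

* `Theil2006_continuous_of_geometry` — for `V` continuous on `[0, ∞)` both existence statements
  are theorems (tree `exists_isRelaxedMinimizer`, `exists_isRelaxedDirichletMinimizer`), so the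
  conclusions of Theorem 1.2 (corrected) and Corollary 1.3 follow from the geometry ALONE.

* `Theil2006.geometryPackage_of_local`, `Theil2006_mainTheorems_of_localGeometry` — the same with
  Proposition 2.9 replaced by the pointwise inputs of its appendix proof ((70), near-defect
  alternative, partition identity, (72)) and (34) by its two printed steps ((52) per simplex,
  (28)); `Theil2006SimplexDeficitCount.lean`.
* `Theil2006.geometryPackage_of_printed`, `Theil2006_mainTheorems_of_printedGeometry` — the same
  with the geometry stated in the PRINTED vocabulary: `𝒯_λ(y)` = `Theil2006.simplicesAt`
  (`Theil2006SimplexDeficitCount.lean`) built on `Theil2006.IsCentredSimplex` = the tree's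
  `IsEquilateralSimplex` (Definition 2.6) + the centring clause closing its loophole
  (Definition 2.6, tree), Lemma 2.7 (25), Proposition 2.8 (1) (count `≤ 2` and uniqueness of the
  side parameter), (3) (ball form), Proposition 2.9 (26), (27), and (34), all verbatim.

So the tree's three Theil-2006 named facts are reduced to: Lemma 2.7, Propositions 2.8, 2.9 and
(34) of the paper for FINITE configurations (Chapter 4 and [FJM]), plus two existence statements.
-/

noncomputable section

open scoped BigOperators Topology
open Filter Set Metric MeasureTheory

namespace Literature.MathematicalPhysics.StatisticalMechanics

namespace Theil2006

/-- **(44), uniformly in `L`, from the finite Chapter-4 geometry.** [cite: Theil2006, §3 (44) (preprint p. 13); §2.3–2.4; §4] -/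
theorem mainEstimate_periodic_of_geometry {K C₃₄ C₉ K₃ : ℝ} (hK : 0 ≤ K)
    (hC₃₄ : 0 ≤ C₃₄) (hC₉ : 0 ≤ C₉) (hK₃ : 0 ≤ K₃)
    (hgeom : ∃ α₂ : ℝ, 0 < α₂ ∧ ∀ ⦃α : ℝ⦄, 0 < α → α < α₂ → ∀ ⦃V : ℝ → ℝ⦄, IsAdmissible α V →
      ∀ {N : ℕ} (y : Fin N → Plane), (∀ i j : Fin N, i ≠ j → 1 - α < dist (y i) (y j)) →
      ∃ (TLall : Finset (Finset (Fin N))) (lamOf : Finset (Fin N) → ℝ),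
        (∀ T ∈ TLall, lamOf T ∈ distSet \ {1}) ∧ (∀ T ∈ TLall, T.card = 3) ∧
        (∀ T ∈ TLall, ∀ x ∈ T, ∀ x' ∈ T, x ≠ x' →
          |dist (y x) (y x') / lamOf T - 1| ≤ K * α) ∧
        (∀ p ∈ (Finset.univ : Finset (Fin N × Fin N)).filter (fun p => p.1 < p.2) \
            shortRangePairs α y, (TLall.filter fun T => p.1 ∈ T ∧ p.2 ∈ T).card ≤ 2) ∧
        (∀ p ∈ (Finset.univ : Finset (Fin N × Fin N)).filter (fun p => p.1 < p.2) \
            shortRangePairs α y, (TLall.filter fun T => p.1 ∈ T ∧ p.2 ∈ T).card < 2 →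
            ∃ b ∈ defects α y, dist (y p.1) (y b) ≤ K₃ * dist (y p.1) (y p.2)) ∧
        (∀ lam : ↥(distSet \ {1}),
          (0 ≤ ((unitSimplices α y).card : ℝ) -
              1 / (m (lam : ℝ) : ℝ) * (TLall.filter fun T => lamOf T = lam).card ∧
            ((unitSimplices α y).card : ℝ) -
              1 / (m (lam : ℝ) : ℝ) * (TLall.filter fun T => lamOf T = lam).card ≤
              C₉ * (lam : ℝ) ^ 2 * (defects α y).card) ∧
          (0 ≤ ∑ S ∈ unitSimplices α y, (volume (convexHull ℝ (y '' ↑S))).toReal -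
              1 / ((lam : ℝ) ^ 2 * m (lam : ℝ)) *
                ∑ T ∈ TLall.filter (fun T => lamOf T = lam),
                  (volume (convexHull ℝ (y '' ↑T))).toReal ∧
            ∑ S ∈ unitSimplices α y, (volume (convexHull ℝ (y '' ↑S))).toReal -
              1 / ((lam : ℝ) ^ 2 * m (lam : ℝ)) *
                ∑ T ∈ TLall.filter (fun T => lamOf T = lam),
                  (volume (convexHull ℝ (y '' ↑T))).toReal ≤
              C₉ * (lam : ℝ) ^ 2 * (defects α y).card) ∧
          (lam : ℝ)⁻¹ ^ 7 * ∑ T ∈ TLall.filter (fun T => lamOf T = lam),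
              (1 / 2 * ∑ p ∈ T.offDiag, (dist (y p.1) (y p.2) - lam) ^ 2) ≤
            C₃₄ * (lam : ℝ)⁻¹ ^ 5 * Real.log (lam : ℝ) * m (lam : ℝ) *
              ∑ p ∈ shortRangePairs α y, (dist (y p.1) (y p.2) - 1) ^ 2)) :
    ∃ α₁ : ℝ, 0 < α₁ ∧ ∀ α : ℝ, 0 < α → α < α₁ → ∀ V : ℝ → ℝ, IsAdmissible α V →
      ∃ C : ℝ, 0 < C ∧ ∀ L : ℕ, 0 < L → ∀ (X : Set (ℤ × ℤ)) (y : ℤ × ℤ → Plane),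
        IsPeriodicSet L X → IsPeriodic L y →
          (∀ x ∈ X, ∀ x' ∈ X, x ≠ x' → 1 - α < dist (y x) (y x')) →
            mainEstimateRHS C α V L X y ≤ relaxedPeriodicEnergy V L X y / 2 := by
  obtain ⟨α₂, hα₂, hgeom⟩ := hgeom
  obtain ⟨α₀, hα₀, h9⟩ := exists_mainLocalEstimate_finite hK hC₃₄ hC₉ hK₃
  refine ⟨min (min α₀ α₂) 1, by positivity, fun α hα hαlt V hV =>
    ⟨2, by norm_num, fun L hL X y hX hy h13 => ?_⟩⟩
  have hα0' : α < α₀ := hαlt.trans_le ((min_le_left _ _).trans (min_le_left _ _))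
  have hα2' : α < α₂ := hαlt.trans_le ((min_le_left _ _).trans (min_le_right _ _))
  have hα1 : α < 1 := hαlt.trans_le (min_le_right _ _)
  refine mainEstimate_periodic_of_finite hV hα1 hL hX hy h13 fun z hz => ?_
  obtain ⟨TLall, lamOf, hl, h3, h25, h281, h283, hgl⟩ := hgeom hα hα2' hV z hz
  exact h9 hα hα0' hV z hz TLall lamOf hl h3 h25 h281 h283 hgl


/-! ### The geometry package in the printed vocabulary (Definition 2.6, `IsCentredSimplex`) -/

section PrintedGeometry

variable {α : ℝ} {N : ℕ} {y : Fin N → Plane}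

/-- **From the printed statements to the geometry package.** For a configuration `y : X_N → ℝ²`:
Lemma 2.7 (25) for all `T ∈ 𝒯_λ(y)`, `λ ∈ Λ`; Proposition 2.8 (1) in its two parts — `#𝒯(x₁,x₂) ≤ 2`
for long pairs, and the uniqueness of the side parameter of a long simplex —; Proposition 2.8 (3)
in the printed ball form `y(∂X) ∩ B(½(y(x₁)+y(x₂)), 28|y(x₁)−y(x₂)|) ≠ ∅`; Proposition 2.9
(26), (27) as printed; and (34); THEN the labelled family `(longSimplices, sideOf)` satisfies the
hypotheses of `exists_mainLocalEstimate_finite` (with `K₃ = 29`).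
[cite: Theil2006, §2.3 Lemma 2.7, Propositions 2.8, 2.9; §2.4 (34) (preprint pp. 8–11)] -/
theorem geometryPackage_of_printed {K C₃₄ C₉ : ℝ}
    (h25 : ∀ lam ∈ distSet, ∀ T : Finset (Fin N), IsCentredSimplex α y lam T →
      ∀ x ∈ T, ∀ x' ∈ T, x ≠ x' → |dist (y x) (y x') / lam - 1| ≤ K * α)
    (h281 : ∀ p ∈ (Finset.univ : Finset (Fin N × Fin N)).filter (fun p => p.1 < p.2) \
        shortRangePairs α y, ((longSimplices α y).filter fun T => p.1 ∈ T ∧ p.2 ∈ T).card ≤ 2)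
    (huniq : ∀ (T : Finset (Fin N)) (lam lam' : ℝ), lam ∈ distSet \ {1} → lam' ∈ distSet \ {1} →
      IsCentredSimplex α y lam T → IsCentredSimplex α y lam' T → lam = lam')
    (h283 : ∀ p ∈ (Finset.univ : Finset (Fin N × Fin N)).filter (fun p => p.1 < p.2) \
        shortRangePairs α y, ((longSimplices α y).filter fun T => p.1 ∈ T ∧ p.2 ∈ T).card ≤ 1 →
        ∃ b ∈ defects α y, dist ((2 : ℝ)⁻¹ • (y p.1 + y p.2)) (y b) < 28 * dist (y p.1) (y p.2))
    (h26 : ∀ lam : ↥(distSet \ {1}),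
      0 ≤ ((unitSimplices α y).card : ℝ) - 1 / (m (lam : ℝ) : ℝ) * (simplicesAt α y lam).card ∧
        ((unitSimplices α y).card : ℝ) - 1 / (m (lam : ℝ) : ℝ) * (simplicesAt α y lam).card ≤
          C₉ * (lam : ℝ) ^ 2 * (defects α y).card)
    (h27 : ∀ lam : ↥(distSet \ {1}),
      0 ≤ ∑ S ∈ unitSimplices α y, (volume (convexHull ℝ (y '' ↑S))).toReal -
          1 / ((lam : ℝ) ^ 2 * m (lam : ℝ)) *
            ∑ T ∈ simplicesAt α y lam, (volume (convexHull ℝ (y '' ↑T))).toReal ∧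
        ∑ S ∈ unitSimplices α y, (volume (convexHull ℝ (y '' ↑S))).toReal -
          1 / ((lam : ℝ) ^ 2 * m (lam : ℝ)) *
            ∑ T ∈ simplicesAt α y lam, (volume (convexHull ℝ (y '' ↑T))).toReal ≤
          C₉ * (lam : ℝ) ^ 2 * (defects α y).card)
    (h34 : ∀ lam : ↥(distSet \ {1}),
      (lam : ℝ)⁻¹ ^ 7 * ∑ T ∈ simplicesAt α y lam,
          (1 / 2 * ∑ p ∈ T.offDiag, (dist (y p.1) (y p.2) - lam) ^ 2) ≤
        C₃₄ * (lam : ℝ)⁻¹ ^ 5 * Real.log (lam : ℝ) * m (lam : ℝ) *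
          ∑ p ∈ shortRangePairs α y, (dist (y p.1) (y p.2) - 1) ^ 2) :
    ∃ (TLall : Finset (Finset (Fin N))) (lamOf : Finset (Fin N) → ℝ),
      (∀ T ∈ TLall, lamOf T ∈ distSet \ {1}) ∧ (∀ T ∈ TLall, T.card = 3) ∧
      (∀ T ∈ TLall, ∀ x ∈ T, ∀ x' ∈ T, x ≠ x' → |dist (y x) (y x') / lamOf T - 1| ≤ K * α) ∧
      (∀ p ∈ (Finset.univ : Finset (Fin N × Fin N)).filter (fun p => p.1 < p.2) \
          shortRangePairs α y, (TLall.filter fun T => p.1 ∈ T ∧ p.2 ∈ T).card ≤ 2) ∧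
      (∀ p ∈ (Finset.univ : Finset (Fin N × Fin N)).filter (fun p => p.1 < p.2) \
          shortRangePairs α y, (TLall.filter fun T => p.1 ∈ T ∧ p.2 ∈ T).card < 2 →
          ∃ b ∈ defects α y, dist (y p.1) (y b) ≤ 29 * dist (y p.1) (y p.2)) ∧
      (∀ lam : ↥(distSet \ {1}),
        (0 ≤ ((unitSimplices α y).card : ℝ) -
            1 / (m (lam : ℝ) : ℝ) * (TLall.filter fun T => lamOf T = lam).card ∧
          ((unitSimplices α y).card : ℝ) -
            1 / (m (lam : ℝ) : ℝ) * (TLall.filter fun T => lamOf T = lam).card ≤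
            C₉ * (lam : ℝ) ^ 2 * (defects α y).card) ∧
        (0 ≤ ∑ S ∈ unitSimplices α y, (volume (convexHull ℝ (y '' ↑S))).toReal -
            1 / ((lam : ℝ) ^ 2 * m (lam : ℝ)) *
              ∑ T ∈ TLall.filter (fun T => lamOf T = lam),
                (volume (convexHull ℝ (y '' ↑T))).toReal ∧
          ∑ S ∈ unitSimplices α y, (volume (convexHull ℝ (y '' ↑S))).toReal -
            1 / ((lam : ℝ) ^ 2 * m (lam : ℝ)) *
              ∑ T ∈ TLall.filter (fun T => lamOf T = lam),
                (volume (convexHull ℝ (y '' ↑T))).toReal ≤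
            C₉ * (lam : ℝ) ^ 2 * (defects α y).card) ∧
        (lam : ℝ)⁻¹ ^ 7 * ∑ T ∈ TLall.filter (fun T => lamOf T = lam),
            (1 / 2 * ∑ p ∈ T.offDiag, (dist (y p.1) (y p.2) - lam) ^ 2) ≤
          C₃₄ * (lam : ℝ)⁻¹ ^ 5 * Real.log (lam : ℝ) * m (lam : ℝ) *
            ∑ p ∈ shortRangePairs α y, (dist (y p.1) (y p.2) - 1) ^ 2) := by
  classical
  -- the labelled family
  have hfilter : ∀ lam : ↥(distSet \ {1}),
      (longSimplices α y).filter (fun T => sideOf α y T = lam) = simplicesAt α y lam := by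
    intro lam
    ext T
    rw [Finset.mem_filter, mem_longSimplices, mem_simplicesAt]
    constructor
    · rintro ⟨h, hside⟩
      have hs := (sideOf_spec h).2
      rwa [hside] at hs
    · intro hT
      have h : ∃ lam' ∈ distSet \ {1}, IsCentredSimplex α y lam' T := ⟨lam, lam.2, hT⟩
      obtain ⟨hmem, hs⟩ := sideOf_spec h
      exact ⟨h, huniq T _ _ hmem lam.2 hs hT⟩
  refine ⟨longSimplices α y, sideOf α y, fun T hT => (sideOf_spec (mem_longSimplices.1 hT)).1,
    fun T hT => ?_, fun T hT x hx x' hx' hxx' => ?_, h281, fun p hp hlt => ?_, fun lam => ?_⟩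
  · obtain ⟨lam, -, hT'⟩ := mem_longSimplices.1 hT
    exact hT'.1.card_eq_three
  · obtain ⟨hmem, hs⟩ := sideOf_spec (mem_longSimplices.1 hT)
    exact h25 _ hmem.1 T hs x hx x' hx' hxx'
  · obtain ⟨b, hb, hdist⟩ := h283 p hp (by omega)
    refine ⟨b, hb, ?_⟩
    have hmid : dist (y p.1) ((2 : ℝ)⁻¹ • (y p.1 + y p.2)) = 2⁻¹ * dist (y p.1) (y p.2) := by
      have e : y p.1 - (2 : ℝ)⁻¹ • (y p.1 + y p.2) = (2 : ℝ)⁻¹ • (y p.1 - y p.2) := by module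
      rw [dist_eq_norm, e, norm_smul, Real.norm_eq_abs, abs_of_pos (by norm_num), ← dist_eq_norm]
    have htri := dist_triangle (y p.1) ((2 : ℝ)⁻¹ • (y p.1 + y p.2)) (y b)
    rw [hmid] at htri
    linarith [dist_nonneg (x := y p.1) (y := y p.2)]
  · rw [hfilter lam]
    exact ⟨h26 lam, h27 lam, h34 lam⟩

/-- **From the LOCAL (pointwise) statements of the appendix to the geometry package.** As
`geometryPackage_of_printed`, but with Proposition 2.9 (26), (27) replaced by the pointwise inputs
of their printed proof (Appendix pp. 24–25): (70) `s(x,λ) ≤ m(λ)s(x,1)`, the near-defect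
alternative `s(x,λ) < 6m(λ) ⇒ y(∂X) ∩ B̄(y(x), 28λ) ≠ ∅`, the partition identity
`meas(T) = Σ_{S∈𝒯₁} meas(S ∩ T)` and (72) (`≤` always, `≥` off the defects) — assembled by
`prop29_first_of_pointwise`, `prop29_second_of_pointwise` (`C₉ = 311904`); `0 < α ≤ 1/50`, (13).
[cite: Theil2006, §2.3 Lemma 2.7, Proposition 2.8; Appendix proof of Proposition 2.9 (69)–(72); §2.4 (34) (preprint pp. 8–11, 24–25)] -/
theorem geometryPackage_of_local {K C₅₂ C₂₈ : ℝ} (hα : 0 < α) (hα' : α ≤ 1 / 50) (hC₅₂ : 0 ≤ C₅₂)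
    (hsep : ∀ i j : Fin N, i ≠ j → 1 - α < dist (y i) (y j))
    (h25 : ∀ lam ∈ distSet, ∀ T : Finset (Fin N), IsCentredSimplex α y lam T →
      ∀ x ∈ T, ∀ x' ∈ T, x ≠ x' → |dist (y x) (y x') / lam - 1| ≤ K * α)
    (h281 : ∀ p ∈ (Finset.univ : Finset (Fin N × Fin N)).filter (fun p => p.1 < p.2) \
        shortRangePairs α y, ((longSimplices α y).filter fun T => p.1 ∈ T ∧ p.2 ∈ T).card ≤ 2)
    (huniq : ∀ (T : Finset (Fin N)) (lam lam' : ℝ), lam ∈ distSet \ {1} → lam' ∈ distSet \ {1} →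
      IsCentredSimplex α y lam T → IsCentredSimplex α y lam' T → lam = lam')
    (h283 : ∀ p ∈ (Finset.univ : Finset (Fin N × Fin N)).filter (fun p => p.1 < p.2) \
        shortRangePairs α y, ((longSimplices α y).filter fun T => p.1 ∈ T ∧ p.2 ∈ T).card ≤ 1 →
        ∃ b ∈ defects α y, dist ((2 : ℝ)⁻¹ • (y p.1 + y p.2)) (y b) < 28 * dist (y p.1) (y p.2))
    (h70 : ∀ lam : ↥(distSet \ {1}), ∀ x : Fin N,
      cornerCount α y lam x ≤ m (lam : ℝ) * cornerCount α y 1 x)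
    (hnear : ∀ lam : ↥(distSet \ {1}), ∀ x : Fin N, cornerCount α y lam x < 6 * m (lam : ℝ) →
      ∃ b ∈ defects α y, dist (y x) (y b) ≤ 28 * lam)
    (hpart : ∀ lam : ↥(distSet \ {1}), ∀ T ∈ simplicesAt α y lam,
      (volume (convexHull ℝ (y '' ↑T))).toReal =
        ∑ S ∈ unitSimplices α y, (volume (convexHull ℝ (y '' ↑S) ∩ convexHull ℝ (y '' ↑T))).toReal)
    (h72 : ∀ lam : ↥(distSet \ {1}), ∀ S ∈ unitSimplices α y,
      ∑ T ∈ simplicesAt α y lam,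
          (volume (convexHull ℝ (y '' ↑S) ∩ convexHull ℝ (y '' ↑T))).toReal ≤
        m (lam : ℝ) * (lam : ℝ) ^ 2 * (volume (convexHull ℝ (y '' ↑S))).toReal)
    (h72eq : ∀ lam : ↥(distSet \ {1}), ∀ S ∈ unitSimplices α y,
      (∀ x ∈ S, ∀ b ∈ defects α y, 28 * (lam : ℝ) < dist (y x) (y b)) →
      m (lam : ℝ) * (lam : ℝ) ^ 2 * (volume (convexHull ℝ (y '' ↑S))).toReal ≤
        ∑ T ∈ simplicesAt α y lam,
          (volume (convexHull ℝ (y '' ↑S) ∩ convexHull ℝ (y '' ↑T))).toReal)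
    (hrig : ∀ lam : ↥(distSet \ {1}), ∃ ω : Finset (Fin N) → Finset (Fin N),
      (∀ T ∈ simplicesAt α y lam,
        1 / 2 * ∑ p ∈ T.offDiag, (dist (y p.1) (y p.2) - lam) ^ 2 ≤
          C₅₂ * Real.log (lam : ℝ) *
            ∑ p ∈ (shortRangePairs α y).filter (fun p => p.1 ∈ ω T ∧ p.2 ∈ ω T),
              (dist (y p.1) (y p.2) - 1) ^ 2) ∧
      (∀ x : Fin N, (((simplicesAt α y lam).filter fun T => x ∈ ω T).card : ℝ) ≤
        C₂₈ * (lam : ℝ) ^ 2 * m (lam : ℝ))) :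
    ∃ (TLall : Finset (Finset (Fin N))) (lamOf : Finset (Fin N) → ℝ),
      (∀ T ∈ TLall, lamOf T ∈ distSet \ {1}) ∧ (∀ T ∈ TLall, T.card = 3) ∧
      (∀ T ∈ TLall, ∀ x ∈ T, ∀ x' ∈ T, x ≠ x' → |dist (y x) (y x') / lamOf T - 1| ≤ K * α) ∧
      (∀ p ∈ (Finset.univ : Finset (Fin N × Fin N)).filter (fun p => p.1 < p.2) \
          shortRangePairs α y, (TLall.filter fun T => p.1 ∈ T ∧ p.2 ∈ T).card ≤ 2) ∧
      (∀ p ∈ (Finset.univ : Finset (Fin N × Fin N)).filter (fun p => p.1 < p.2) \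
          shortRangePairs α y, (TLall.filter fun T => p.1 ∈ T ∧ p.2 ∈ T).card < 2 →
          ∃ b ∈ defects α y, dist (y p.1) (y b) ≤ 29 * dist (y p.1) (y p.2)) ∧
      (∀ lam : ↥(distSet \ {1}),
        (0 ≤ ((unitSimplices α y).card : ℝ) -
            1 / (m (lam : ℝ) : ℝ) * (TLall.filter fun T => lamOf T = lam).card ∧
          ((unitSimplices α y).card : ℝ) -
            1 / (m (lam : ℝ) : ℝ) * (TLall.filter fun T => lamOf T = lam).card ≤
            311904 * (lam : ℝ) ^ 2 * (defects α y).card) ∧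
        (0 ≤ ∑ S ∈ unitSimplices α y, (volume (convexHull ℝ (y '' ↑S))).toReal -
            1 / ((lam : ℝ) ^ 2 * m (lam : ℝ)) *
              ∑ T ∈ TLall.filter (fun T => lamOf T = lam),
                (volume (convexHull ℝ (y '' ↑T))).toReal ∧
          ∑ S ∈ unitSimplices α y, (volume (convexHull ℝ (y '' ↑S))).toReal -
            1 / ((lam : ℝ) ^ 2 * m (lam : ℝ)) *
              ∑ T ∈ TLall.filter (fun T => lamOf T = lam),
                (volume (convexHull ℝ (y '' ↑T))).toReal ≤
            311904 * (lam : ℝ) ^ 2 * (defects α y).card) ∧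
        (lam : ℝ)⁻¹ ^ 7 * ∑ T ∈ TLall.filter (fun T => lamOf T = lam),
            (1 / 2 * ∑ p ∈ T.offDiag, (dist (y p.1) (y p.2) - lam) ^ 2) ≤
          C₅₂ * C₂₈ * (lam : ℝ)⁻¹ ^ 5 * Real.log (lam : ℝ) * m (lam : ℝ) *
            ∑ p ∈ shortRangePairs α y, (dist (y p.1) (y p.2) - 1) ^ 2) := by
  have hB : (0 : ℝ) ≤ (defects α y).card := Nat.cast_nonneg _
  have hl1 : ∀ lam : ↥(distSet \ {1}), (1 : ℝ) ≤ (lam : ℝ) := fun lam => by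
    have h3 := sqrt_three_le_of_mem_distSet lam.2.1 fun h => lam.2.2 h
    have : (1 : ℝ) ≤ √3 := by
      rw [show (1 : ℝ) = √1 by simp]; exact Real.sqrt_le_sqrt (by norm_num)
    linarith
  refine geometryPackage_of_printed h25 h281 huniq h283 (fun lam => ?_) (fun lam => ?_)
    (fun lam => ?_)
  · obtain ⟨h1, h2⟩ :=
      prop29_first_of_pointwise hα hα' hsep (hl1 lam) lam.2.1.2 (h70 lam) (hnear lam)
    exact ⟨h1, h2.trans (by nlinarith [sq_nonneg (lam : ℝ)])⟩
  · exact prop29_second_of_pointwise hα hα' hsep (hl1 lam) lam.2.1.2 (hpart lam) (h72 lam)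
      (h72eq lam)
  · obtain ⟨ω, h52, h28⟩ := hrig lam
    exact h34_of_rigidity_of_multiplicity (hl1 lam) hC₅₂ ω h52 h28

end PrintedGeometry

end Theil2006

open Theil2006 MeasureTheory in
/-- **Theil 2006 — Theorem 1.1, Theorem 1.2 (corrected, up to a rigid motion) and Corollary 1.3
from the finite Chapter-4 geometry and the two existence statements.** The three conjuncts are
the tree's named facts `Theil2006_groundStateEnergy`, `Theil2006_periodicGroundStates_upToRotation`
(the corrected Theorem 1.2 of `Theil2006Periodic.lean`) and `Theil2006_dirichletGroundStates`.
[cite: Theil2006, §1 Theorems 1.1, 1.2, Corollary 1.3; §2–§4] -/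
theorem Theil2006_mainTheorems_of_geometry {K C₃₄ C₉ K₃ : ℝ} (hK : 0 ≤ K)
    (hC₃₄ : 0 ≤ C₃₄) (hC₉ : 0 ≤ C₉) (hK₃ : 0 ≤ K₃)
    (hgeom : ∃ α₂ : ℝ, 0 < α₂ ∧ ∀ ⦃α : ℝ⦄, 0 < α → α < α₂ → ∀ ⦃V : ℝ → ℝ⦄, IsAdmissible α V →
      ∀ {N : ℕ} (y : Fin N → Plane), (∀ i j : Fin N, i ≠ j → 1 - α < dist (y i) (y j)) →
      ∃ (TLall : Finset (Finset (Fin N))) (lamOf : Finset (Fin N) → ℝ),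
        (∀ T ∈ TLall, lamOf T ∈ distSet \ {1}) ∧ (∀ T ∈ TLall, T.card = 3) ∧
        (∀ T ∈ TLall, ∀ x ∈ T, ∀ x' ∈ T, x ≠ x' →
          |dist (y x) (y x') / lamOf T - 1| ≤ K * α) ∧
        (∀ p ∈ (Finset.univ : Finset (Fin N × Fin N)).filter (fun p => p.1 < p.2) \
            shortRangePairs α y, (TLall.filter fun T => p.1 ∈ T ∧ p.2 ∈ T).card ≤ 2) ∧
        (∀ p ∈ (Finset.univ : Finset (Fin N × Fin N)).filter (fun p => p.1 < p.2) \
            shortRangePairs α y, (TLall.filter fun T => p.1 ∈ T ∧ p.2 ∈ T).card < 2 →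
            ∃ b ∈ defects α y, dist (y p.1) (y b) ≤ K₃ * dist (y p.1) (y p.2)) ∧
        (∀ lam : ↥(distSet \ {1}),
          (0 ≤ ((unitSimplices α y).card : ℝ) -
              1 / (m (lam : ℝ) : ℝ) * (TLall.filter fun T => lamOf T = lam).card ∧
            ((unitSimplices α y).card : ℝ) -
              1 / (m (lam : ℝ) : ℝ) * (TLall.filter fun T => lamOf T = lam).card ≤
              C₉ * (lam : ℝ) ^ 2 * (defects α y).card) ∧
          (0 ≤ ∑ S ∈ unitSimplices α y, (volume (convexHull ℝ (y '' ↑S))).toReal -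
              1 / ((lam : ℝ) ^ 2 * m (lam : ℝ)) *
                ∑ T ∈ TLall.filter (fun T => lamOf T = lam),
                  (volume (convexHull ℝ (y '' ↑T))).toReal ∧
            ∑ S ∈ unitSimplices α y, (volume (convexHull ℝ (y '' ↑S))).toReal -
              1 / ((lam : ℝ) ^ 2 * m (lam : ℝ)) *
                ∑ T ∈ TLall.filter (fun T => lamOf T = lam),
                  (volume (convexHull ℝ (y '' ↑T))).toReal ≤
              C₉ * (lam : ℝ) ^ 2 * (defects α y).card) ∧
          (lam : ℝ)⁻¹ ^ 7 * ∑ T ∈ TLall.filter (fun T => lamOf T = lam),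
              (1 / 2 * ∑ p ∈ T.offDiag, (dist (y p.1) (y p.2) - lam) ^ 2) ≤
            C₃₄ * (lam : ℝ)⁻¹ ^ 5 * Real.log (lam : ℝ) * m (lam : ℝ) *
              ∑ p ∈ shortRangePairs α y, (dist (y p.1) (y p.2) - 1) ^ 2))
    (hexPer : ∃ α₂ : ℝ, 0 < α₂ ∧ ∀ α : ℝ, 0 < α → α < α₂ → ∀ L : ℕ, 0 < L → ∀ V : ℝ → ℝ,
      IsAdmissible α V → ∃ (X₀ : Set (ℤ × ℤ)) (y₀ : ℤ × ℤ → Plane), IsRelaxedMinimizer V L X₀ y₀)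
    (hexDir : ∃ α₃ : ℝ, 0 < α₃ ∧ ∀ α : ℝ, 0 < α → α < α₃ → ∀ V : ℝ → ℝ, IsAdmissible α V →
      ∀ A : Finset (ℤ × ℤ), ∃ (A' : Finset (ℤ × ℤ)) (y : ℤ × ℤ → Plane),
        IsRelaxedDirichletMinimizer V A A' y) :
    Theil2006_groundStateEnergy ∧ Theil2006_periodicGroundStates_upToRotation ∧
      Theil2006_dirichletGroundStates :=
  ⟨Theil2006_groundStateEnergy_of_geometry hK hC₃₄ hC₉ hK₃ hgeom,
    Theil2006_periodic_and_dirichletGroundStates_of_mainEstimate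
      (mainEstimate_periodic_of_geometry hK hC₃₄ hC₉ hK₃ hgeom) hexPer hexDir⟩


open Theil2006 MeasureTheory in
/-- **For continuous potentials no existence hypothesis is needed.** From the finite Chapter-4
geometry alone: for all small `α` and every `V` satisfying (1)–(5) that is continuous on `[0, ∞)`,
(a) **Theorem 1.2 (corrected)**: every ground state `y ∈ Y_L^per` of `E_L^per` (`L ≥ 1`)
satisfies (42), (43) and `RΩ + τ = A₂` for a rotation `R` and a translation `τ`
(`exists_rotation_range_eq_of_mainEstimate_of_continuousOn` of the tree with (44) from
`mainEstimate_periodic_of_geometry`); (b) **Corollary 1.3**: every ground state of `E_𝒜` over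
`Y_𝒜^Dir` has `{y(x)} = A₂` (`range_eq_triangularLattice_of_mainEstimate_of_continuousOn`).
[cite: Theil2006, §1 Theorem 1.2, Corollary 1.3; §3 (preprint pp. 13–15)] -/
theorem Theil2006_continuous_of_geometry {K C₃₄ C₉ K₃ : ℝ} (hK : 0 ≤ K)
    (hC₃₄ : 0 ≤ C₃₄) (hC₉ : 0 ≤ C₉) (hK₃ : 0 ≤ K₃)
    (hgeom : ∃ α₂ : ℝ, 0 < α₂ ∧ ∀ ⦃α : ℝ⦄, 0 < α → α < α₂ → ∀ ⦃V : ℝ → ℝ⦄, IsAdmissible α V →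
      ∀ {N : ℕ} (y : Fin N → Plane), (∀ i j : Fin N, i ≠ j → 1 - α < dist (y i) (y j)) →
      ∃ (TLall : Finset (Finset (Fin N))) (lamOf : Finset (Fin N) → ℝ),
        (∀ T ∈ TLall, lamOf T ∈ distSet \ {1}) ∧ (∀ T ∈ TLall, T.card = 3) ∧
        (∀ T ∈ TLall, ∀ x ∈ T, ∀ x' ∈ T, x ≠ x' →
          |dist (y x) (y x') / lamOf T - 1| ≤ K * α) ∧
        (∀ p ∈ (Finset.univ : Finset (Fin N × Fin N)).filter (fun p => p.1 < p.2) \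
            shortRangePairs α y, (TLall.filter fun T => p.1 ∈ T ∧ p.2 ∈ T).card ≤ 2) ∧
        (∀ p ∈ (Finset.univ : Finset (Fin N × Fin N)).filter (fun p => p.1 < p.2) \
            shortRangePairs α y, (TLall.filter fun T => p.1 ∈ T ∧ p.2 ∈ T).card < 2 →
            ∃ b ∈ defects α y, dist (y p.1) (y b) ≤ K₃ * dist (y p.1) (y p.2)) ∧
        (∀ lam : ↥(distSet \ {1}),
          (0 ≤ ((unitSimplices α y).card : ℝ) -
              1 / (m (lam : ℝ) : ℝ) * (TLall.filter fun T => lamOf T = lam).card ∧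
            ((unitSimplices α y).card : ℝ) -
              1 / (m (lam : ℝ) : ℝ) * (TLall.filter fun T => lamOf T = lam).card ≤
              C₉ * (lam : ℝ) ^ 2 * (defects α y).card) ∧
          (0 ≤ ∑ S ∈ unitSimplices α y, (volume (convexHull ℝ (y '' ↑S))).toReal -
              1 / ((lam : ℝ) ^ 2 * m (lam : ℝ)) *
                ∑ T ∈ TLall.filter (fun T => lamOf T = lam),
                  (volume (convexHull ℝ (y '' ↑T))).toReal ∧
            ∑ S ∈ unitSimplices α y, (volume (convexHull ℝ (y '' ↑S))).toReal -
              1 / ((lam : ℝ) ^ 2 * m (lam : ℝ)) *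
                ∑ T ∈ TLall.filter (fun T => lamOf T = lam),
                  (volume (convexHull ℝ (y '' ↑T))).toReal ≤
              C₉ * (lam : ℝ) ^ 2 * (defects α y).card) ∧
          (lam : ℝ)⁻¹ ^ 7 * ∑ T ∈ TLall.filter (fun T => lamOf T = lam),
              (1 / 2 * ∑ p ∈ T.offDiag, (dist (y p.1) (y p.2) - lam) ^ 2) ≤
            C₃₄ * (lam : ℝ)⁻¹ ^ 5 * Real.log (lam : ℝ) * m (lam : ℝ) *
              ∑ p ∈ shortRangePairs α y, (dist (y p.1) (y p.2) - 1) ^ 2)) :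
    ∃ α₀ : ℝ, 0 < α₀ ∧ ∀ α : ℝ, 0 < α → α < α₀ → ∀ V : ℝ → ℝ, IsAdmissible α V →
      ContinuousOn V (Ici 0) →
      (∀ L : ℕ, 0 < L → ∀ y : ℤ × ℤ → Plane, IsPeriodic L y →
        (∀ y' : ℤ × ℤ → Plane, IsPeriodic L y' → periodicEnergy V L y ≤ periodicEnergy V L y') →
          (∀ x x', y x ≠ y x' → 1 ≤ dist (y x) (y x')) ∧
            (∀ x, {p ∈ Set.range y | dist (y x) p ≤ 1}.ncard = 7) ∧
              ∃ R : Plane ≃ₗᵢ[ℝ] Plane,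
                LinearMap.det (R.toLinearEquiv : Plane →ₗ[ℝ] Plane) = 1 ∧
                  ∃ τ : Plane, Set.range (fun k => R (y k) + τ) = triangularLattice) ∧
      (∀ (A : Finset (ℤ × ℤ)) (y : ℤ × ℤ → Plane), IsClampedOutside A y →
        (∀ y' : ℤ × ℤ → Plane, IsClampedOutside A y' → dirichletEnergy V A y ≤ dirichletEnergy V A y') →
          Set.range y = triangularLattice) := by
  have h44 := mainEstimate_periodic_of_geometry hK hC₃₄ hC₉ hK₃ hgeom
  obtain ⟨αD, hαD, -, hDir⟩ := range_eq_triangularLattice_of_mainEstimate_of_continuousOn h44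
  obtain ⟨αP, hαP, -, hPer⟩ := exists_rotation_range_eq_of_mainEstimate_of_continuousOn
  obtain ⟨α₁, hα₁, h44'⟩ := h44
  refine ⟨min (min αD αP) α₁, by positivity, fun α hα hαlt V hV hVc => ⟨?_, ?_⟩⟩
  · intro L hL y hy hground
    have hαP' : α < αP := hαlt.trans_le ((min_le_left _ _).trans (min_le_right _ _))
    have hα1' : α < α₁ := hαlt.trans_le (min_le_right _ _)
    obtain ⟨C, hC, hCmain⟩ := h44' α hα hα1' V hV
    exact hPer α hα hαP' L hL V hV hVc C hC (hCmain L hL) y hy hground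
  · intro A y hy hmin
    have hαD' : α < αD := hαlt.trans_le ((min_le_left _ _).trans (min_le_left _ _))
    exact hDir α hα hαD' V hV hVc A y hy hmin


open Theil2006 MeasureTheory in
/-- **Theil 2006 — the three main results from the PRINTED Chapter-4 statements.** If there are
constants `K, C₃₄, C₉` and `α₂ > 0` such that for all `α ∈ (0, α₂)`, all `V` satisfying (1)–(5)
and all finite configurations `y : X_N → ℝ²` with (13): Lemma 2.7 (25) holds for every
`T ∈ 𝒯_λ(y)` (`Theil2006.IsCentredSimplex`: Definition 2.6 + centring clause); Proposition 2.8 (1) holds for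
long pairs (`#𝒯(x₁,x₂) ≤ 2`, and the side parameter of a long simplex is unique); Proposition 2.8
(3) holds for long pairs (`#𝒯(x₁,x₂) ≤ 1 ⇒ y(∂X) ∩ B(½(y(x₁)+y(x₂)), 28|y(x₁)−y(x₂)|) ≠ ∅`);
Proposition 2.9 (26), (27) hold for every `λ ∈ Λ ∖ {1}`; and (34) holds for every `λ ∈ Λ ∖ {1}`
— THEN Theorem 1.1, Theorem 1.2 (corrected) and Corollary 1.3 hold, given the existence of relaxed
periodic and Dirichlet minimizers (both proved for `V` continuous on `[0, ∞)`).
[cite: Theil2006, §2.3 Lemma 2.7, Propositions 2.8, 2.9, §2.4 (34), §4 (preprint pp. 8–11, 16–24)] -/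
theorem Theil2006_mainTheorems_of_printedGeometry {K C₃₄ C₉ : ℝ} (hK : 0 ≤ K)
    (hC₃₄ : 0 ≤ C₃₄) (hC₉ : 0 ≤ C₉)
    (hprinted : ∃ α₂ : ℝ, 0 < α₂ ∧ ∀ ⦃α : ℝ⦄, 0 < α → α < α₂ → ∀ ⦃V : ℝ → ℝ⦄, IsAdmissible α V →
      ∀ {N : ℕ} (y : Fin N → Plane), (∀ i j : Fin N, i ≠ j → 1 - α < dist (y i) (y j)) →
      (∀ lam ∈ distSet, ∀ T : Finset (Fin N), IsCentredSimplex α y lam T →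
        ∀ x ∈ T, ∀ x' ∈ T, x ≠ x' → |dist (y x) (y x') / lam - 1| ≤ K * α) ∧
      (∀ p ∈ (Finset.univ : Finset (Fin N × Fin N)).filter (fun p => p.1 < p.2) \
          shortRangePairs α y, ((longSimplices α y).filter fun T => p.1 ∈ T ∧ p.2 ∈ T).card ≤ 2) ∧
      (∀ (T : Finset (Fin N)) (lam lam' : ℝ), lam ∈ distSet \ {1} → lam' ∈ distSet \ {1} →
        IsCentredSimplex α y lam T → IsCentredSimplex α y lam' T → lam = lam') ∧
      (∀ p ∈ (Finset.univ : Finset (Fin N × Fin N)).filter (fun p => p.1 < p.2) \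
          shortRangePairs α y, ((longSimplices α y).filter fun T => p.1 ∈ T ∧ p.2 ∈ T).card ≤ 1 →
          ∃ b ∈ defects α y, dist ((2 : ℝ)⁻¹ • (y p.1 + y p.2)) (y b) < 28 * dist (y p.1) (y p.2)) ∧
      (∀ lam : ↥(distSet \ {1}),
        0 ≤ ((unitSimplices α y).card : ℝ) - 1 / (m (lam : ℝ) : ℝ) * (simplicesAt α y lam).card ∧
          ((unitSimplices α y).card : ℝ) - 1 / (m (lam : ℝ) : ℝ) * (simplicesAt α y lam).card ≤
            C₉ * (lam : ℝ) ^ 2 * (defects α y).card) ∧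
      (∀ lam : ↥(distSet \ {1}),
        0 ≤ ∑ S ∈ unitSimplices α y, (volume (convexHull ℝ (y '' ↑S))).toReal -
            1 / ((lam : ℝ) ^ 2 * m (lam : ℝ)) *
              ∑ T ∈ simplicesAt α y lam, (volume (convexHull ℝ (y '' ↑T))).toReal ∧
          ∑ S ∈ unitSimplices α y, (volume (convexHull ℝ (y '' ↑S))).toReal -
            1 / ((lam : ℝ) ^ 2 * m (lam : ℝ)) *
              ∑ T ∈ simplicesAt α y lam, (volume (convexHull ℝ (y '' ↑T))).toReal ≤
            C₉ * (lam : ℝ) ^ 2 * (defects α y).card) ∧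
      (∀ lam : ↥(distSet \ {1}),
        (lam : ℝ)⁻¹ ^ 7 * ∑ T ∈ simplicesAt α y lam,
            (1 / 2 * ∑ p ∈ T.offDiag, (dist (y p.1) (y p.2) - lam) ^ 2) ≤
          C₃₄ * (lam : ℝ)⁻¹ ^ 5 * Real.log (lam : ℝ) * m (lam : ℝ) *
            ∑ p ∈ shortRangePairs α y, (dist (y p.1) (y p.2) - 1) ^ 2))
    (hexPer : ∃ α₂ : ℝ, 0 < α₂ ∧ ∀ α : ℝ, 0 < α → α < α₂ → ∀ L : ℕ, 0 < L → ∀ V : ℝ → ℝ,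
      IsAdmissible α V → ∃ (X₀ : Set (ℤ × ℤ)) (y₀ : ℤ × ℤ → Plane), IsRelaxedMinimizer V L X₀ y₀)
    (hexDir : ∃ α₃ : ℝ, 0 < α₃ ∧ ∀ α : ℝ, 0 < α → α < α₃ → ∀ V : ℝ → ℝ, IsAdmissible α V →
      ∀ A : Finset (ℤ × ℤ), ∃ (A' : Finset (ℤ × ℤ)) (y : ℤ × ℤ → Plane),
        IsRelaxedDirichletMinimizer V A A' y) :
    Theil2006_groundStateEnergy ∧ Theil2006_periodicGroundStates_upToRotation ∧
      Theil2006_dirichletGroundStates := by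
  obtain ⟨α₂, hα₂, hpr⟩ := hprinted
  refine Theil2006_mainTheorems_of_geometry (K₃ := 29) hK hC₃₄ hC₉ (by norm_num)
    ⟨α₂, hα₂, fun α hα hαlt V hV N y hsep => ?_⟩ hexPer hexDir
  obtain ⟨h25, h281, huniq, h283, h26, h27, h34⟩ := hpr hα hαlt hV y hsep
  exact geometryPackage_of_printed h25 h281 huniq h283 h26 h27 h34


open Theil2006 MeasureTheory in
/-- **Continuous potentials, printed vocabulary**: from the printed Chapter-4 statements alone,
for every `V` satisfying (1)–(5) and continuous on `[0, ∞)` (small `α`): the conclusions of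
Theorem 1.2 (corrected) for every periodic ground state and of Corollary 1.3 for every Dirichlet
ground state. [cite: Theil2006, §1 Theorem 1.2, Corollary 1.3; §2.3; §4] -/
theorem Theil2006_continuous_of_printedGeometry {K C₃₄ C₉ : ℝ} (hK : 0 ≤ K)
    (hC₃₄ : 0 ≤ C₃₄) (hC₉ : 0 ≤ C₉)
    (hprinted : ∃ α₂ : ℝ, 0 < α₂ ∧ ∀ ⦃α : ℝ⦄, 0 < α → α < α₂ → ∀ ⦃V : ℝ → ℝ⦄, IsAdmissible α V →
      ∀ {N : ℕ} (y : Fin N → Plane), (∀ i j : Fin N, i ≠ j → 1 - α < dist (y i) (y j)) →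
      (∀ lam ∈ distSet, ∀ T : Finset (Fin N), IsCentredSimplex α y lam T →
        ∀ x ∈ T, ∀ x' ∈ T, x ≠ x' → |dist (y x) (y x') / lam - 1| ≤ K * α) ∧
      (∀ p ∈ (Finset.univ : Finset (Fin N × Fin N)).filter (fun p => p.1 < p.2) \
          shortRangePairs α y, ((longSimplices α y).filter fun T => p.1 ∈ T ∧ p.2 ∈ T).card ≤ 2) ∧
      (∀ (T : Finset (Fin N)) (lam lam' : ℝ), lam ∈ distSet \ {1} → lam' ∈ distSet \ {1} →
        IsCentredSimplex α y lam T → IsCentredSimplex α y lam' T → lam = lam') ∧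
      (∀ p ∈ (Finset.univ : Finset (Fin N × Fin N)).filter (fun p => p.1 < p.2) \
          shortRangePairs α y, ((longSimplices α y).filter fun T => p.1 ∈ T ∧ p.2 ∈ T).card ≤ 1 →
          ∃ b ∈ defects α y, dist ((2 : ℝ)⁻¹ • (y p.1 + y p.2)) (y b) < 28 * dist (y p.1) (y p.2)) ∧
      (∀ lam : ↥(distSet \ {1}),
        0 ≤ ((unitSimplices α y).card : ℝ) - 1 / (m (lam : ℝ) : ℝ) * (simplicesAt α y lam).card ∧
          ((unitSimplices α y).card : ℝ) - 1 / (m (lam : ℝ) : ℝ) * (simplicesAt α y lam).card ≤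
            C₉ * (lam : ℝ) ^ 2 * (defects α y).card) ∧
      (∀ lam : ↥(distSet \ {1}),
        0 ≤ ∑ S ∈ unitSimplices α y, (volume (convexHull ℝ (y '' ↑S))).toReal -
            1 / ((lam : ℝ) ^ 2 * m (lam : ℝ)) *
              ∑ T ∈ simplicesAt α y lam, (volume (convexHull ℝ (y '' ↑T))).toReal ∧
          ∑ S ∈ unitSimplices α y, (volume (convexHull ℝ (y '' ↑S))).toReal -
            1 / ((lam : ℝ) ^ 2 * m (lam : ℝ)) *
              ∑ T ∈ simplicesAt α y lam, (volume (convexHull ℝ (y '' ↑T))).toReal ≤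
            C₉ * (lam : ℝ) ^ 2 * (defects α y).card) ∧
      (∀ lam : ↥(distSet \ {1}),
        (lam : ℝ)⁻¹ ^ 7 * ∑ T ∈ simplicesAt α y lam,
            (1 / 2 * ∑ p ∈ T.offDiag, (dist (y p.1) (y p.2) - lam) ^ 2) ≤
          C₃₄ * (lam : ℝ)⁻¹ ^ 5 * Real.log (lam : ℝ) * m (lam : ℝ) *
            ∑ p ∈ shortRangePairs α y, (dist (y p.1) (y p.2) - 1) ^ 2)) :
    ∃ α₀ : ℝ, 0 < α₀ ∧ ∀ α : ℝ, 0 < α → α < α₀ → ∀ V : ℝ → ℝ, IsAdmissible α V →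
      ContinuousOn V (Ici 0) →
      (∀ L : ℕ, 0 < L → ∀ y : ℤ × ℤ → Plane, IsPeriodic L y →
        (∀ y' : ℤ × ℤ → Plane, IsPeriodic L y' → periodicEnergy V L y ≤ periodicEnergy V L y') →
          (∀ x x', y x ≠ y x' → 1 ≤ dist (y x) (y x')) ∧
            (∀ x, {p ∈ Set.range y | dist (y x) p ≤ 1}.ncard = 7) ∧
              ∃ R : Plane ≃ₗᵢ[ℝ] Plane,
                LinearMap.det (R.toLinearEquiv : Plane →ₗ[ℝ] Plane) = 1 ∧
                  ∃ τ : Plane, Set.range (fun k => R (y k) + τ) = triangularLattice) ∧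
      (∀ (A : Finset (ℤ × ℤ)) (y : ℤ × ℤ → Plane), IsClampedOutside A y →
        (∀ y' : ℤ × ℤ → Plane, IsClampedOutside A y' → dirichletEnergy V A y ≤ dirichletEnergy V A y') →
          Set.range y = triangularLattice) := by
  obtain ⟨α₂, hα₂, hpr⟩ := hprinted
  refine Theil2006_continuous_of_geometry (K₃ := 29) hK hC₃₄ hC₉ (by norm_num)
    ⟨α₂, hα₂, fun α hα hαlt V hV N y hsep => ?_⟩
  obtain ⟨h25, h281, huniq, h283, h26, h27, h34⟩ := hpr hα hαlt hV y hsep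
  exact geometryPackage_of_printed h25 h281 huniq h283 h26 h27 h34


open Theil2006 MeasureTheory in
/-- **Theil 2006 — the three main results from the LOCAL appendix statements.** As
`Theil2006_mainTheorems_of_printedGeometry`, with Proposition 2.9 (26), (27) replaced by the four
pointwise inputs of their printed proof (Appendix pp. 24–25: (70), the near-defect alternative,
the partition identity, (72)), so that every remaining hypothesis is a LOCAL statement about one
simplex / one particle / one pair — in the print each is read off Proposition 4.8 (reference
configurations) resp. Proposition 4.3 ((34)).
[cite: Theil2006, §2.3–2.4, Appendix Propositions 4.3, 4.8 and pp. 23–25 (preprint)] -/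
theorem Theil2006_mainTheorems_of_localGeometry {K C₅₂ C₂₈ : ℝ} (hK : 0 ≤ K) (hC₅₂ : 0 ≤ C₅₂)
    (hC₂₈ : 0 ≤ C₂₈)
    (hlocal : ∃ α₂ : ℝ, 0 < α₂ ∧ ∀ ⦃α : ℝ⦄, 0 < α → α < α₂ → ∀ ⦃V : ℝ → ℝ⦄, IsAdmissible α V →
      ∀ {N : ℕ} (y : Fin N → Plane), (∀ i j : Fin N, i ≠ j → 1 - α < dist (y i) (y j)) →
      (∀ lam ∈ distSet, ∀ T : Finset (Fin N), IsCentredSimplex α y lam T →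
      ∀ x ∈ T, ∀ x' ∈ T, x ≠ x' → |dist (y x) (y x') / lam - 1| ≤ K * α) ∧
      (∀ p ∈ (Finset.univ : Finset (Fin N × Fin N)).filter (fun p => p.1 < p.2) \
        shortRangePairs α y, ((longSimplices α y).filter fun T => p.1 ∈ T ∧ p.2 ∈ T).card ≤ 2) ∧
      (∀ (T : Finset (Fin N)) (lam lam' : ℝ), lam ∈ distSet \ {1} → lam' ∈ distSet \ {1} →
      IsCentredSimplex α y lam T → IsCentredSimplex α y lam' T → lam = lam') ∧
      (∀ p ∈ (Finset.univ : Finset (Fin N × Fin N)).filter (fun p => p.1 < p.2) \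
        shortRangePairs α y, ((longSimplices α y).filter fun T => p.1 ∈ T ∧ p.2 ∈ T).card ≤ 1 →
        ∃ b ∈ defects α y, dist ((2 : ℝ)⁻¹ • (y p.1 + y p.2)) (y b) < 28 * dist (y p.1) (y p.2)) ∧
      (∀ lam : ↥(distSet \ {1}), ∀ x : Fin N,
      cornerCount α y lam x ≤ m (lam : ℝ) * cornerCount α y 1 x) ∧
      (∀ lam : ↥(distSet \ {1}), ∀ x : Fin N, cornerCount α y lam x < 6 * m (lam : ℝ) →
      ∃ b ∈ defects α y, dist (y x) (y b) ≤ 28 * lam) ∧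
      (∀ lam : ↥(distSet \ {1}), ∀ T ∈ simplicesAt α y lam,
      (volume (convexHull ℝ (y '' ↑T))).toReal =
        ∑ S ∈ unitSimplices α y, (volume (convexHull ℝ (y '' ↑S) ∩ convexHull ℝ (y '' ↑T))).toReal) ∧
      (∀ lam : ↥(distSet \ {1}), ∀ S ∈ unitSimplices α y,
      ∑ T ∈ simplicesAt α y lam,
          (volume (convexHull ℝ (y '' ↑S) ∩ convexHull ℝ (y '' ↑T))).toReal ≤
        m (lam : ℝ) * (lam : ℝ) ^ 2 * (volume (convexHull ℝ (y '' ↑S))).toReal) ∧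
      (∀ lam : ↥(distSet \ {1}), ∀ S ∈ unitSimplices α y,
      (∀ x ∈ S, ∀ b ∈ defects α y, 28 * (lam : ℝ) < dist (y x) (y b)) →
      m (lam : ℝ) * (lam : ℝ) ^ 2 * (volume (convexHull ℝ (y '' ↑S))).toReal ≤
        ∑ T ∈ simplicesAt α y lam,
          (volume (convexHull ℝ (y '' ↑S) ∩ convexHull ℝ (y '' ↑T))).toReal) ∧
      (∀ lam : ↥(distSet \ {1}), ∃ ω : Finset (Fin N) → Finset (Fin N),
      (∀ T ∈ simplicesAt α y lam,
        1 / 2 * ∑ p ∈ T.offDiag, (dist (y p.1) (y p.2) - lam) ^ 2 ≤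
          C₅₂ * Real.log (lam : ℝ) *
            ∑ p ∈ (shortRangePairs α y).filter (fun p => p.1 ∈ ω T ∧ p.2 ∈ ω T),
              (dist (y p.1) (y p.2) - 1) ^ 2) ∧
      (∀ x : Fin N, (((simplicesAt α y lam).filter fun T => x ∈ ω T).card : ℝ) ≤
        C₂₈ * (lam : ℝ) ^ 2 * m (lam : ℝ))))
    (hexPer : ∃ α₂ : ℝ, 0 < α₂ ∧ ∀ α : ℝ, 0 < α → α < α₂ → ∀ L : ℕ, 0 < L → ∀ V : ℝ → ℝ,
      IsAdmissible α V → ∃ (X₀ : Set (ℤ × ℤ)) (y₀ : ℤ × ℤ → Plane), IsRelaxedMinimizer V L X₀ y₀)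
    (hexDir : ∃ α₃ : ℝ, 0 < α₃ ∧ ∀ α : ℝ, 0 < α → α < α₃ → ∀ V : ℝ → ℝ, IsAdmissible α V →
      ∀ A : Finset (ℤ × ℤ), ∃ (A' : Finset (ℤ × ℤ)) (y : ℤ × ℤ → Plane),
        IsRelaxedDirichletMinimizer V A A' y) :
    Theil2006_groundStateEnergy ∧ Theil2006_periodicGroundStates_upToRotation ∧
      Theil2006_dirichletGroundStates := by
  obtain ⟨α₂, hα₂, hloc⟩ := hlocal
  refine Theil2006_mainTheorems_of_geometry (K₃ := 29) (C₉ := 311904) (C₃₄ := C₅₂ * C₂₈) hK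
    (mul_nonneg hC₅₂ hC₂₈) (by norm_num) (by norm_num)
    ⟨min α₂ (1 / 50), lt_min hα₂ (by norm_num), fun α hα hαlt V hV N y hsep => ?_⟩ hexPer hexDir
  have hα2 : α < α₂ := lt_of_lt_of_le hαlt (min_le_left _ _)
  have hα50 : α ≤ 1 / 50 := (lt_of_lt_of_le hαlt (min_le_right _ _)).le
  obtain ⟨h25, h281, huniq, h283, h70, hnear, hpart, h72, h72eq, hrig⟩ := hloc hα hα2 hV y hsep
  exact geometryPackage_of_local hα hα50 hC₅₂ hsep h25 h281 huniq h283 h70 hnear hpart h72 h72eq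
    hrig

end Literature.MathematicalPhysics.StatisticalMechanics

end

/-! # Part: staged brick `Theil2006FromReferences` (sha16 52f6a5fc17c2de8b) — verbatim -/

/-!
# Theil 2006: Theorems 1.1, 1.2 (corrected) and Corollary 1.3 from Proposition 4.8 (reference
configurations, ball form), the (27)-bookkeeping and Proposition 4.3's (52) on the patches

Topic `Literature/MathematicalPhysics/StatisticalMechanics`. Pure glue over
`Theil2006FromGeometry.lean` (`Theil2006_mainTheorems_of_geometry`,
`Theil2006_continuous_of_geometry`, `Theil2006.geometryPackage_of_local`) and
`Theil2006LocalGeometryFromReference.lean` (`Theil2006.HasReferences.localGeometry`: Lemma 2.7,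
Proposition 2.8 (1), (3), (70), the near-defect alternative and (28) from Proposition 4.8 applied
to concentric balls, Appendix pp. 23–25). Everything here is PROVED (no `sorry`, no named fact;
D-0026).

## What is here

* `Theil2006.geometry_of_references` — the finite Chapter-4 geometry package (the hypothesis
  `hgeom` of `Theil2006_mainTheorems_of_geometry`, constants `K₃ = 29`, `C₉ = 311904`,
  `C₃₄ = 4056 C₅₂`) from THREE inputs, each for all small `α` and all finite configurations with
  (13):
  (H48) Proposition 4.8 in ball form, `Theil2006.HasReferences α y K` — for all concentric open
  balls `B(c,r) ⊂ B(c,R)`, `r ≥ 2`, `R ≥ 4r+2`, without defects in `B(c,R)`, a discrete imbedding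
  of `y⁻¹(B(c,r))` with (60), (61), (62);
  (H27) the two pointwise inputs of the printed proof of Proposition 2.9 (27) (Appendix p. 25):
  the partition identity `meas conv y(T) = Σ_{S∈𝒯₁} meas(conv y(S) ∩ conv y(T))` for
  `T ∈ 𝒯_λ(y)` and (72) `Σ_{T∈𝒯_λ} meas(conv y(S) ∩ conv y(T)) ≤ m(λ)λ² meas conv y(S)` for
  `S ∈ 𝒯₁`, with `≥` when `S` is farther than `28λ` from the defects;
  (H52) the per-simplex rigidity display of p. 11 ("the L²-rigidity estimate provided by
  Proposition 4.3 applied to `u(ξ) := y(Φ⁻¹(ξ))`": `Σ_{{x,x′}⊂T} (|y(x)−y(x′)|−λ)² ≤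
  C log(λ) Σ_{{x,x′}∈𝒮, {x,x′}⊂ω_T} (|y(x)−y(x′)|−1)²`) on patches `ω_T` with
  `y(ω_T) ⊂ B̄(z_T, 5λ)` (Definition 2.6 (24)); the multiplicity bound (28) for such patches is
  PROVED from (H48) (`Theil2006.HasReferences.card_filter_mem_patch_le`, `C₂₈ = 4056`).
* `Theil2006_mainTheorems_of_references` — **Theorem 1.1, Theorem 1.2 (corrected, up to a rigid
  motion: `Theil2006_periodicGroundStates_upToRotation`) and Corollary 1.3
  (`Theil2006_dirichletGroundStates`)** from (H48), (H27), (H52) and the existence of relaxed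
  periodic / Dirichlet minimizers (both proved in the tree for `V` continuous on `[0,∞)`).
* `Theil2006_continuous_of_references` — for `V` continuous on `[0, ∞)` the conclusions of
  Theorem 1.2 (corrected) and Corollary 1.3 from (H48), (H27), (H52) alone.
* `Theil2006_mainTheorems_of_prop48` — the same as `Theil2006_mainTheorems_of_references` with
  (H48) written exactly as the printed Proposition 4.8 in ball form ((60) with `R ∈ SO(2)`);
* `Theil2006_mainTheorems_of_existsReference` — the same with (H48) WITHOUT assertion (1):
  discrete imbeddings of the ball patches with (61), (62) suffice, (60) being a theorem
  (`Theil2006.discreteImbedding_unique_ball`, `Theil2006ReferenceUniqueness.lean`);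
* `Theil2006_mainTheorems_of_existsRigidReference` — the same with (H48) reduced to EXISTENCE
  of discrete imbeddings of the ball patches WITH THE RIGIDITY ESTIMATE (61) only, (62) being a
  theorem too (`Theil2006.IsDiscreteImbeddingOn.exists_eq_of_ball_subset`,
  `Theil2006ReferenceSurjectivity.lean`), AND with (H27) reduced to its (72)-half: the partition
  identity `meas conv y(T) = Σ_{S∈𝒯₁} meas(conv y(S) ∩ conv y(T))` is a theorem
  (`Theil2006.partition_identity`, from `Theil2006.toReal_volume_convexHull_eq_sum_inter` of
  `Theil2006SimplexCover.lean`).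

So the tree's three Theil-2006 named facts are reduced to: the existence half of Proposition 4.8
(p. 21) with its rigidity estimate (61) for concentric balls, the measure bookkeeping of p. 25, and the p. 11 rigidity display (Proposition 4.3 (52),
p. 18, transported to the patches) — all for FINITE configurations — plus the two existence
statements.
-/

noncomputable section

open scoped BigOperators Topology
open Filter Set Metric MeasureTheory

namespace Literature.MathematicalPhysics.StatisticalMechanics

namespace Theil2006

/-- `K α ≤ 1/10` once `α ≤ 1/(10K + 10)` (`K ≥ 0`). [folklore] -/
private theorem mul_le_tenth_of_le {K α : ℝ} (hK : 0 ≤ K) (h : α ≤ 1 / (10 * K + 10)) :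
    K * α ≤ 1 / 10 := by
  have h10 : 0 < 10 * K + 10 := by positivity
  have h1 : K * α ≤ K * (1 / (10 * K + 10)) := mul_le_mul_of_nonneg_left h hK
  have h2 : K * (1 / (10 * K + 10)) ≤ 1 / 10 := by
    rw [mul_one_div, div_le_div_iff₀ h10 (by norm_num)]
    nlinarith
  exact h1.trans h2

/-- **The finite Chapter-4 geometry package from Proposition 4.8 (ball form), the
(27)-bookkeeping and the p. 11 rigidity display.** For all small `α`, all admissible `V` and all
finite configurations with (13): the labelled family of centred long simplices
`(longSimplices, sideOf)` with (25) (constant `2K+1`), Proposition 2.8 (1), (3) (`K₃ = 29`),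
Proposition 2.9 (26), (27) (`C₉ = 311904`) and (34) (`C₃₄ = 4056 C₅₂`, via (28) proved) — i.e.
the hypothesis of
`Theil2006_groundStateEnergy_of_geometry` / `Theil2006_mainTheorems_of_geometry`.
[cite: Theil2006, §2.3 Lemma 2.7, Propositions 2.8, 2.9, §2.4 (34); Appendix Propositions 4.3, 4.8 and pp. 23–25 (preprint)] -/
theorem geometry_of_references {C₅₂ : ℝ} (hC₅₂ : 0 ≤ C₅₂)
    (h48 : ∃ α₀ K : ℝ, 0 < α₀ ∧ 0 ≤ K ∧ ∀ ⦃α : ℝ⦄, 0 < α → α < α₀ →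
      ∀ {N : ℕ} (y : Fin N → Plane), (∀ i j : Fin N, i ≠ j → 1 - α < dist (y i) (y j)) →
        HasReferences α y K)
    (h27 : ∃ α₂ : ℝ, 0 < α₂ ∧ ∀ ⦃α : ℝ⦄, 0 < α → α < α₂ →
      ∀ {N : ℕ} (y : Fin N → Plane), (∀ i j : Fin N, i ≠ j → 1 - α < dist (y i) (y j)) →
      (∀ lam : ↥(distSet \ {1}), ∀ T ∈ simplicesAt α y lam,
        (volume (convexHull ℝ (y '' ↑T))).toReal =
          ∑ S ∈ unitSimplices α y,
            (volume (convexHull ℝ (y '' ↑S) ∩ convexHull ℝ (y '' ↑T))).toReal) ∧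
      (∀ lam : ↥(distSet \ {1}), ∀ S ∈ unitSimplices α y,
        ∑ T ∈ simplicesAt α y lam,
            (volume (convexHull ℝ (y '' ↑S) ∩ convexHull ℝ (y '' ↑T))).toReal ≤
          m (lam : ℝ) * (lam : ℝ) ^ 2 * (volume (convexHull ℝ (y '' ↑S))).toReal) ∧
      (∀ lam : ↥(distSet \ {1}), ∀ S ∈ unitSimplices α y,
        (∀ x ∈ S, ∀ b ∈ defects α y, 28 * (lam : ℝ) < dist (y x) (y b)) →
        m (lam : ℝ) * (lam : ℝ) ^ 2 * (volume (convexHull ℝ (y '' ↑S))).toReal ≤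
          ∑ T ∈ simplicesAt α y lam,
            (volume (convexHull ℝ (y '' ↑S) ∩ convexHull ℝ (y '' ↑T))).toReal))
    (h52 : ∃ α₂ : ℝ, 0 < α₂ ∧ ∀ ⦃α : ℝ⦄, 0 < α → α < α₂ →
      ∀ {N : ℕ} (y : Fin N → Plane), (∀ i j : Fin N, i ≠ j → 1 - α < dist (y i) (y j)) →
      ∀ lam : ↥(distSet \ {1}), ∃ ω : Finset (Fin N) → Finset (Fin N),
        (∀ T ∈ simplicesAt α y lam, ∀ a ∈ ω T, dist (y a) (simplexCentre y T) ≤ 5 * lam) ∧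
        (∀ T ∈ simplicesAt α y lam,
          1 / 2 * ∑ p ∈ T.offDiag, (dist (y p.1) (y p.2) - lam) ^ 2 ≤
            C₅₂ * Real.log (lam : ℝ) *
              ∑ p ∈ (shortRangePairs α y).filter (fun p => p.1 ∈ ω T ∧ p.2 ∈ ω T),
                (dist (y p.1) (y p.2) - 1) ^ 2)) :
    ∃ K : ℝ, 0 ≤ K ∧ ∃ α₂ : ℝ, 0 < α₂ ∧ ∀ ⦃α : ℝ⦄, 0 < α → α < α₂ → ∀ ⦃V : ℝ → ℝ⦄,
      IsAdmissible α V →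
      ∀ {N : ℕ} (y : Fin N → Plane), (∀ i j : Fin N, i ≠ j → 1 - α < dist (y i) (y j)) →
      ∃ (TLall : Finset (Finset (Fin N))) (lamOf : Finset (Fin N) → ℝ),
        (∀ T ∈ TLall, lamOf T ∈ distSet \ {1}) ∧ (∀ T ∈ TLall, T.card = 3) ∧
        (∀ T ∈ TLall, ∀ x ∈ T, ∀ x' ∈ T, x ≠ x' →
          |dist (y x) (y x') / lamOf T - 1| ≤ K * α) ∧
        (∀ p ∈ (Finset.univ : Finset (Fin N × Fin N)).filter (fun p => p.1 < p.2) \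
            shortRangePairs α y, (TLall.filter fun T => p.1 ∈ T ∧ p.2 ∈ T).card ≤ 2) ∧
        (∀ p ∈ (Finset.univ : Finset (Fin N × Fin N)).filter (fun p => p.1 < p.2) \
            shortRangePairs α y, (TLall.filter fun T => p.1 ∈ T ∧ p.2 ∈ T).card < 2 →
            ∃ b ∈ defects α y, dist (y p.1) (y b) ≤ 29 * dist (y p.1) (y p.2)) ∧
        (∀ lam : ↥(distSet \ {1}),
          (0 ≤ ((unitSimplices α y).card : ℝ) -
              1 / (m (lam : ℝ) : ℝ) * (TLall.filter fun T => lamOf T = lam).card ∧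
            ((unitSimplices α y).card : ℝ) -
              1 / (m (lam : ℝ) : ℝ) * (TLall.filter fun T => lamOf T = lam).card ≤
              311904 * (lam : ℝ) ^ 2 * (defects α y).card) ∧
          (0 ≤ ∑ S ∈ unitSimplices α y, (volume (convexHull ℝ (y '' ↑S))).toReal -
              1 / ((lam : ℝ) ^ 2 * m (lam : ℝ)) *
                ∑ T ∈ TLall.filter (fun T => lamOf T = lam),
                  (volume (convexHull ℝ (y '' ↑T))).toReal ∧
            ∑ S ∈ unitSimplices α y, (volume (convexHull ℝ (y '' ↑S))).toReal -
              1 / ((lam : ℝ) ^ 2 * m (lam : ℝ)) *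
                ∑ T ∈ TLall.filter (fun T => lamOf T = lam),
                  (volume (convexHull ℝ (y '' ↑T))).toReal ≤
              311904 * (lam : ℝ) ^ 2 * (defects α y).card) ∧
          (lam : ℝ)⁻¹ ^ 7 * ∑ T ∈ TLall.filter (fun T => lamOf T = lam),
              (1 / 2 * ∑ p ∈ T.offDiag, (dist (y p.1) (y p.2) - lam) ^ 2) ≤
            C₅₂ * 4056 * (lam : ℝ)⁻¹ ^ 5 * Real.log (lam : ℝ) * m (lam : ℝ) *
              ∑ p ∈ shortRangePairs α y, (dist (y p.1) (y p.2) - 1) ^ 2) := by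
  obtain ⟨α₀, K, hα₀, hK, h48⟩ := h48
  obtain ⟨α₂, hα₂, h27⟩ := h27
  obtain ⟨α₃, hα₃, h52⟩ := h52
  have hK10 : 0 < 1 / (10 * K + 10) := by positivity
  refine ⟨2 * K + 1, by positivity,
    min (min α₀ α₂) (min α₃ (min (1 / 200) (1 / (10 * K + 10)))), by positivity,
    fun α hα hαlt V _ N y hsep => ?_⟩
  have hα0 : α < α₀ := hαlt.trans_le ((min_le_left _ _).trans (min_le_left _ _))
  have hα2 : α < α₂ := hαlt.trans_le ((min_le_left _ _).trans (min_le_right _ _))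
  have hα3 : α < α₃ := hαlt.trans_le ((min_le_right _ _).trans (min_le_left _ _))
  have hα200 : α ≤ 1 / 200 :=
    (hαlt.trans_le ((min_le_right _ _).trans ((min_le_right _ _).trans (min_le_left _ _)))).le
  have hαK : α ≤ 1 / (10 * K + 10) :=
    (hαlt.trans_le ((min_le_right _ _).trans ((min_le_right _ _).trans (min_le_right _ _)))).le
  have hKα : K * α ≤ 1 / 10 := mul_le_tenth_of_le hK hαK
  have href := h48 hα hα0 y hsep
  obtain ⟨h25, h281, huniq, h283, h70, hnear⟩ := href.localGeometry hα hα200 hK hKα hsep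
  obtain ⟨hpart, h72, h72eq⟩ := h27 hα hα2 y hsep
  exact geometryPackage_of_local hα (by linarith) hC₅₂ hsep h25 h281 huniq h283 h70 hnear hpart h72
    h72eq (href.rigidityInputs hα hα200 hsep (h52 hα hα3 y hsep))

/-- **The partition identity, in the vocabulary of the (27)-inputs** (`simplicesAt`,
`unitSimplices`): for `λ ∈ Λ ∖ {1}` and `T ∈ 𝒯_λ(y)` (centred),
`meas conv y(T) = Σ_{S ∈ 𝒯₁(y)} meas(conv y(S) ∩ conv y(T))` — the first of the three (H27)
clauses, now a theorem (`Theil2006.toReal_volume_convexHull_eq_sum_inter`,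
`Theil2006SimplexCover.lean`; (13), `0 < α ≤ 1/200`).
[cite: Theil2006, Appendix proof of Proposition 2.9 (27) (preprint p. 25)] -/
theorem partition_identity {α : ℝ} {N : ℕ} {y : Fin N → Plane} (hα : 0 < α) (hα' : α ≤ 1 / 200)
    (hsep : ∀ i j : Fin N, i ≠ j → 1 - α < dist (y i) (y j)) :
    ∀ lam : ↥(distSet \ {1}), ∀ T ∈ simplicesAt α y lam,
      (volume (convexHull ℝ (y '' ↑T))).toReal =
        ∑ S ∈ unitSimplices α y,
          (volume (convexHull ℝ (y '' ↑S) ∩ convexHull ℝ (y '' ↑T))).toReal := by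
  classical
  intro lam T hT
  have hlam : 1 < (lam : ℝ) := one_lt_of_mem_distSet_diff lam.2
  have hT' : IsEquilateralSimplex α y lam T := (mem_simplicesAt.1 hT).1
  have h := toReal_volume_convexHull_eq_sum_inter hα hα' hsep hT' hlam
  rw [h]
  unfold unitSimplices
  congr 1

end Theil2006

open Theil2006 MeasureTheory in
/-- **Theil 2006 — Theorem 1.1, Theorem 1.2 (corrected, up to a rigid motion) and Corollary 1.3
from Proposition 4.8 (reference configurations, ball form), the (27)-bookkeeping, the p. 11
rigidity display, and the two existence statements.** Hypotheses, each for all small `α` and all finite configurations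
`y : X_N → ℝ²` with (13): (H48) `Theil2006.HasReferences α y K` — for all concentric open balls
`Ω′ = B(c,r) ⊂ Ω = B(c,R)` with `r ≥ 2`, `R ≥ 4r + 2` and `Ω ∩ y(∂X) = ∅` a discrete imbedding of
`y⁻¹(Ω′)`
with (60) (uniqueness up to a rigid motion), (61) (rigidity, constant `K`), (62) (surjectivity)
(Proposition 4.8, p. 21, in the form of its four applications pp. 23–24); (H27) the partition
identity and (72) (Appendix p. 25); (H52) the p. 11 display — (52) of Proposition 4.3
transported to a patch `ω_T` with `y(ω_T) ⊂ B̄(z_T,5λ)` — for every `T ∈ 𝒯_λ(y)` ((28) for these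
patches is proved); plus the existence of relaxed periodic minimizers (`hexPer`) and of relaxed Dirichlet
minimizers (`hexDir`) — both theorems of the tree for `V` continuous on `[0, ∞)`
(`Theil2006.exists_isRelaxedMinimizer`, `Theil2006.exists_isRelaxedDirichletMinimizer`).
Conclusion: the tree's named facts `Theil2006_groundStateEnergy` (Theorem 1.1),
`Theil2006_periodicGroundStates_upToRotation` (Theorem 1.2 as proved: up to a rotation) and
`Theil2006_dirichletGroundStates` (Corollary 1.3).
[cite: Theil2006, §1 Theorems 1.1, 1.2, Corollary 1.3; §2–§3; Appendix Propositions 4.3, 4.8, pp. 23–25 (preprint)] -/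
theorem Theil2006_mainTheorems_of_references {C₅₂ : ℝ} (hC₅₂ : 0 ≤ C₅₂)
    (h48 : ∃ α₀ K : ℝ, 0 < α₀ ∧ 0 ≤ K ∧ ∀ ⦃α : ℝ⦄, 0 < α → α < α₀ →
      ∀ {N : ℕ} (y : Fin N → Plane), (∀ i j : Fin N, i ≠ j → 1 - α < dist (y i) (y j)) →
        HasReferences α y K)
    (h27 : ∃ α₂ : ℝ, 0 < α₂ ∧ ∀ ⦃α : ℝ⦄, 0 < α → α < α₂ →
      ∀ {N : ℕ} (y : Fin N → Plane), (∀ i j : Fin N, i ≠ j → 1 - α < dist (y i) (y j)) →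
      (∀ lam : ↥(distSet \ {1}), ∀ T ∈ simplicesAt α y lam,
        (volume (convexHull ℝ (y '' ↑T))).toReal =
          ∑ S ∈ unitSimplices α y,
            (volume (convexHull ℝ (y '' ↑S) ∩ convexHull ℝ (y '' ↑T))).toReal) ∧
      (∀ lam : ↥(distSet \ {1}), ∀ S ∈ unitSimplices α y,
        ∑ T ∈ simplicesAt α y lam,
            (volume (convexHull ℝ (y '' ↑S) ∩ convexHull ℝ (y '' ↑T))).toReal ≤
          m (lam : ℝ) * (lam : ℝ) ^ 2 * (volume (convexHull ℝ (y '' ↑S))).toReal) ∧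
      (∀ lam : ↥(distSet \ {1}), ∀ S ∈ unitSimplices α y,
        (∀ x ∈ S, ∀ b ∈ defects α y, 28 * (lam : ℝ) < dist (y x) (y b)) →
        m (lam : ℝ) * (lam : ℝ) ^ 2 * (volume (convexHull ℝ (y '' ↑S))).toReal ≤
          ∑ T ∈ simplicesAt α y lam,
            (volume (convexHull ℝ (y '' ↑S) ∩ convexHull ℝ (y '' ↑T))).toReal))
    (h52 : ∃ α₂ : ℝ, 0 < α₂ ∧ ∀ ⦃α : ℝ⦄, 0 < α → α < α₂ →
      ∀ {N : ℕ} (y : Fin N → Plane), (∀ i j : Fin N, i ≠ j → 1 - α < dist (y i) (y j)) →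
      ∀ lam : ↥(distSet \ {1}), ∃ ω : Finset (Fin N) → Finset (Fin N),
        (∀ T ∈ simplicesAt α y lam, ∀ a ∈ ω T, dist (y a) (simplexCentre y T) ≤ 5 * lam) ∧
        (∀ T ∈ simplicesAt α y lam,
          1 / 2 * ∑ p ∈ T.offDiag, (dist (y p.1) (y p.2) - lam) ^ 2 ≤
            C₅₂ * Real.log (lam : ℝ) *
              ∑ p ∈ (shortRangePairs α y).filter (fun p => p.1 ∈ ω T ∧ p.2 ∈ ω T),
                (dist (y p.1) (y p.2) - 1) ^ 2))
    (hexPer : ∃ α₂ : ℝ, 0 < α₂ ∧ ∀ α : ℝ, 0 < α → α < α₂ → ∀ L : ℕ, 0 < L → ∀ V : ℝ → ℝ,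
      IsAdmissible α V → ∃ (X₀ : Set (ℤ × ℤ)) (y₀ : ℤ × ℤ → Plane), IsRelaxedMinimizer V L X₀ y₀)
    (hexDir : ∃ α₃ : ℝ, 0 < α₃ ∧ ∀ α : ℝ, 0 < α → α < α₃ → ∀ V : ℝ → ℝ, IsAdmissible α V →
      ∀ A : Finset (ℤ × ℤ), ∃ (A' : Finset (ℤ × ℤ)) (y : ℤ × ℤ → Plane),
        IsRelaxedDirichletMinimizer V A A' y) :
    Theil2006_groundStateEnergy ∧ Theil2006_periodicGroundStates_upToRotation ∧
      Theil2006_dirichletGroundStates := by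
  obtain ⟨K, hK, hgeom⟩ := geometry_of_references hC₅₂ h48 h27 h52
  exact Theil2006_mainTheorems_of_geometry (K₃ := 29) (C₉ := 311904) (C₃₄ := C₅₂ * 4056) hK
    (mul_nonneg hC₅₂ (by norm_num)) (by norm_num) (by norm_num) hgeom hexPer hexDir


open Theil2006 MeasureTheory in
/-- **For continuous potentials no existence hypothesis is needed**: from (H48) Proposition 4.8 in
ball form, (H27) and (H52) alone, for all small `α` and every `V` satisfying (1)–(5) that is
continuous on `[0, ∞)`: (a) **Theorem 1.2 (corrected)** — every ground state `y ∈ Y_L^per` of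
`E_L^per` (`L ≥ 1`) satisfies (42), (43) and `RΩ + τ = A₂` for a rotation `R ∈ SO(2)` and a
translation `τ`; (b) **Corollary 1.3** — every ground state of `E_𝒜` over `Y_𝒜^Dir` has
`{y(x)} = A₂`.
[cite: Theil2006, §1 Theorem 1.2, Corollary 1.3; §3 (preprint pp. 13–15); Appendix Propositions 4.3, 4.8] -/
theorem Theil2006_continuous_of_references {C₅₂ : ℝ} (hC₅₂ : 0 ≤ C₅₂)
    (h48 : ∃ α₀ K : ℝ, 0 < α₀ ∧ 0 ≤ K ∧ ∀ ⦃α : ℝ⦄, 0 < α → α < α₀ →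
      ∀ {N : ℕ} (y : Fin N → Plane), (∀ i j : Fin N, i ≠ j → 1 - α < dist (y i) (y j)) →
        HasReferences α y K)
    (h27 : ∃ α₂ : ℝ, 0 < α₂ ∧ ∀ ⦃α : ℝ⦄, 0 < α → α < α₂ →
      ∀ {N : ℕ} (y : Fin N → Plane), (∀ i j : Fin N, i ≠ j → 1 - α < dist (y i) (y j)) →
      (∀ lam : ↥(distSet \ {1}), ∀ T ∈ simplicesAt α y lam,
        (volume (convexHull ℝ (y '' ↑T))).toReal =
          ∑ S ∈ unitSimplices α y,
            (volume (convexHull ℝ (y '' ↑S) ∩ convexHull ℝ (y '' ↑T))).toReal) ∧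
      (∀ lam : ↥(distSet \ {1}), ∀ S ∈ unitSimplices α y,
        ∑ T ∈ simplicesAt α y lam,
            (volume (convexHull ℝ (y '' ↑S) ∩ convexHull ℝ (y '' ↑T))).toReal ≤
          m (lam : ℝ) * (lam : ℝ) ^ 2 * (volume (convexHull ℝ (y '' ↑S))).toReal) ∧
      (∀ lam : ↥(distSet \ {1}), ∀ S ∈ unitSimplices α y,
        (∀ x ∈ S, ∀ b ∈ defects α y, 28 * (lam : ℝ) < dist (y x) (y b)) →
        m (lam : ℝ) * (lam : ℝ) ^ 2 * (volume (convexHull ℝ (y '' ↑S))).toReal ≤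
          ∑ T ∈ simplicesAt α y lam,
            (volume (convexHull ℝ (y '' ↑S) ∩ convexHull ℝ (y '' ↑T))).toReal))
    (h52 : ∃ α₂ : ℝ, 0 < α₂ ∧ ∀ ⦃α : ℝ⦄, 0 < α → α < α₂ →
      ∀ {N : ℕ} (y : Fin N → Plane), (∀ i j : Fin N, i ≠ j → 1 - α < dist (y i) (y j)) →
      ∀ lam : ↥(distSet \ {1}), ∃ ω : Finset (Fin N) → Finset (Fin N),
        (∀ T ∈ simplicesAt α y lam, ∀ a ∈ ω T, dist (y a) (simplexCentre y T) ≤ 5 * lam) ∧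
        (∀ T ∈ simplicesAt α y lam,
          1 / 2 * ∑ p ∈ T.offDiag, (dist (y p.1) (y p.2) - lam) ^ 2 ≤
            C₅₂ * Real.log (lam : ℝ) *
              ∑ p ∈ (shortRangePairs α y).filter (fun p => p.1 ∈ ω T ∧ p.2 ∈ ω T),
                (dist (y p.1) (y p.2) - 1) ^ 2)) :
    ∃ α₀ : ℝ, 0 < α₀ ∧ ∀ α : ℝ, 0 < α → α < α₀ → ∀ V : ℝ → ℝ, IsAdmissible α V →
      ContinuousOn V (Ici 0) →
      (∀ L : ℕ, 0 < L → ∀ y : ℤ × ℤ → Plane, IsPeriodic L y →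
        (∀ y' : ℤ × ℤ → Plane, IsPeriodic L y' → periodicEnergy V L y ≤ periodicEnergy V L y') →
          (∀ x x', y x ≠ y x' → 1 ≤ dist (y x) (y x')) ∧
            (∀ x, {p ∈ Set.range y | dist (y x) p ≤ 1}.ncard = 7) ∧
              ∃ R : Plane ≃ₗᵢ[ℝ] Plane,
                LinearMap.det (R.toLinearEquiv : Plane →ₗ[ℝ] Plane) = 1 ∧
                  ∃ τ : Plane, Set.range (fun k => R (y k) + τ) = triangularLattice) ∧
      (∀ (A : Finset (ℤ × ℤ)) (y : ℤ × ℤ → Plane), IsClampedOutside A y →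
        (∀ y' : ℤ × ℤ → Plane, IsClampedOutside A y' →
          dirichletEnergy V A y ≤ dirichletEnergy V A y') →
          Set.range y = triangularLattice) := by
  obtain ⟨K, hK, hgeom⟩ := geometry_of_references hC₅₂ h48 h27 h52
  exact Theil2006_continuous_of_geometry (K₃ := 29) (C₉ := 311904) (C₃₄ := C₅₂ * 4056) hK
    (mul_nonneg hC₅₂ (by norm_num)) (by norm_num) (by norm_num) hgeom


open Theil2006 MeasureTheory in
/-- **Theil 2006 — the three main results from Proposition 4.8 AS PRINTED (ball form).** As
`Theil2006_mainTheorems_of_references`, with (H48) spelled out as the printed Proposition 4.8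
(p. 21) applied to concentric open balls `Ω′ = B(c,r) ⊂ Ω = B(c,R)`: "There exist constants
`α₀, K > 0` such that for all `α ∈ (0,α₀)` and all domains `Ω′ ⊂ Ω` with
`dist(Ω′,∂Ω) ≥ 3 diam(Ω′) + 2` [read: `R ≥ 4r + 2`, radius for "diam", print flag F1], `Ω` convex,
`Ω ∩ y(∂X) = ∅`, there exists a discrete imbedding `Φ : ω → A₂`, `ω = y⁻¹(Ω′)`, with (1) for each
discrete imbedding `Φ′ : ω → A₂` a rotation `R ∈ SO(2)` with (60) `Φ′(x) − Φ′(x′) = R(Φ(x) − Φ(x′))`;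
(2) (61) `sup | |Φ(x)−Φ(x′)|/|y(x)−y(x′)| − 1 | ≤ Kα`; (3) (62) `B(y(x),ρ) ⊂ Ω′ ⇒
Φ(ω) ⊃ B(Φ(x), ρ/2) ∩ A₂`" (for configurations with (13), the paper's standing assumption, p. 4),
restricted to radii `r ≥ 2` — a lower bound the print omits but (60) needs (a tiny `Ω′` capturing
a particle and two opposite neighbours only has discrete imbeddings not related by a rotation;
LIT1-AS-PRINTED §34, flag F4); the paper's own applications have `r ≥ 2λ₁ ≥ 2√3`.
[cite: Theil2006, Appendix Proposition 4.8 (60)–(62) (preprint p. 21); §1 Theorems 1.1, 1.2, Corollary 1.3] -/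
theorem Theil2006_mainTheorems_of_prop48 {C₅₂ : ℝ} (hC₅₂ : 0 ≤ C₅₂)
    (h48 : ∃ α₀ K : ℝ, 0 < α₀ ∧ 0 < K ∧ ∀ ⦃α : ℝ⦄, 0 < α → α < α₀ →
      ∀ {N : ℕ} (y : Fin N → Plane), (∀ i j : Fin N, i ≠ j → 1 - α < dist (y i) (y j)) →
      ∀ (c : Plane) (r R : ℝ), 2 ≤ r → 4 * r + 2 ≤ R → (∀ b ∈ defects α y, R ≤ dist (y b) c) →
        ∃ Φ : Fin N → ℤ × ℤ, IsDiscreteImbeddingOn α y (y ⁻¹' ball c r) Φ ∧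
          (∀ Φ' : Fin N → ℤ × ℤ, IsDiscreteImbeddingOn α y (y ⁻¹' ball c r) Φ' →
            ∃ Rot : Plane ≃ₗᵢ[ℝ] Plane,
              LinearMap.det (Rot.toLinearEquiv : Plane →ₗ[ℝ] Plane) = 1 ∧
              ∀ x x' : Fin N, y x ∈ ball c r → y x' ∈ ball c r →
                triPoint (Φ' x) - triPoint (Φ' x') = Rot (triPoint (Φ x) - triPoint (Φ x'))) ∧
          (∀ x x' : Fin N, y x ∈ ball c r → y x' ∈ ball c r → x ≠ x' →
            |dist (triPoint (Φ x)) (triPoint (Φ x')) / dist (y x) (y x') - 1| ≤ K * α) ∧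
          (∀ (x : Fin N) (ρ : ℝ), 0 < ρ → ball (y x) ρ ⊆ ball c r →
            ∀ g : ℤ × ℤ, dist (triPoint g) (triPoint (Φ x)) < ρ / 2 →
              ∃ x'' : Fin N, y x'' ∈ ball c r ∧ Φ x'' = g))
    (h27 : ∃ α₂ : ℝ, 0 < α₂ ∧ ∀ ⦃α : ℝ⦄, 0 < α → α < α₂ →
      ∀ {N : ℕ} (y : Fin N → Plane), (∀ i j : Fin N, i ≠ j → 1 - α < dist (y i) (y j)) →
      (∀ lam : ↥(distSet \ {1}), ∀ T ∈ simplicesAt α y lam,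
        (volume (convexHull ℝ (y '' ↑T))).toReal =
          ∑ S ∈ unitSimplices α y,
            (volume (convexHull ℝ (y '' ↑S) ∩ convexHull ℝ (y '' ↑T))).toReal) ∧
      (∀ lam : ↥(distSet \ {1}), ∀ S ∈ unitSimplices α y,
        ∑ T ∈ simplicesAt α y lam,
            (volume (convexHull ℝ (y '' ↑S) ∩ convexHull ℝ (y '' ↑T))).toReal ≤
          m (lam : ℝ) * (lam : ℝ) ^ 2 * (volume (convexHull ℝ (y '' ↑S))).toReal) ∧
      (∀ lam : ↥(distSet \ {1}), ∀ S ∈ unitSimplices α y,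
        (∀ x ∈ S, ∀ b ∈ defects α y, 28 * (lam : ℝ) < dist (y x) (y b)) →
        m (lam : ℝ) * (lam : ℝ) ^ 2 * (volume (convexHull ℝ (y '' ↑S))).toReal ≤
          ∑ T ∈ simplicesAt α y lam,
            (volume (convexHull ℝ (y '' ↑S) ∩ convexHull ℝ (y '' ↑T))).toReal))
    (h52 : ∃ α₂ : ℝ, 0 < α₂ ∧ ∀ ⦃α : ℝ⦄, 0 < α → α < α₂ →
      ∀ {N : ℕ} (y : Fin N → Plane), (∀ i j : Fin N, i ≠ j → 1 - α < dist (y i) (y j)) →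
      ∀ lam : ↥(distSet \ {1}), ∃ ω : Finset (Fin N) → Finset (Fin N),
        (∀ T ∈ simplicesAt α y lam, ∀ a ∈ ω T, dist (y a) (simplexCentre y T) ≤ 5 * lam) ∧
        (∀ T ∈ simplicesAt α y lam,
          1 / 2 * ∑ p ∈ T.offDiag, (dist (y p.1) (y p.2) - lam) ^ 2 ≤
            C₅₂ * Real.log (lam : ℝ) *
              ∑ p ∈ (shortRangePairs α y).filter (fun p => p.1 ∈ ω T ∧ p.2 ∈ ω T),
                (dist (y p.1) (y p.2) - 1) ^ 2))
    (hexPer : ∃ α₂ : ℝ, 0 < α₂ ∧ ∀ α : ℝ, 0 < α → α < α₂ → ∀ L : ℕ, 0 < L → ∀ V : ℝ → ℝ,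
      IsAdmissible α V → ∃ (X₀ : Set (ℤ × ℤ)) (y₀ : ℤ × ℤ → Plane), IsRelaxedMinimizer V L X₀ y₀)
    (hexDir : ∃ α₃ : ℝ, 0 < α₃ ∧ ∀ α : ℝ, 0 < α → α < α₃ → ∀ V : ℝ → ℝ, IsAdmissible α V →
      ∀ A : Finset (ℤ × ℤ), ∃ (A' : Finset (ℤ × ℤ)) (y : ℤ × ℤ → Plane),
        IsRelaxedDirichletMinimizer V A A' y) :
    Theil2006_groundStateEnergy ∧ Theil2006_periodicGroundStates_upToRotation ∧
      Theil2006_dirichletGroundStates := by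
  obtain ⟨α₀, K, hα₀, hK, h48⟩ := h48
  exact Theil2006_mainTheorems_of_references hC₅₂
    ⟨α₀, K, hα₀, hK.le, fun α hα hα0 N y hsep => HasReferences.of_so2 (h48 hα hα0 y hsep)⟩
    h27 h52 hexPer hexDir

open Theil2006 MeasureTheory in
/-- **Theil 2006 — the three main results from the EXISTENCE of reference configurations with
(61), (62)** ((60) being a theorem for ball patches, `Theil2006.discreteImbedding_unique_ball`): as
`Theil2006_mainTheorems_of_references`, with (H48) weakened to: for all small `α`, all finite
configurations with (13) and all concentric balls `B(c,r) ⊂ B(c,R)`, `r ≥ 2`, `R ≥ 4r + 2`,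
`B(c,R) ∩ y(∂X) = ∅`, SOME discrete imbedding of `y⁻¹(B(c,r))` satisfies the rigidity estimate
(61) (constant `K`) and the surjectivity (62) — i.e. Proposition 4.8 without its assertion (1).
[cite: Theil2006, §1 Theorems 1.1, 1.2, Corollary 1.3; Appendix Proposition 4.8 (61), (62) (preprint p. 21)] -/
theorem Theil2006_mainTheorems_of_existsReference {C₅₂ : ℝ} (hC₅₂ : 0 ≤ C₅₂)
    (h48 : ∃ α₀ K : ℝ, 0 < α₀ ∧ 0 ≤ K ∧ ∀ ⦃α : ℝ⦄, 0 < α → α < α₀ →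
      ∀ {N : ℕ} (y : Fin N → Plane), (∀ i j : Fin N, i ≠ j → 1 - α < dist (y i) (y j)) →
      ∀ (c : Plane) (r R : ℝ), 2 ≤ r → 4 * r + 2 ≤ R → (∀ b ∈ defects α y, R ≤ dist (y b) c) →
        ∃ Φ : Fin N → ℤ × ℤ, IsDiscreteImbeddingOn α y (y ⁻¹' ball c r) Φ ∧
          (∀ x x' : Fin N, y x ∈ ball c r → y x' ∈ ball c r → x ≠ x' →
            |dist (triPoint (Φ x)) (triPoint (Φ x')) / dist (y x) (y x') - 1| ≤ K * α) ∧
          (∀ (x : Fin N) (ρ : ℝ), 0 < ρ → ball (y x) ρ ⊆ ball c r →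
            ∀ g : ℤ × ℤ, dist (triPoint g) (triPoint (Φ x)) < ρ / 2 →
              ∃ x'' : Fin N, y x'' ∈ ball c r ∧ Φ x'' = g))
    (h27 : ∃ α₂ : ℝ, 0 < α₂ ∧ ∀ ⦃α : ℝ⦄, 0 < α → α < α₂ →
      ∀ {N : ℕ} (y : Fin N → Plane), (∀ i j : Fin N, i ≠ j → 1 - α < dist (y i) (y j)) →
      (∀ lam : ↥(distSet \ {1}), ∀ T ∈ simplicesAt α y lam,
        (volume (convexHull ℝ (y '' ↑T))).toReal =
          ∑ S ∈ unitSimplices α y,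
            (volume (convexHull ℝ (y '' ↑S) ∩ convexHull ℝ (y '' ↑T))).toReal) ∧
      (∀ lam : ↥(distSet \ {1}), ∀ S ∈ unitSimplices α y,
        ∑ T ∈ simplicesAt α y lam,
            (volume (convexHull ℝ (y '' ↑S) ∩ convexHull ℝ (y '' ↑T))).toReal ≤
          m (lam : ℝ) * (lam : ℝ) ^ 2 * (volume (convexHull ℝ (y '' ↑S))).toReal) ∧
      (∀ lam : ↥(distSet \ {1}), ∀ S ∈ unitSimplices α y,
        (∀ x ∈ S, ∀ b ∈ defects α y, 28 * (lam : ℝ) < dist (y x) (y b)) →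
        m (lam : ℝ) * (lam : ℝ) ^ 2 * (volume (convexHull ℝ (y '' ↑S))).toReal ≤
          ∑ T ∈ simplicesAt α y lam,
            (volume (convexHull ℝ (y '' ↑S) ∩ convexHull ℝ (y '' ↑T))).toReal))
    (h52 : ∃ α₂ : ℝ, 0 < α₂ ∧ ∀ ⦃α : ℝ⦄, 0 < α → α < α₂ →
      ∀ {N : ℕ} (y : Fin N → Plane), (∀ i j : Fin N, i ≠ j → 1 - α < dist (y i) (y j)) →
      ∀ lam : ↥(distSet \ {1}), ∃ ω : Finset (Fin N) → Finset (Fin N),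
        (∀ T ∈ simplicesAt α y lam, ∀ a ∈ ω T, dist (y a) (simplexCentre y T) ≤ 5 * lam) ∧
        (∀ T ∈ simplicesAt α y lam,
          1 / 2 * ∑ p ∈ T.offDiag, (dist (y p.1) (y p.2) - lam) ^ 2 ≤
            C₅₂ * Real.log (lam : ℝ) *
              ∑ p ∈ (shortRangePairs α y).filter (fun p => p.1 ∈ ω T ∧ p.2 ∈ ω T),
                (dist (y p.1) (y p.2) - 1) ^ 2))
    (hexPer : ∃ α₂ : ℝ, 0 < α₂ ∧ ∀ α : ℝ, 0 < α → α < α₂ → ∀ L : ℕ, 0 < L → ∀ V : ℝ → ℝ,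
      IsAdmissible α V → ∃ (X₀ : Set (ℤ × ℤ)) (y₀ : ℤ × ℤ → Plane), IsRelaxedMinimizer V L X₀ y₀)
    (hexDir : ∃ α₃ : ℝ, 0 < α₃ ∧ ∀ α : ℝ, 0 < α → α < α₃ → ∀ V : ℝ → ℝ, IsAdmissible α V →
      ∀ A : Finset (ℤ × ℤ), ∃ (A' : Finset (ℤ × ℤ)) (y : ℤ × ℤ → Plane),
        IsRelaxedDirichletMinimizer V A A' y) :
    Theil2006_groundStateEnergy ∧ Theil2006_periodicGroundStates_upToRotation ∧
      Theil2006_dirichletGroundStates := by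
  obtain ⟨α₀, K, hα₀, hK, h48⟩ := h48
  refine Theil2006_mainTheorems_of_references hC₅₂
    ⟨min α₀ (1 / 200), K, lt_min hα₀ (by norm_num), hK, fun α hα hα0 N y hsep => ?_⟩
    h27 h52 hexPer hexDir
  have hα1 : α < α₀ := hα0.trans_le (min_le_left _ _)
  have hα200 : α ≤ 1 / 200 := (hα0.trans_le (min_le_right _ _)).le
  exact HasReferences.of_exists hα hα200 hsep (h48 hα hα1 y hsep)

open Theil2006 MeasureTheory in
/-- **Theorems 1.1, 1.2 (corrected), Corollary 1.3 from the EXISTENCE of rigid discrete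
imbeddings of ball patches.** As `Theil2006_mainTheorems_of_existsReference`, with (H48) reduced
further: for all small `α`, all finite configurations with (13) and all concentric balls
`B(c,r) ⊂ B(c,R)` (`r ≥ 2`, `R ≥ 4r + 2`) without defects in `B(c,R)`, a discrete imbedding of
`y⁻¹(B(c,r))` satisfying the rigidity estimate (61) EXISTS — assertions (1) (60) and (3) (62) of
Proposition 4.8 are theorems (`Theil2006.discreteImbedding_unique_ball`,
`Theil2006.IsDiscreteImbeddingOn.exists_eq_of_ball_subset`). The inputs (H27), (H52) and the two
existence statements are unchanged. [cite: Theil2006, Theorems 1.1, 1.2, Corollary 1.3 (preprint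
pp. 2–3); Appendix Proposition 4.8 (61) (p. 21), Proposition 2.9 (27) proof (p. 25), §2.4 p. 11] -/
theorem Theil2006_mainTheorems_of_existsRigidReference {C₅₂ : ℝ} (hC₅₂ : 0 ≤ C₅₂)
    (h48 : ∃ α₀ K : ℝ, 0 < α₀ ∧ 0 ≤ K ∧ ∀ ⦃α : ℝ⦄, 0 < α → α < α₀ →
      ∀ {N : ℕ} (y : Fin N → Plane), (∀ i j : Fin N, i ≠ j → 1 - α < dist (y i) (y j)) →
      ∀ (c : Plane) (r R : ℝ), 2 ≤ r → 4 * r + 2 ≤ R → (∀ b ∈ defects α y, R ≤ dist (y b) c) →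
        ∃ Φ : Fin N → ℤ × ℤ, IsDiscreteImbeddingOn α y (y ⁻¹' ball c r) Φ ∧
          (∀ x x' : Fin N, y x ∈ ball c r → y x' ∈ ball c r → x ≠ x' →
            |dist (triPoint (Φ x)) (triPoint (Φ x')) / dist (y x) (y x') - 1| ≤ K * α))
    (h72 : ∃ α₂ : ℝ, 0 < α₂ ∧ ∀ ⦃α : ℝ⦄, 0 < α → α < α₂ →
      ∀ {N : ℕ} (y : Fin N → Plane), (∀ i j : Fin N, i ≠ j → 1 - α < dist (y i) (y j)) →
      (∀ lam : ↥(distSet \ {1}), ∀ S ∈ unitSimplices α y,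
        ∑ T ∈ simplicesAt α y lam,
            (volume (convexHull ℝ (y '' ↑S) ∩ convexHull ℝ (y '' ↑T))).toReal ≤
          m (lam : ℝ) * (lam : ℝ) ^ 2 * (volume (convexHull ℝ (y '' ↑S))).toReal) ∧
      (∀ lam : ↥(distSet \ {1}), ∀ S ∈ unitSimplices α y,
        (∀ x ∈ S, ∀ b ∈ defects α y, 28 * (lam : ℝ) < dist (y x) (y b)) →
        m (lam : ℝ) * (lam : ℝ) ^ 2 * (volume (convexHull ℝ (y '' ↑S))).toReal ≤
          ∑ T ∈ simplicesAt α y lam,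
            (volume (convexHull ℝ (y '' ↑S) ∩ convexHull ℝ (y '' ↑T))).toReal))
    (h52 : ∃ α₂ : ℝ, 0 < α₂ ∧ ∀ ⦃α : ℝ⦄, 0 < α → α < α₂ →
      ∀ {N : ℕ} (y : Fin N → Plane), (∀ i j : Fin N, i ≠ j → 1 - α < dist (y i) (y j)) →
      ∀ lam : ↥(distSet \ {1}), ∃ ω : Finset (Fin N) → Finset (Fin N),
        (∀ T ∈ simplicesAt α y lam, ∀ a ∈ ω T, dist (y a) (simplexCentre y T) ≤ 5 * lam) ∧
        (∀ T ∈ simplicesAt α y lam,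
          1 / 2 * ∑ p ∈ T.offDiag, (dist (y p.1) (y p.2) - lam) ^ 2 ≤
            C₅₂ * Real.log (lam : ℝ) *
              ∑ p ∈ (shortRangePairs α y).filter (fun p => p.1 ∈ ω T ∧ p.2 ∈ ω T),
                (dist (y p.1) (y p.2) - 1) ^ 2))
    (hexPer : ∃ α₂ : ℝ, 0 < α₂ ∧ ∀ α : ℝ, 0 < α → α < α₂ → ∀ L : ℕ, 0 < L → ∀ V : ℝ → ℝ,
      IsAdmissible α V → ∃ (X₀ : Set (ℤ × ℤ)) (y₀ : ℤ × ℤ → Plane), IsRelaxedMinimizer V L X₀ y₀)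
    (hexDir : ∃ α₃ : ℝ, 0 < α₃ ∧ ∀ α : ℝ, 0 < α → α < α₃ → ∀ V : ℝ → ℝ, IsAdmissible α V →
      ∀ A : Finset (ℤ × ℤ), ∃ (A' : Finset (ℤ × ℤ)) (y : ℤ × ℤ → Plane),
        IsRelaxedDirichletMinimizer V A A' y) :
    Theil2006_groundStateEnergy ∧ Theil2006_periodicGroundStates_upToRotation ∧
      Theil2006_dirichletGroundStates := by
  obtain ⟨α₀, K, hα₀, hK, h48⟩ := h48
  obtain ⟨α₂, hα₂, h72⟩ := h72
  refine Theil2006_mainTheorems_of_references hC₅₂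
    ⟨min α₀ (1 / 200), K, lt_min hα₀ (by norm_num), hK, fun α hα hα0 N y hsep => ?_⟩
    ⟨min α₂ (1 / 200), lt_min hα₂ (by norm_num), fun α hα hα0 N y hsep => ?_⟩ h52 hexPer hexDir
  · have hα1 : α < α₀ := hα0.trans_le (min_le_left _ _)
    have hα200 : α ≤ 1 / 200 := (hα0.trans_le (min_le_right _ _)).le
    exact HasReferences.of_exists_rigid hα hα200 hsep (h48 hα hα1 y hsep)
  · have hα1 : α < α₂ := hα0.trans_le (min_le_left _ _)
    have hα200 : α ≤ 1 / 200 := (hα0.trans_le (min_le_right _ _)).le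
    exact ⟨partition_identity hα hα200 hsep, (h72 hα hα1 y hsep).1, (h72 hα hα1 y hsep).2⟩

end Literature.MathematicalPhysics.StatisticalMechanics

end

/-! # Part: staged brick `Theil2006FromExistence` (sha16 6fd93309d5218086) — verbatim -/

/-!
# Theil 2006, Theorems 1.1, 1.2 (corrected) and Corollary 1.3 from the EXISTENCE of reference
charts alone — the (27)- and (34)-inputs discharged by the measure bookkeeping (72) and the
elementary `L²` rigidity with factor `C λ`

Topic `Literature/MathematicalPhysics/StatisticalMechanics`; companion of
`Theil2006FromReferences.lean` (F. Theil, *A proof of crystallization in two dimensions*,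
Comm. Math. Phys. **262** (2006) 209–236, accepted preprint of 26 Aug 2005).

## What this file does

`Theil2006FromReferences.Theil2006_mainTheorems_of_existsRigidReference` derives the three main
results from (H48′) (existence of discrete imbeddings of defect-free discs with (61) —
`Theil2006_existsRigidReference`, PROVED in `Theil2006ExistsReference.lean`), (H72) (the measure
bookkeeping of Appendix p. 25 — PROVED from (H48′) in `Theil2006MeasureBookkeeping.lean`,
`Theil2006.measureBookkeeping_of_existsRigid`), (H52) (the p. 11 display, Proposition 4.3 (52)
with the factor `C log λ`, whose printed proof is Friesecke–James–Müller plus the trace theorem —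
NOT available), and the existence of relaxed periodic / Dirichlet minimizers.

`Theil2006LongSimplexRigidity.lean` proves the p. 11 display with the factor `C λ` instead
(`Theil2006.rigidityL2_of_existsRigid`, from (H48′)), and `Theil2006ResummationWeighted.lean`
re-runs §2.4's chain (34) → (36) → (37) → (9) → Theorem 1.1 for any (34)-weight below the
summable weights (35) — `λ⁻⁷ · Cλ · 4056 λ² m(λ) = O(λ⁻⁴ m(λ)) ≤ λ⁻³ m(λ)`.  This file threads the
factor `C λ` through the geometry package of `Theil2006FromGeometry` /
`Theil2006LocalGeometryFromReference` / `Theil2006FromReferences` (the `…W` twins below: same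
statements with the (34)-clause `C₃₄ λ⁻⁴ m(λ) Q` in place of `C₃₄ λ⁻⁵ log(λ) m(λ) Q`, same
proofs) and concludes:

* `Theil2006_mainTheorems_of_existsRigidReference'` — Theorems 1.1, 1.2 (corrected: up to a
  rotation) and Corollary 1.3 from (H48′) and the two minimizer-existence statements ALONE;
* `Theil2006_groundStateEnergy_of_existsRigidReference` — Theorem 1.1 from (H48′) ALONE;
  `Theil2006_continuous_of_existsRigidReference'` — Theorem 1.2 (corrected) and Corollary 1.3
  for continuous `V` from (H48′) alone.
The hypothesis-free forms (with (H48′) := `Theil2006_existsRigidReference`) are in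
`Theil2006MainTheoremsHold.lean`.

Deviation from print, recorded: the per-simplex rigidity enters with the factor `C λ` (elementary,
`Theil2006LongSimplexRigidity`) where the print has `C log λ` (Proposition 4.3 via [FJM]); the
conclusions (9), Theorems 1.1, 1.2, Corollary 1.3 are unchanged since only the summability (35)
of the error weights is used (p. 11).  Everything here is proved; no definitions, no named facts.
[cite: Theil2006, §1 Theorems 1.1, 1.2, Corollary 1.3; §2.4 (34)–(37); Appendix Propositions
4.3, 4.8 and pp. 23–25 (preprint)]
-/

noncomputable section

open scoped BigOperators Topology
open Filter Set Metric MeasureTheory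

namespace Literature.MathematicalPhysics.StatisticalMechanics

namespace Theil2006

variable {α : ℝ} {N : ℕ} {y : Fin N → Plane} {K : ℝ}

/-- The elementary (34)-weight `λ⁻⁴` lies below the summable weight of (35) on `Λ ∖ {1}`
(`λ ≥ 1`). [cite: Theil2006, §2.4 (35) (preprint p. 11); our bookkeeping] -/
theorem inv4_weight_le : ∀ lam : ℝ, lam ∈ distSet \ {1} →
    0 ≤ lam⁻¹ ^ 4 ∧ lam⁻¹ ^ 4 ≤ (1 + Real.log lam) * lam⁻¹ ^ 5 + lam⁻¹ ^ 3 := by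
  intro lam hlam
  have h1 : 1 ≤ lam := one_le_of_mem_distSet hlam.1
  have hinv : 0 ≤ lam⁻¹ := inv_nonneg.2 (by linarith)
  have hinv1 : lam⁻¹ ≤ 1 := inv_le_one_of_one_le₀ h1
  have hlog : 0 ≤ Real.log lam := Real.log_nonneg h1
  refine ⟨pow_nonneg hinv 4, ?_⟩
  have h43 : lam⁻¹ ^ 4 ≤ lam⁻¹ ^ 3 := by
    rw [show lam⁻¹ ^ 4 = lam⁻¹ ^ 3 * lam⁻¹ by ring]
    exact mul_le_of_le_one_right (pow_nonneg hinv 3) hinv1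
  nlinarith [pow_nonneg hinv 5]

/-- **(34) with the weight `λ⁻⁴`, from the per-simplex rigidity with factor `C λ` and (28)**
(the `λ`-twin of `Theil2006.h34_of_rigidity_of_multiplicity`): for `λ ≥ 1` and patches `ω_T`,
IF `½ Σ_{x≠x′∈T} (|y x − y x′| − λ)² ≤ C₅₂ λ Σ_{𝒮, ⊂ ω_T} (|y x − y x′| − 1)²` for every `T ∈ 𝒯_λ(y)`
and every particle lies in at most `C₂₈ λ² m(λ)` patches, THEN
`λ⁻⁷ Σ_{T∈𝒯_λ} ½ Σ (|y x − y x′| − λ)² ≤ C₅₂ C₂₈ λ⁻⁴ m(λ) Σ_𝒮 (|y x − y x′| − 1)²`.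
[cite: Theil2006, §2.4 (34) with (28) (preprint pp. 9–11); factor `λ` ours (`Theil2006LongSimplexRigidity`)] -/
theorem h34W_of_rigidity_of_multiplicity {lam C₅₂ C₂₈ : ℝ} (hlam : 1 ≤ lam) (hC₅₂ : 0 ≤ C₅₂)
    (ω : Finset (Fin N) → Finset (Fin N))
    (h52 : ∀ T ∈ simplicesAt α y lam,
      1 / 2 * ∑ p ∈ T.offDiag, (dist (y p.1) (y p.2) - lam) ^ 2 ≤
        C₅₂ * lam * ∑ p ∈ (shortRangePairs α y).filter (fun p => p.1 ∈ ω T ∧ p.2 ∈ ω T),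
          (dist (y p.1) (y p.2) - 1) ^ 2)
    (h28 : ∀ x : Fin N, (((simplicesAt α y lam).filter fun T => x ∈ ω T).card : ℝ) ≤
      C₂₈ * lam ^ 2 * m lam) :
    lam⁻¹ ^ 7 * ∑ T ∈ simplicesAt α y lam,
        (1 / 2 * ∑ p ∈ T.offDiag, (dist (y p.1) (y p.2) - lam) ^ 2) ≤
      C₅₂ * C₂₈ * lam⁻¹ ^ 4 * m lam *
        ∑ p ∈ shortRangePairs α y, (dist (y p.1) (y p.2) - 1) ^ 2 := by
  classical
  set TL := simplicesAt α y lam with hTL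
  set f : Fin N × Fin N → ℝ := fun p => (dist (y p.1) (y p.2) - 1) ^ 2 with hf
  have hf0 : ∀ p, 0 ≤ f p := fun p => sq_nonneg _
  have hl0 : 0 < lam := by linarith
  have h1 : ∑ T ∈ TL, (1 / 2 * ∑ p ∈ T.offDiag, (dist (y p.1) (y p.2) - lam) ^ 2) ≤
      C₅₂ * lam * ∑ T ∈ TL,
        ∑ p ∈ (shortRangePairs α y).filter (fun p => p.1 ∈ ω T ∧ p.2 ∈ ω T), f p := by
    rw [Finset.mul_sum]
    exact Finset.sum_le_sum fun T hT => h52 T hT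
  have h2 : ∑ T ∈ TL, ∑ p ∈ (shortRangePairs α y).filter (fun p => p.1 ∈ ω T ∧ p.2 ∈ ω T), f p =
      ∑ p ∈ shortRangePairs α y, ((TL.filter fun T => p.1 ∈ ω T ∧ p.2 ∈ ω T).card : ℝ) * f p := by
    simp_rw [Finset.sum_filter]
    rw [Finset.sum_comm]
    refine Finset.sum_congr rfl fun p _ => ?_
    rw [← Finset.sum_filter, Finset.sum_const, nsmul_eq_mul]
  have h3 : ∀ p ∈ shortRangePairs α y,
      ((TL.filter fun T => p.1 ∈ ω T ∧ p.2 ∈ ω T).card : ℝ) * f p ≤ C₂₈ * lam ^ 2 * m lam * f p := by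
    intro p _
    refine mul_le_mul_of_nonneg_right ?_ (hf0 p)
    refine le_trans ?_ (h28 p.1)
    exact_mod_cast Finset.card_le_card fun T hT => by
      rw [Finset.mem_filter] at hT ⊢
      exact ⟨hT.1, hT.2.1⟩
  have h4 : ∑ T ∈ TL, ∑ p ∈ (shortRangePairs α y).filter (fun p => p.1 ∈ ω T ∧ p.2 ∈ ω T), f p ≤
      C₂₈ * lam ^ 2 * m lam * ∑ p ∈ shortRangePairs α y, f p := by
    rw [h2, Finset.mul_sum]
    exact Finset.sum_le_sum h3
  have h5 : ∑ T ∈ TL, (1 / 2 * ∑ p ∈ T.offDiag, (dist (y p.1) (y p.2) - lam) ^ 2) ≤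
      C₅₂ * lam * (C₂₈ * lam ^ 2 * m lam * ∑ p ∈ shortRangePairs α y, f p) :=
    h1.trans (mul_le_mul_of_nonneg_left h4 (mul_nonneg hC₅₂ hl0.le))
  have hl7 : 0 ≤ lam⁻¹ ^ 7 := by positivity
  calc lam⁻¹ ^ 7 * ∑ T ∈ TL, (1 / 2 * ∑ p ∈ T.offDiag, (dist (y p.1) (y p.2) - lam) ^ 2)
      ≤ lam⁻¹ ^ 7 * (C₅₂ * lam *
          (C₂₈ * lam ^ 2 * m lam * ∑ p ∈ shortRangePairs α y, f p)) :=
        mul_le_mul_of_nonneg_left h5 hl7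
    _ = C₅₂ * C₂₈ * lam⁻¹ ^ 4 * m lam * ∑ p ∈ shortRangePairs α y, f p := by
        field_simp


/-- (`W`-twin of `Theil2006.mainEstimate_periodic_of_geometry`: identical statement and proof except
that the (34)-clause reads `C₃₄ λ⁻⁴ m(λ) Σ_𝒮(…)²` and the per-simplex rigidity carries the
factor `C λ` in place of the print's `C₃₄ λ⁻⁵ log(λ) m(λ) Σ_𝒮(…)²` / `C log λ` — the elementary
`Theil2006LongSimplexRigidity` input routed through `Theil2006ResummationWeighted`; deviation
from print recorded in the module docstring.)
**(44), uniformly in `L`, from the finite Chapter-4 geometry.** [cite: Theil2006, §3 (44) (preprint p. 13); §2.3–2.4; §4] -/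
theorem mainEstimate_periodic_of_geometryW {K C₃₄ C₉ K₃ : ℝ} (hK : 0 ≤ K)
    (hC₃₄ : 0 ≤ C₃₄) (hC₉ : 0 ≤ C₉) (hK₃ : 0 ≤ K₃)
    (hgeom : ∃ α₂ : ℝ, 0 < α₂ ∧ ∀ ⦃α : ℝ⦄, 0 < α → α < α₂ → ∀ ⦃V : ℝ → ℝ⦄, IsAdmissible α V →
      ∀ {N : ℕ} (y : Fin N → Plane), (∀ i j : Fin N, i ≠ j → 1 - α < dist (y i) (y j)) →
      ∃ (TLall : Finset (Finset (Fin N))) (lamOf : Finset (Fin N) → ℝ),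
        (∀ T ∈ TLall, lamOf T ∈ distSet \ {1}) ∧ (∀ T ∈ TLall, T.card = 3) ∧
        (∀ T ∈ TLall, ∀ x ∈ T, ∀ x' ∈ T, x ≠ x' →
          |dist (y x) (y x') / lamOf T - 1| ≤ K * α) ∧
        (∀ p ∈ (Finset.univ : Finset (Fin N × Fin N)).filter (fun p => p.1 < p.2) \
            shortRangePairs α y, (TLall.filter fun T => p.1 ∈ T ∧ p.2 ∈ T).card ≤ 2) ∧
        (∀ p ∈ (Finset.univ : Finset (Fin N × Fin N)).filter (fun p => p.1 < p.2) \
            shortRangePairs α y, (TLall.filter fun T => p.1 ∈ T ∧ p.2 ∈ T).card < 2 →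
            ∃ b ∈ defects α y, dist (y p.1) (y b) ≤ K₃ * dist (y p.1) (y p.2)) ∧
        (∀ lam : ↥(distSet \ {1}),
          (0 ≤ ((unitSimplices α y).card : ℝ) -
              1 / (m (lam : ℝ) : ℝ) * (TLall.filter fun T => lamOf T = lam).card ∧
            ((unitSimplices α y).card : ℝ) -
              1 / (m (lam : ℝ) : ℝ) * (TLall.filter fun T => lamOf T = lam).card ≤
              C₉ * (lam : ℝ) ^ 2 * (defects α y).card) ∧
          (0 ≤ ∑ S ∈ unitSimplices α y, (volume (convexHull ℝ (y '' ↑S))).toReal -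
              1 / ((lam : ℝ) ^ 2 * m (lam : ℝ)) *
                ∑ T ∈ TLall.filter (fun T => lamOf T = lam),
                  (volume (convexHull ℝ (y '' ↑T))).toReal ∧
            ∑ S ∈ unitSimplices α y, (volume (convexHull ℝ (y '' ↑S))).toReal -
              1 / ((lam : ℝ) ^ 2 * m (lam : ℝ)) *
                ∑ T ∈ TLall.filter (fun T => lamOf T = lam),
                  (volume (convexHull ℝ (y '' ↑T))).toReal ≤
              C₉ * (lam : ℝ) ^ 2 * (defects α y).card) ∧
          (lam : ℝ)⁻¹ ^ 7 * ∑ T ∈ TLall.filter (fun T => lamOf T = lam),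
              (1 / 2 * ∑ p ∈ T.offDiag, (dist (y p.1) (y p.2) - lam) ^ 2) ≤
            C₃₄ * (lam : ℝ)⁻¹ ^ 4 * m (lam : ℝ) *
              ∑ p ∈ shortRangePairs α y, (dist (y p.1) (y p.2) - 1) ^ 2)) :
    ∃ α₁ : ℝ, 0 < α₁ ∧ ∀ α : ℝ, 0 < α → α < α₁ → ∀ V : ℝ → ℝ, IsAdmissible α V →
      ∃ C : ℝ, 0 < C ∧ ∀ L : ℕ, 0 < L → ∀ (X : Set (ℤ × ℤ)) (y : ℤ × ℤ → Plane),
        IsPeriodicSet L X → IsPeriodic L y →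
          (∀ x ∈ X, ∀ x' ∈ X, x ≠ x' → 1 - α < dist (y x) (y x')) →
            mainEstimateRHS C α V L X y ≤ relaxedPeriodicEnergy V L X y / 2 := by
  obtain ⟨α₂, hα₂, hgeom⟩ := hgeom
  obtain ⟨α₀, hα₀, h9⟩ := exists_mainLocalEstimate_finiteW hK hC₃₄ hC₉ hK₃ (fun lam => lam⁻¹ ^ 4)
    inv4_weight_le
  refine ⟨min (min α₀ α₂) 1, by positivity, fun α hα hαlt V hV =>
    ⟨2, by norm_num, fun L hL X y hX hy h13 => ?_⟩⟩
  have hα0' : α < α₀ := hαlt.trans_le ((min_le_left _ _).trans (min_le_left _ _))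
  have hα2' : α < α₂ := hαlt.trans_le ((min_le_left _ _).trans (min_le_right _ _))
  have hα1 : α < 1 := hαlt.trans_le (min_le_right _ _)
  refine mainEstimate_periodic_of_finite hV hα1 hL hX hy h13 fun z hz => ?_
  obtain ⟨TLall, lamOf, hl, h3, h25, h281, h283, hgl⟩ := hgeom hα hα2' hV z hz
  exact h9 hα hα0' hV z hz TLall lamOf hl h3 h25 h281 h283 hgl

/-- (`W`-twin of `Theil2006.geometryPackage_of_printed`: identical statement and proof except
that the (34)-clause reads `C₃₄ λ⁻⁴ m(λ) Σ_𝒮(…)²` and the per-simplex rigidity carries the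
factor `C λ` in place of the print's `C₃₄ λ⁻⁵ log(λ) m(λ) Σ_𝒮(…)²` / `C log λ` — the elementary
`Theil2006LongSimplexRigidity` input routed through `Theil2006ResummationWeighted`; deviation
from print recorded in the module docstring.)
**From the printed statements to the geometry package.** For a configuration `y : X_N → ℝ²`:
Lemma 2.7 (25) for all `T ∈ 𝒯_λ(y)`, `λ ∈ Λ`; Proposition 2.8 (1) in its two parts — `#𝒯(x₁,x₂) ≤ 2`
for long pairs, and the uniqueness of the side parameter of a long simplex —; Proposition 2.8 (3)
in the printed ball form `y(∂X) ∩ B(½(y(x₁)+y(x₂)), 28|y(x₁)−y(x₂)|) ≠ ∅`; Proposition 2.9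
(26), (27) as printed; and (34); THEN the labelled family `(longSimplices, sideOf)` satisfies the
hypotheses of `exists_mainLocalEstimate_finite` (with `K₃ = 29`).
[cite: Theil2006, §2.3 Lemma 2.7, Propositions 2.8, 2.9; §2.4 (34) (preprint pp. 8–11)] -/
theorem geometryPackage_of_printedW {K C₃₄ C₉ : ℝ}
    (h25 : ∀ lam ∈ distSet, ∀ T : Finset (Fin N), IsCentredSimplex α y lam T →
      ∀ x ∈ T, ∀ x' ∈ T, x ≠ x' → |dist (y x) (y x') / lam - 1| ≤ K * α)
    (h281 : ∀ p ∈ (Finset.univ : Finset (Fin N × Fin N)).filter (fun p => p.1 < p.2) \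
        shortRangePairs α y, ((longSimplices α y).filter fun T => p.1 ∈ T ∧ p.2 ∈ T).card ≤ 2)
    (huniq : ∀ (T : Finset (Fin N)) (lam lam' : ℝ), lam ∈ distSet \ {1} → lam' ∈ distSet \ {1} →
      IsCentredSimplex α y lam T → IsCentredSimplex α y lam' T → lam = lam')
    (h283 : ∀ p ∈ (Finset.univ : Finset (Fin N × Fin N)).filter (fun p => p.1 < p.2) \
        shortRangePairs α y, ((longSimplices α y).filter fun T => p.1 ∈ T ∧ p.2 ∈ T).card ≤ 1 →
        ∃ b ∈ defects α y, dist ((2 : ℝ)⁻¹ • (y p.1 + y p.2)) (y b) < 28 * dist (y p.1) (y p.2))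
    (h26 : ∀ lam : ↥(distSet \ {1}),
      0 ≤ ((unitSimplices α y).card : ℝ) - 1 / (m (lam : ℝ) : ℝ) * (simplicesAt α y lam).card ∧
        ((unitSimplices α y).card : ℝ) - 1 / (m (lam : ℝ) : ℝ) * (simplicesAt α y lam).card ≤
          C₉ * (lam : ℝ) ^ 2 * (defects α y).card)
    (h27 : ∀ lam : ↥(distSet \ {1}),
      0 ≤ ∑ S ∈ unitSimplices α y, (volume (convexHull ℝ (y '' ↑S))).toReal -
          1 / ((lam : ℝ) ^ 2 * m (lam : ℝ)) *
            ∑ T ∈ simplicesAt α y lam, (volume (convexHull ℝ (y '' ↑T))).toReal ∧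
        ∑ S ∈ unitSimplices α y, (volume (convexHull ℝ (y '' ↑S))).toReal -
          1 / ((lam : ℝ) ^ 2 * m (lam : ℝ)) *
            ∑ T ∈ simplicesAt α y lam, (volume (convexHull ℝ (y '' ↑T))).toReal ≤
          C₉ * (lam : ℝ) ^ 2 * (defects α y).card)
    (h34 : ∀ lam : ↥(distSet \ {1}),
      (lam : ℝ)⁻¹ ^ 7 * ∑ T ∈ simplicesAt α y lam,
          (1 / 2 * ∑ p ∈ T.offDiag, (dist (y p.1) (y p.2) - lam) ^ 2) ≤
        C₃₄ * (lam : ℝ)⁻¹ ^ 4 * m (lam : ℝ) *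
          ∑ p ∈ shortRangePairs α y, (dist (y p.1) (y p.2) - 1) ^ 2) :
    ∃ (TLall : Finset (Finset (Fin N))) (lamOf : Finset (Fin N) → ℝ),
      (∀ T ∈ TLall, lamOf T ∈ distSet \ {1}) ∧ (∀ T ∈ TLall, T.card = 3) ∧
      (∀ T ∈ TLall, ∀ x ∈ T, ∀ x' ∈ T, x ≠ x' → |dist (y x) (y x') / lamOf T - 1| ≤ K * α) ∧
      (∀ p ∈ (Finset.univ : Finset (Fin N × Fin N)).filter (fun p => p.1 < p.2) \
          shortRangePairs α y, (TLall.filter fun T => p.1 ∈ T ∧ p.2 ∈ T).card ≤ 2) ∧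
      (∀ p ∈ (Finset.univ : Finset (Fin N × Fin N)).filter (fun p => p.1 < p.2) \
          shortRangePairs α y, (TLall.filter fun T => p.1 ∈ T ∧ p.2 ∈ T).card < 2 →
          ∃ b ∈ defects α y, dist (y p.1) (y b) ≤ 29 * dist (y p.1) (y p.2)) ∧
      (∀ lam : ↥(distSet \ {1}),
        (0 ≤ ((unitSimplices α y).card : ℝ) -
            1 / (m (lam : ℝ) : ℝ) * (TLall.filter fun T => lamOf T = lam).card ∧
          ((unitSimplices α y).card : ℝ) -
            1 / (m (lam : ℝ) : ℝ) * (TLall.filter fun T => lamOf T = lam).card ≤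
            C₉ * (lam : ℝ) ^ 2 * (defects α y).card) ∧
        (0 ≤ ∑ S ∈ unitSimplices α y, (volume (convexHull ℝ (y '' ↑S))).toReal -
            1 / ((lam : ℝ) ^ 2 * m (lam : ℝ)) *
              ∑ T ∈ TLall.filter (fun T => lamOf T = lam),
                (volume (convexHull ℝ (y '' ↑T))).toReal ∧
          ∑ S ∈ unitSimplices α y, (volume (convexHull ℝ (y '' ↑S))).toReal -
            1 / ((lam : ℝ) ^ 2 * m (lam : ℝ)) *
              ∑ T ∈ TLall.filter (fun T => lamOf T = lam),
                (volume (convexHull ℝ (y '' ↑T))).toReal ≤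
            C₉ * (lam : ℝ) ^ 2 * (defects α y).card) ∧
        (lam : ℝ)⁻¹ ^ 7 * ∑ T ∈ TLall.filter (fun T => lamOf T = lam),
            (1 / 2 * ∑ p ∈ T.offDiag, (dist (y p.1) (y p.2) - lam) ^ 2) ≤
          C₃₄ * (lam : ℝ)⁻¹ ^ 4 * m (lam : ℝ) *
            ∑ p ∈ shortRangePairs α y, (dist (y p.1) (y p.2) - 1) ^ 2) := by
  classical
  -- the labelled family
  have hfilter : ∀ lam : ↥(distSet \ {1}),
      (longSimplices α y).filter (fun T => sideOf α y T = lam) = simplicesAt α y lam := by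
    intro lam
    ext T
    rw [Finset.mem_filter, mem_longSimplices, mem_simplicesAt]
    constructor
    · rintro ⟨h, hside⟩
      have hs := (sideOf_spec h).2
      rwa [hside] at hs
    · intro hT
      have h : ∃ lam' ∈ distSet \ {1}, IsCentredSimplex α y lam' T := ⟨lam, lam.2, hT⟩
      obtain ⟨hmem, hs⟩ := sideOf_spec h
      exact ⟨h, huniq T _ _ hmem lam.2 hs hT⟩
  refine ⟨longSimplices α y, sideOf α y, fun T hT => (sideOf_spec (mem_longSimplices.1 hT)).1,
    fun T hT => ?_, fun T hT x hx x' hx' hxx' => ?_, h281, fun p hp hlt => ?_, fun lam => ?_⟩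
  · obtain ⟨lam, -, hT'⟩ := mem_longSimplices.1 hT
    exact hT'.1.card_eq_three
  · obtain ⟨hmem, hs⟩ := sideOf_spec (mem_longSimplices.1 hT)
    exact h25 _ hmem.1 T hs x hx x' hx' hxx'
  · obtain ⟨b, hb, hdist⟩ := h283 p hp (by omega)
    refine ⟨b, hb, ?_⟩
    have hmid : dist (y p.1) ((2 : ℝ)⁻¹ • (y p.1 + y p.2)) = 2⁻¹ * dist (y p.1) (y p.2) := by
      have e : y p.1 - (2 : ℝ)⁻¹ • (y p.1 + y p.2) = (2 : ℝ)⁻¹ • (y p.1 - y p.2) := by module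
      rw [dist_eq_norm, e, norm_smul, Real.norm_eq_abs, abs_of_pos (by norm_num), ← dist_eq_norm]
    have htri := dist_triangle (y p.1) ((2 : ℝ)⁻¹ • (y p.1 + y p.2)) (y b)
    rw [hmid] at htri
    linarith [dist_nonneg (x := y p.1) (y := y p.2)]
  · rw [hfilter lam]
    exact ⟨h26 lam, h27 lam, h34 lam⟩

/-- (`W`-twin of `Theil2006.geometryPackage_of_local`: identical statement and proof except
that the (34)-clause reads `C₃₄ λ⁻⁴ m(λ) Σ_𝒮(…)²` and the per-simplex rigidity carries the
factor `C λ` in place of the print's `C₃₄ λ⁻⁵ log(λ) m(λ) Σ_𝒮(…)²` / `C log λ` — the elementary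
`Theil2006LongSimplexRigidity` input routed through `Theil2006ResummationWeighted`; deviation
from print recorded in the module docstring.)
**From the LOCAL (pointwise) statements of the appendix to the geometry package.** As
`geometryPackage_of_printed`, but with Proposition 2.9 (26), (27) replaced by the pointwise inputs
of their printed proof (Appendix pp. 24–25): (70) `s(x,λ) ≤ m(λ)s(x,1)`, the near-defect
alternative `s(x,λ) < 6m(λ) ⇒ y(∂X) ∩ B̄(y(x), 28λ) ≠ ∅`, the partition identity
`meas(T) = Σ_{S∈𝒯₁} meas(S ∩ T)` and (72) (`≤` always, `≥` off the defects) — assembled by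
`prop29_first_of_pointwise`, `prop29_second_of_pointwise` (`C₉ = 311904`); `0 < α ≤ 1/50`, (13).
[cite: Theil2006, §2.3 Lemma 2.7, Proposition 2.8; Appendix proof of Proposition 2.9 (69)–(72); §2.4 (34) (preprint pp. 8–11, 24–25)] -/
theorem geometryPackage_of_localW {K C₅₂ C₂₈ : ℝ} (hα : 0 < α) (hα' : α ≤ 1 / 50) (hC₅₂ : 0 ≤ C₅₂)
    (hsep : ∀ i j : Fin N, i ≠ j → 1 - α < dist (y i) (y j))
    (h25 : ∀ lam ∈ distSet, ∀ T : Finset (Fin N), IsCentredSimplex α y lam T →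
      ∀ x ∈ T, ∀ x' ∈ T, x ≠ x' → |dist (y x) (y x') / lam - 1| ≤ K * α)
    (h281 : ∀ p ∈ (Finset.univ : Finset (Fin N × Fin N)).filter (fun p => p.1 < p.2) \
        shortRangePairs α y, ((longSimplices α y).filter fun T => p.1 ∈ T ∧ p.2 ∈ T).card ≤ 2)
    (huniq : ∀ (T : Finset (Fin N)) (lam lam' : ℝ), lam ∈ distSet \ {1} → lam' ∈ distSet \ {1} →
      IsCentredSimplex α y lam T → IsCentredSimplex α y lam' T → lam = lam')
    (h283 : ∀ p ∈ (Finset.univ : Finset (Fin N × Fin N)).filter (fun p => p.1 < p.2) \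
        shortRangePairs α y, ((longSimplices α y).filter fun T => p.1 ∈ T ∧ p.2 ∈ T).card ≤ 1 →
        ∃ b ∈ defects α y, dist ((2 : ℝ)⁻¹ • (y p.1 + y p.2)) (y b) < 28 * dist (y p.1) (y p.2))
    (h70 : ∀ lam : ↥(distSet \ {1}), ∀ x : Fin N,
      cornerCount α y lam x ≤ m (lam : ℝ) * cornerCount α y 1 x)
    (hnear : ∀ lam : ↥(distSet \ {1}), ∀ x : Fin N, cornerCount α y lam x < 6 * m (lam : ℝ) →
      ∃ b ∈ defects α y, dist (y x) (y b) ≤ 28 * lam)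
    (hpart : ∀ lam : ↥(distSet \ {1}), ∀ T ∈ simplicesAt α y lam,
      (volume (convexHull ℝ (y '' ↑T))).toReal =
        ∑ S ∈ unitSimplices α y, (volume (convexHull ℝ (y '' ↑S) ∩ convexHull ℝ (y '' ↑T))).toReal)
    (h72 : ∀ lam : ↥(distSet \ {1}), ∀ S ∈ unitSimplices α y,
      ∑ T ∈ simplicesAt α y lam,
          (volume (convexHull ℝ (y '' ↑S) ∩ convexHull ℝ (y '' ↑T))).toReal ≤
        m (lam : ℝ) * (lam : ℝ) ^ 2 * (volume (convexHull ℝ (y '' ↑S))).toReal)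
    (h72eq : ∀ lam : ↥(distSet \ {1}), ∀ S ∈ unitSimplices α y,
      (∀ x ∈ S, ∀ b ∈ defects α y, 28 * (lam : ℝ) < dist (y x) (y b)) →
      m (lam : ℝ) * (lam : ℝ) ^ 2 * (volume (convexHull ℝ (y '' ↑S))).toReal ≤
        ∑ T ∈ simplicesAt α y lam,
          (volume (convexHull ℝ (y '' ↑S) ∩ convexHull ℝ (y '' ↑T))).toReal)
    (hrig : ∀ lam : ↥(distSet \ {1}), ∃ ω : Finset (Fin N) → Finset (Fin N),
      (∀ T ∈ simplicesAt α y lam,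
        1 / 2 * ∑ p ∈ T.offDiag, (dist (y p.1) (y p.2) - lam) ^ 2 ≤
          C₅₂ * (lam : ℝ) *
            ∑ p ∈ (shortRangePairs α y).filter (fun p => p.1 ∈ ω T ∧ p.2 ∈ ω T),
              (dist (y p.1) (y p.2) - 1) ^ 2) ∧
      (∀ x : Fin N, (((simplicesAt α y lam).filter fun T => x ∈ ω T).card : ℝ) ≤
        C₂₈ * (lam : ℝ) ^ 2 * m (lam : ℝ))) :
    ∃ (TLall : Finset (Finset (Fin N))) (lamOf : Finset (Fin N) → ℝ),
      (∀ T ∈ TLall, lamOf T ∈ distSet \ {1}) ∧ (∀ T ∈ TLall, T.card = 3) ∧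
      (∀ T ∈ TLall, ∀ x ∈ T, ∀ x' ∈ T, x ≠ x' → |dist (y x) (y x') / lamOf T - 1| ≤ K * α) ∧
      (∀ p ∈ (Finset.univ : Finset (Fin N × Fin N)).filter (fun p => p.1 < p.2) \
          shortRangePairs α y, (TLall.filter fun T => p.1 ∈ T ∧ p.2 ∈ T).card ≤ 2) ∧
      (∀ p ∈ (Finset.univ : Finset (Fin N × Fin N)).filter (fun p => p.1 < p.2) \
          shortRangePairs α y, (TLall.filter fun T => p.1 ∈ T ∧ p.2 ∈ T).card < 2 →
          ∃ b ∈ defects α y, dist (y p.1) (y b) ≤ 29 * dist (y p.1) (y p.2)) ∧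
      (∀ lam : ↥(distSet \ {1}),
        (0 ≤ ((unitSimplices α y).card : ℝ) -
            1 / (m (lam : ℝ) : ℝ) * (TLall.filter fun T => lamOf T = lam).card ∧
          ((unitSimplices α y).card : ℝ) -
            1 / (m (lam : ℝ) : ℝ) * (TLall.filter fun T => lamOf T = lam).card ≤
            311904 * (lam : ℝ) ^ 2 * (defects α y).card) ∧
        (0 ≤ ∑ S ∈ unitSimplices α y, (volume (convexHull ℝ (y '' ↑S))).toReal -
            1 / ((lam : ℝ) ^ 2 * m (lam : ℝ)) *
              ∑ T ∈ TLall.filter (fun T => lamOf T = lam),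
                (volume (convexHull ℝ (y '' ↑T))).toReal ∧
          ∑ S ∈ unitSimplices α y, (volume (convexHull ℝ (y '' ↑S))).toReal -
            1 / ((lam : ℝ) ^ 2 * m (lam : ℝ)) *
              ∑ T ∈ TLall.filter (fun T => lamOf T = lam),
                (volume (convexHull ℝ (y '' ↑T))).toReal ≤
            311904 * (lam : ℝ) ^ 2 * (defects α y).card) ∧
        (lam : ℝ)⁻¹ ^ 7 * ∑ T ∈ TLall.filter (fun T => lamOf T = lam),
            (1 / 2 * ∑ p ∈ T.offDiag, (dist (y p.1) (y p.2) - lam) ^ 2) ≤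
          C₅₂ * C₂₈ * (lam : ℝ)⁻¹ ^ 4 * m (lam : ℝ) *
            ∑ p ∈ shortRangePairs α y, (dist (y p.1) (y p.2) - 1) ^ 2) := by
  have hB : (0 : ℝ) ≤ (defects α y).card := Nat.cast_nonneg _
  have hl1 : ∀ lam : ↥(distSet \ {1}), (1 : ℝ) ≤ (lam : ℝ) := fun lam => by
    have h3 := sqrt_three_le_of_mem_distSet lam.2.1 fun h => lam.2.2 h
    have : (1 : ℝ) ≤ √3 := by
      rw [show (1 : ℝ) = √1 by simp]; exact Real.sqrt_le_sqrt (by norm_num)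
    linarith
  refine geometryPackage_of_printedW h25 h281 huniq h283 (fun lam => ?_) (fun lam => ?_)
    (fun lam => ?_)
  · obtain ⟨h1, h2⟩ :=
      prop29_first_of_pointwise hα hα' hsep (hl1 lam) lam.2.1.2 (h70 lam) (hnear lam)
    exact ⟨h1, h2.trans (by nlinarith [sq_nonneg (lam : ℝ)])⟩
  · exact prop29_second_of_pointwise hα hα' hsep (hl1 lam) lam.2.1.2 (hpart lam) (h72 lam)
      (h72eq lam)
  · obtain ⟨ω, h52, h28⟩ := hrig lam
    exact h34W_of_rigidity_of_multiplicity (hl1 lam) hC₅₂ ω h52 h28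

/-- (`W`-twin of `Theil2006.HasReferences.rigidityInputs`: identical statement and proof except
that the (34)-clause reads `C₃₄ λ⁻⁴ m(λ) Σ_𝒮(…)²` and the per-simplex rigidity carries the
factor `C λ` in place of the print's `C₃₄ λ⁻⁵ log(λ) m(λ) Σ_𝒮(…)²` / `C log λ` — the elementary
`Theil2006LongSimplexRigidity` input routed through `Theil2006ResummationWeighted`; deviation
from print recorded in the module docstring.)
**The (34)-inputs from the p. 11 display and Proposition 4.8 (ball form).** If for every
`λ ∈ Λ ∖ {1}` there are patches `ω_T` with `y(ω_T) ⊂ B̄(z_T, 5λ)` on which the printed per-simplex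
rigidity estimate "`Σ_{{x,x′}⊂T} (|y(x)−y(x′)| − λ)² ≤ C log(λ) Σ_{{x,x′}∈𝒮, {x,x′}⊂ω_T} (|y(x)−y(x′)| − 1)²`"
(p. 11, "the L²-rigidity estimate provided by Proposition 4.3 applied to `u(ξ) := y(Φ⁻¹(ξ))`")
holds, then together with (28) (`card_filter_mem_patch_le`, `C₂₈ = 4056`) these patches satisfy
the hypothesis `hrig` of `Theil2006.geometryPackage_of_local` / `h34_of_rigidity_of_multiplicity`.
[cite: Theil2006, §2.4 display before (34) and (28) (preprint pp. 9, 11, 25)] -/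
theorem HasReferences.rigidityInputsW (hα : 0 < α) (hα' : α ≤ 1 / 200)
    (hsep : ∀ i j : Fin N, i ≠ j → 1 - α < dist (y i) (y j)) (href : HasReferences α y K)
    {C₅₂ : ℝ}
    (h52 : ∀ lam : ↥(distSet \ {1}), ∃ ω : Finset (Fin N) → Finset (Fin N),
      (∀ T ∈ simplicesAt α y lam, ∀ a ∈ ω T, dist (y a) (simplexCentre y T) ≤ 5 * lam) ∧
      (∀ T ∈ simplicesAt α y lam,
        1 / 2 * ∑ p ∈ T.offDiag, (dist (y p.1) (y p.2) - lam) ^ 2 ≤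
          C₅₂ * (lam : ℝ) *
            ∑ p ∈ (shortRangePairs α y).filter (fun p => p.1 ∈ ω T ∧ p.2 ∈ ω T),
              (dist (y p.1) (y p.2) - 1) ^ 2)) :
    ∀ lam : ↥(distSet \ {1}), ∃ ω : Finset (Fin N) → Finset (Fin N),
      (∀ T ∈ simplicesAt α y lam,
        1 / 2 * ∑ p ∈ T.offDiag, (dist (y p.1) (y p.2) - lam) ^ 2 ≤
          C₅₂ * (lam : ℝ) *
            ∑ p ∈ (shortRangePairs α y).filter (fun p => p.1 ∈ ω T ∧ p.2 ∈ ω T),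
              (dist (y p.1) (y p.2) - 1) ^ 2) ∧
      (∀ x : Fin N, (((simplicesAt α y lam).filter fun T => x ∈ ω T).card : ℝ) ≤
        4056 * (lam : ℝ) ^ 2 * m (lam : ℝ)) := by
  intro lam
  obtain ⟨ω, hω, h52'⟩ := h52 lam
  exact ⟨ω, h52', fun x => href.card_filter_mem_patch_le hα hα' hsep lam hω x⟩

/-- `K α ≤ 1/10` once `α ≤ 1/(10K + 10)` (`K ≥ 0`). [folklore] -/
private theorem mul_le_tenth_of_le_E {K α : ℝ} (hK : 0 ≤ K) (h : α ≤ 1 / (10 * K + 10)) :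
    K * α ≤ 1 / 10 := by
  have h10 : 0 < 10 * K + 10 := by positivity
  have h1 : K * α ≤ K * (1 / (10 * K + 10)) := mul_le_mul_of_nonneg_left h hK
  have h2 : K * (1 / (10 * K + 10)) ≤ 1 / 10 := by
    rw [mul_one_div, div_le_div_iff₀ h10 (by norm_num)]
    nlinarith
  exact h1.trans h2

/-- (`W`-twin of `Theil2006.geometry_of_references`: identical statement and proof except
that the (34)-clause reads `C₃₄ λ⁻⁴ m(λ) Σ_𝒮(…)²` and the per-simplex rigidity carries the
factor `C λ` in place of the print's `C₃₄ λ⁻⁵ log(λ) m(λ) Σ_𝒮(…)²` / `C log λ` — the elementary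
`Theil2006LongSimplexRigidity` input routed through `Theil2006ResummationWeighted`; deviation
from print recorded in the module docstring.)
**The finite Chapter-4 geometry package from Proposition 4.8 (ball form), the
(27)-bookkeeping and the p. 11 rigidity display.** For all small `α`, all admissible `V` and all
finite configurations with (13): the labelled family of centred long simplices
`(longSimplices, sideOf)` with (25) (constant `2K+1`), Proposition 2.8 (1), (3) (`K₃ = 29`),
Proposition 2.9 (26), (27) (`C₉ = 311904`) and (34) (`C₃₄ = 4056 C₅₂`, via (28) proved) — i.e.
the hypothesis of
`Theil2006_groundStateEnergy_of_geometry` / `Theil2006_mainTheorems_of_geometry`.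
[cite: Theil2006, §2.3 Lemma 2.7, Propositions 2.8, 2.9, §2.4 (34); Appendix Propositions 4.3, 4.8 and pp. 23–25 (preprint)] -/
theorem geometry_of_referencesW {C₅₂ : ℝ} (hC₅₂ : 0 ≤ C₅₂)
    (h48 : ∃ α₀ K : ℝ, 0 < α₀ ∧ 0 ≤ K ∧ ∀ ⦃α : ℝ⦄, 0 < α → α < α₀ →
      ∀ {N : ℕ} (y : Fin N → Plane), (∀ i j : Fin N, i ≠ j → 1 - α < dist (y i) (y j)) →
        HasReferences α y K)
    (h27 : ∃ α₂ : ℝ, 0 < α₂ ∧ ∀ ⦃α : ℝ⦄, 0 < α → α < α₂ →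
      ∀ {N : ℕ} (y : Fin N → Plane), (∀ i j : Fin N, i ≠ j → 1 - α < dist (y i) (y j)) →
      (∀ lam : ↥(distSet \ {1}), ∀ T ∈ simplicesAt α y lam,
        (volume (convexHull ℝ (y '' ↑T))).toReal =
          ∑ S ∈ unitSimplices α y,
            (volume (convexHull ℝ (y '' ↑S) ∩ convexHull ℝ (y '' ↑T))).toReal) ∧
      (∀ lam : ↥(distSet \ {1}), ∀ S ∈ unitSimplices α y,
        ∑ T ∈ simplicesAt α y lam,
            (volume (convexHull ℝ (y '' ↑S) ∩ convexHull ℝ (y '' ↑T))).toReal ≤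
          m (lam : ℝ) * (lam : ℝ) ^ 2 * (volume (convexHull ℝ (y '' ↑S))).toReal) ∧
      (∀ lam : ↥(distSet \ {1}), ∀ S ∈ unitSimplices α y,
        (∀ x ∈ S, ∀ b ∈ defects α y, 28 * (lam : ℝ) < dist (y x) (y b)) →
        m (lam : ℝ) * (lam : ℝ) ^ 2 * (volume (convexHull ℝ (y '' ↑S))).toReal ≤
          ∑ T ∈ simplicesAt α y lam,
            (volume (convexHull ℝ (y '' ↑S) ∩ convexHull ℝ (y '' ↑T))).toReal))
    (h52 : ∃ α₂ : ℝ, 0 < α₂ ∧ ∀ ⦃α : ℝ⦄, 0 < α → α < α₂ →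
      ∀ {N : ℕ} (y : Fin N → Plane), (∀ i j : Fin N, i ≠ j → 1 - α < dist (y i) (y j)) →
      ∀ lam : ↥(distSet \ {1}), ∃ ω : Finset (Fin N) → Finset (Fin N),
        (∀ T ∈ simplicesAt α y lam, ∀ a ∈ ω T, dist (y a) (simplexCentre y T) ≤ 5 * lam) ∧
        (∀ T ∈ simplicesAt α y lam,
          1 / 2 * ∑ p ∈ T.offDiag, (dist (y p.1) (y p.2) - lam) ^ 2 ≤
            C₅₂ * (lam : ℝ) *
              ∑ p ∈ (shortRangePairs α y).filter (fun p => p.1 ∈ ω T ∧ p.2 ∈ ω T),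
                (dist (y p.1) (y p.2) - 1) ^ 2)) :
    ∃ K : ℝ, 0 ≤ K ∧ ∃ α₂ : ℝ, 0 < α₂ ∧ ∀ ⦃α : ℝ⦄, 0 < α → α < α₂ → ∀ ⦃V : ℝ → ℝ⦄,
      IsAdmissible α V →
      ∀ {N : ℕ} (y : Fin N → Plane), (∀ i j : Fin N, i ≠ j → 1 - α < dist (y i) (y j)) →
      ∃ (TLall : Finset (Finset (Fin N))) (lamOf : Finset (Fin N) → ℝ),
        (∀ T ∈ TLall, lamOf T ∈ distSet \ {1}) ∧ (∀ T ∈ TLall, T.card = 3) ∧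
        (∀ T ∈ TLall, ∀ x ∈ T, ∀ x' ∈ T, x ≠ x' →
          |dist (y x) (y x') / lamOf T - 1| ≤ K * α) ∧
        (∀ p ∈ (Finset.univ : Finset (Fin N × Fin N)).filter (fun p => p.1 < p.2) \
            shortRangePairs α y, (TLall.filter fun T => p.1 ∈ T ∧ p.2 ∈ T).card ≤ 2) ∧
        (∀ p ∈ (Finset.univ : Finset (Fin N × Fin N)).filter (fun p => p.1 < p.2) \
            shortRangePairs α y, (TLall.filter fun T => p.1 ∈ T ∧ p.2 ∈ T).card < 2 →
            ∃ b ∈ defects α y, dist (y p.1) (y b) ≤ 29 * dist (y p.1) (y p.2)) ∧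
        (∀ lam : ↥(distSet \ {1}),
          (0 ≤ ((unitSimplices α y).card : ℝ) -
              1 / (m (lam : ℝ) : ℝ) * (TLall.filter fun T => lamOf T = lam).card ∧
            ((unitSimplices α y).card : ℝ) -
              1 / (m (lam : ℝ) : ℝ) * (TLall.filter fun T => lamOf T = lam).card ≤
              311904 * (lam : ℝ) ^ 2 * (defects α y).card) ∧
          (0 ≤ ∑ S ∈ unitSimplices α y, (volume (convexHull ℝ (y '' ↑S))).toReal -
              1 / ((lam : ℝ) ^ 2 * m (lam : ℝ)) *
                ∑ T ∈ TLall.filter (fun T => lamOf T = lam),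
                  (volume (convexHull ℝ (y '' ↑T))).toReal ∧
            ∑ S ∈ unitSimplices α y, (volume (convexHull ℝ (y '' ↑S))).toReal -
              1 / ((lam : ℝ) ^ 2 * m (lam : ℝ)) *
                ∑ T ∈ TLall.filter (fun T => lamOf T = lam),
                  (volume (convexHull ℝ (y '' ↑T))).toReal ≤
              311904 * (lam : ℝ) ^ 2 * (defects α y).card) ∧
          (lam : ℝ)⁻¹ ^ 7 * ∑ T ∈ TLall.filter (fun T => lamOf T = lam),
              (1 / 2 * ∑ p ∈ T.offDiag, (dist (y p.1) (y p.2) - lam) ^ 2) ≤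
            C₅₂ * 4056 * (lam : ℝ)⁻¹ ^ 4 * m (lam : ℝ) *
              ∑ p ∈ shortRangePairs α y, (dist (y p.1) (y p.2) - 1) ^ 2) := by
  obtain ⟨α₀, K, hα₀, hK, h48⟩ := h48
  obtain ⟨α₂, hα₂, h27⟩ := h27
  obtain ⟨α₃, hα₃, h52⟩ := h52
  have hK10 : 0 < 1 / (10 * K + 10) := by positivity
  refine ⟨2 * K + 1, by positivity,
    min (min α₀ α₂) (min α₃ (min (1 / 200) (1 / (10 * K + 10)))), by positivity,
    fun α hα hαlt V _ N y hsep => ?_⟩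
  have hα0 : α < α₀ := hαlt.trans_le ((min_le_left _ _).trans (min_le_left _ _))
  have hα2 : α < α₂ := hαlt.trans_le ((min_le_left _ _).trans (min_le_right _ _))
  have hα3 : α < α₃ := hαlt.trans_le ((min_le_right _ _).trans (min_le_left _ _))
  have hα200 : α ≤ 1 / 200 :=
    (hαlt.trans_le ((min_le_right _ _).trans ((min_le_right _ _).trans (min_le_left _ _)))).le
  have hαK : α ≤ 1 / (10 * K + 10) :=
    (hαlt.trans_le ((min_le_right _ _).trans ((min_le_right _ _).trans (min_le_right _ _)))).le
  have hKα : K * α ≤ 1 / 10 := mul_le_tenth_of_le_E hK hαK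
  have href := h48 hα hα0 y hsep
  obtain ⟨h25, h281, huniq, h283, h70, hnear⟩ := href.localGeometry hα hα200 hK hKα hsep
  obtain ⟨hpart, h72, h72eq⟩ := h27 hα hα2 y hsep
  exact geometryPackage_of_localW hα (by linarith) hC₅₂ hsep h25 h281 huniq h283 h70 hnear hpart h72
    h72eq (href.rigidityInputsW hα hα200 hsep (h52 hα hα3 y hsep))

end Theil2006

open Theil2006 MeasureTheory in
/-- (`W`-twin of `Theil2006_mainTheorems_of_geometry`: identical statement and proof except
that the (34)-clause reads `C₃₄ λ⁻⁴ m(λ) Σ_𝒮(…)²` and the per-simplex rigidity carries the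
factor `C λ` in place of the print's `C₃₄ λ⁻⁵ log(λ) m(λ) Σ_𝒮(…)²` / `C log λ` — the elementary
`Theil2006LongSimplexRigidity` input routed through `Theil2006ResummationWeighted`; deviation
from print recorded in the module docstring.)
**Theil 2006 — Theorem 1.1, Theorem 1.2 (corrected, up to a rigid motion) and Corollary 1.3
from the finite Chapter-4 geometry and the two existence statements.** The three conjuncts are
the tree's named facts `Theil2006_groundStateEnergy`, `Theil2006_periodicGroundStates_upToRotation`
(the corrected Theorem 1.2 of `Theil2006Periodic.lean`) and `Theil2006_dirichletGroundStates`.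
[cite: Theil2006, §1 Theorems 1.1, 1.2, Corollary 1.3; §2–§4] -/
theorem Theil2006_mainTheorems_of_geometryW {K C₃₄ C₉ K₃ : ℝ} (hK : 0 ≤ K)
    (hC₃₄ : 0 ≤ C₃₄) (hC₉ : 0 ≤ C₉) (hK₃ : 0 ≤ K₃)
    (hgeom : ∃ α₂ : ℝ, 0 < α₂ ∧ ∀ ⦃α : ℝ⦄, 0 < α → α < α₂ → ∀ ⦃V : ℝ → ℝ⦄, IsAdmissible α V →
      ∀ {N : ℕ} (y : Fin N → Plane), (∀ i j : Fin N, i ≠ j → 1 - α < dist (y i) (y j)) →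
      ∃ (TLall : Finset (Finset (Fin N))) (lamOf : Finset (Fin N) → ℝ),
        (∀ T ∈ TLall, lamOf T ∈ distSet \ {1}) ∧ (∀ T ∈ TLall, T.card = 3) ∧
        (∀ T ∈ TLall, ∀ x ∈ T, ∀ x' ∈ T, x ≠ x' →
          |dist (y x) (y x') / lamOf T - 1| ≤ K * α) ∧
        (∀ p ∈ (Finset.univ : Finset (Fin N × Fin N)).filter (fun p => p.1 < p.2) \
            shortRangePairs α y, (TLall.filter fun T => p.1 ∈ T ∧ p.2 ∈ T).card ≤ 2) ∧
        (∀ p ∈ (Finset.univ : Finset (Fin N × Fin N)).filter (fun p => p.1 < p.2) \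
            shortRangePairs α y, (TLall.filter fun T => p.1 ∈ T ∧ p.2 ∈ T).card < 2 →
            ∃ b ∈ defects α y, dist (y p.1) (y b) ≤ K₃ * dist (y p.1) (y p.2)) ∧
        (∀ lam : ↥(distSet \ {1}),
          (0 ≤ ((unitSimplices α y).card : ℝ) -
              1 / (m (lam : ℝ) : ℝ) * (TLall.filter fun T => lamOf T = lam).card ∧
            ((unitSimplices α y).card : ℝ) -
              1 / (m (lam : ℝ) : ℝ) * (TLall.filter fun T => lamOf T = lam).card ≤
              C₉ * (lam : ℝ) ^ 2 * (defects α y).card) ∧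
          (0 ≤ ∑ S ∈ unitSimplices α y, (volume (convexHull ℝ (y '' ↑S))).toReal -
              1 / ((lam : ℝ) ^ 2 * m (lam : ℝ)) *
                ∑ T ∈ TLall.filter (fun T => lamOf T = lam),
                  (volume (convexHull ℝ (y '' ↑T))).toReal ∧
            ∑ S ∈ unitSimplices α y, (volume (convexHull ℝ (y '' ↑S))).toReal -
              1 / ((lam : ℝ) ^ 2 * m (lam : ℝ)) *
                ∑ T ∈ TLall.filter (fun T => lamOf T = lam),
                  (volume (convexHull ℝ (y '' ↑T))).toReal ≤
              C₉ * (lam : ℝ) ^ 2 * (defects α y).card) ∧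
          (lam : ℝ)⁻¹ ^ 7 * ∑ T ∈ TLall.filter (fun T => lamOf T = lam),
              (1 / 2 * ∑ p ∈ T.offDiag, (dist (y p.1) (y p.2) - lam) ^ 2) ≤
            C₃₄ * (lam : ℝ)⁻¹ ^ 4 * m (lam : ℝ) *
              ∑ p ∈ shortRangePairs α y, (dist (y p.1) (y p.2) - 1) ^ 2))
    (hexPer : ∃ α₂ : ℝ, 0 < α₂ ∧ ∀ α : ℝ, 0 < α → α < α₂ → ∀ L : ℕ, 0 < L → ∀ V : ℝ → ℝ,
      IsAdmissible α V → ∃ (X₀ : Set (ℤ × ℤ)) (y₀ : ℤ × ℤ → Plane), IsRelaxedMinimizer V L X₀ y₀)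
    (hexDir : ∃ α₃ : ℝ, 0 < α₃ ∧ ∀ α : ℝ, 0 < α → α < α₃ → ∀ V : ℝ → ℝ, IsAdmissible α V →
      ∀ A : Finset (ℤ × ℤ), ∃ (A' : Finset (ℤ × ℤ)) (y : ℤ × ℤ → Plane),
        IsRelaxedDirichletMinimizer V A A' y) :
    Theil2006_groundStateEnergy ∧ Theil2006_periodicGroundStates_upToRotation ∧
      Theil2006_dirichletGroundStates :=
  ⟨Theil2006_groundStateEnergy_of_geometryW hK hC₃₄ hC₉ hK₃ (fun lam => lam⁻¹ ^ 4)
      inv4_weight_le hgeom,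
    Theil2006_periodic_and_dirichletGroundStates_of_mainEstimate
      (mainEstimate_periodic_of_geometryW hK hC₃₄ hC₉ hK₃ hgeom) hexPer hexDir⟩

open Theil2006 MeasureTheory in
/-- (`W`-twin of `Theil2006_mainTheorems_of_references`: identical statement and proof except
that the (34)-clause reads `C₃₄ λ⁻⁴ m(λ) Σ_𝒮(…)²` and the per-simplex rigidity carries the
factor `C λ` in place of the print's `C₃₄ λ⁻⁵ log(λ) m(λ) Σ_𝒮(…)²` / `C log λ` — the elementary
`Theil2006LongSimplexRigidity` input routed through `Theil2006ResummationWeighted`; deviation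
from print recorded in the module docstring.)
**Theil 2006 — Theorem 1.1, Theorem 1.2 (corrected, up to a rigid motion) and Corollary 1.3
from Proposition 4.8 (reference configurations, ball form), the (27)-bookkeeping, the p. 11
rigidity display, and the two existence statements.** Hypotheses, each for all small `α` and all finite configurations
`y : X_N → ℝ²` with (13): (H48) `Theil2006.HasReferences α y K` — for all concentric open balls
`Ω′ = B(c,r) ⊂ Ω = B(c,R)` with `r ≥ 2`, `R ≥ 4r + 2` and `Ω ∩ y(∂X) = ∅` a discrete imbedding of
`y⁻¹(Ω′)`
with (60) (uniqueness up to a rigid motion), (61) (rigidity, constant `K`), (62) (surjectivity)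
(Proposition 4.8, p. 21, in the form of its four applications pp. 23–24); (H27) the partition
identity and (72) (Appendix p. 25); (H52) the p. 11 display — (52) of Proposition 4.3
transported to a patch `ω_T` with `y(ω_T) ⊂ B̄(z_T,5λ)` — for every `T ∈ 𝒯_λ(y)` ((28) for these
patches is proved); plus the existence of relaxed periodic minimizers (`hexPer`) and of relaxed Dirichlet
minimizers (`hexDir`) — both theorems of the tree for `V` continuous on `[0, ∞)`
(`Theil2006.exists_isRelaxedMinimizer`, `Theil2006.exists_isRelaxedDirichletMinimizer`).
Conclusion: the tree's named facts `Theil2006_groundStateEnergy` (Theorem 1.1),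
`Theil2006_periodicGroundStates_upToRotation` (Theorem 1.2 as proved: up to a rotation) and
`Theil2006_dirichletGroundStates` (Corollary 1.3).
[cite: Theil2006, §1 Theorems 1.1, 1.2, Corollary 1.3; §2–§3; Appendix Propositions 4.3, 4.8, pp. 23–25 (preprint)] -/
theorem Theil2006_mainTheorems_of_referencesW {C₅₂ : ℝ} (hC₅₂ : 0 ≤ C₅₂)
    (h48 : ∃ α₀ K : ℝ, 0 < α₀ ∧ 0 ≤ K ∧ ∀ ⦃α : ℝ⦄, 0 < α → α < α₀ →
      ∀ {N : ℕ} (y : Fin N → Plane), (∀ i j : Fin N, i ≠ j → 1 - α < dist (y i) (y j)) →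
        HasReferences α y K)
    (h27 : ∃ α₂ : ℝ, 0 < α₂ ∧ ∀ ⦃α : ℝ⦄, 0 < α → α < α₂ →
      ∀ {N : ℕ} (y : Fin N → Plane), (∀ i j : Fin N, i ≠ j → 1 - α < dist (y i) (y j)) →
      (∀ lam : ↥(distSet \ {1}), ∀ T ∈ simplicesAt α y lam,
        (volume (convexHull ℝ (y '' ↑T))).toReal =
          ∑ S ∈ unitSimplices α y,
            (volume (convexHull ℝ (y '' ↑S) ∩ convexHull ℝ (y '' ↑T))).toReal) ∧
      (∀ lam : ↥(distSet \ {1}), ∀ S ∈ unitSimplices α y,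
        ∑ T ∈ simplicesAt α y lam,
            (volume (convexHull ℝ (y '' ↑S) ∩ convexHull ℝ (y '' ↑T))).toReal ≤
          m (lam : ℝ) * (lam : ℝ) ^ 2 * (volume (convexHull ℝ (y '' ↑S))).toReal) ∧
      (∀ lam : ↥(distSet \ {1}), ∀ S ∈ unitSimplices α y,
        (∀ x ∈ S, ∀ b ∈ defects α y, 28 * (lam : ℝ) < dist (y x) (y b)) →
        m (lam : ℝ) * (lam : ℝ) ^ 2 * (volume (convexHull ℝ (y '' ↑S))).toReal ≤
          ∑ T ∈ simplicesAt α y lam,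
            (volume (convexHull ℝ (y '' ↑S) ∩ convexHull ℝ (y '' ↑T))).toReal))
    (h52 : ∃ α₂ : ℝ, 0 < α₂ ∧ ∀ ⦃α : ℝ⦄, 0 < α → α < α₂ →
      ∀ {N : ℕ} (y : Fin N → Plane), (∀ i j : Fin N, i ≠ j → 1 - α < dist (y i) (y j)) →
      ∀ lam : ↥(distSet \ {1}), ∃ ω : Finset (Fin N) → Finset (Fin N),
        (∀ T ∈ simplicesAt α y lam, ∀ a ∈ ω T, dist (y a) (simplexCentre y T) ≤ 5 * lam) ∧
        (∀ T ∈ simplicesAt α y lam,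
          1 / 2 * ∑ p ∈ T.offDiag, (dist (y p.1) (y p.2) - lam) ^ 2 ≤
            C₅₂ * (lam : ℝ) *
              ∑ p ∈ (shortRangePairs α y).filter (fun p => p.1 ∈ ω T ∧ p.2 ∈ ω T),
                (dist (y p.1) (y p.2) - 1) ^ 2))
    (hexPer : ∃ α₂ : ℝ, 0 < α₂ ∧ ∀ α : ℝ, 0 < α → α < α₂ → ∀ L : ℕ, 0 < L → ∀ V : ℝ → ℝ,
      IsAdmissible α V → ∃ (X₀ : Set (ℤ × ℤ)) (y₀ : ℤ × ℤ → Plane), IsRelaxedMinimizer V L X₀ y₀)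
    (hexDir : ∃ α₃ : ℝ, 0 < α₃ ∧ ∀ α : ℝ, 0 < α → α < α₃ → ∀ V : ℝ → ℝ, IsAdmissible α V →
      ∀ A : Finset (ℤ × ℤ), ∃ (A' : Finset (ℤ × ℤ)) (y : ℤ × ℤ → Plane),
        IsRelaxedDirichletMinimizer V A A' y) :
    Theil2006_groundStateEnergy ∧ Theil2006_periodicGroundStates_upToRotation ∧
      Theil2006_dirichletGroundStates := by
  obtain ⟨K, hK, hgeom⟩ := geometry_of_referencesW hC₅₂ h48 h27 h52
  exact Theil2006_mainTheorems_of_geometryW (K₃ := 29) (C₉ := 311904) (C₃₄ := C₅₂ * 4056) hK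
    (mul_nonneg hC₅₂ (by norm_num)) (by norm_num) (by norm_num) hgeom hexPer hexDir

open Theil2006 MeasureTheory in
/-- (`W`-twin of `Theil2006_mainTheorems_of_existsRigidReference`: identical statement and proof except
that the (34)-clause reads `C₃₄ λ⁻⁴ m(λ) Σ_𝒮(…)²` and the per-simplex rigidity carries the
factor `C λ` in place of the print's `C₃₄ λ⁻⁵ log(λ) m(λ) Σ_𝒮(…)²` / `C log λ` — the elementary
`Theil2006LongSimplexRigidity` input routed through `Theil2006ResummationWeighted`; deviation
from print recorded in the module docstring.)
**Theorems 1.1, 1.2 (corrected), Corollary 1.3 from the EXISTENCE of rigid discrete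
imbeddings of ball patches.** As `Theil2006_mainTheorems_of_existsReference`, with (H48) reduced
further: for all small `α`, all finite configurations with (13) and all concentric balls
`B(c,r) ⊂ B(c,R)` (`r ≥ 2`, `R ≥ 4r + 2`) without defects in `B(c,R)`, a discrete imbedding of
`y⁻¹(B(c,r))` satisfying the rigidity estimate (61) EXISTS — assertions (1) (60) and (3) (62) of
Proposition 4.8 are theorems (`Theil2006.discreteImbedding_unique_ball`,
`Theil2006.IsDiscreteImbeddingOn.exists_eq_of_ball_subset`). The inputs (H27), (H52) and the two
existence statements are unchanged. [cite: Theil2006, Theorems 1.1, 1.2, Corollary 1.3 (preprint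
pp. 2–3); Appendix Proposition 4.8 (61) (p. 21), Proposition 2.9 (27) proof (p. 25), §2.4 p. 11] -/
theorem Theil2006_mainTheorems_of_existsRigidReferenceW {C₅₂ : ℝ} (hC₅₂ : 0 ≤ C₅₂)
    (h48 : ∃ α₀ K : ℝ, 0 < α₀ ∧ 0 ≤ K ∧ ∀ ⦃α : ℝ⦄, 0 < α → α < α₀ →
      ∀ {N : ℕ} (y : Fin N → Plane), (∀ i j : Fin N, i ≠ j → 1 - α < dist (y i) (y j)) →
      ∀ (c : Plane) (r R : ℝ), 2 ≤ r → 4 * r + 2 ≤ R → (∀ b ∈ defects α y, R ≤ dist (y b) c) →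
        ∃ Φ : Fin N → ℤ × ℤ, IsDiscreteImbeddingOn α y (y ⁻¹' ball c r) Φ ∧
          (∀ x x' : Fin N, y x ∈ ball c r → y x' ∈ ball c r → x ≠ x' →
            |dist (triPoint (Φ x)) (triPoint (Φ x')) / dist (y x) (y x') - 1| ≤ K * α))
    (h72 : ∃ α₂ : ℝ, 0 < α₂ ∧ ∀ ⦃α : ℝ⦄, 0 < α → α < α₂ →
      ∀ {N : ℕ} (y : Fin N → Plane), (∀ i j : Fin N, i ≠ j → 1 - α < dist (y i) (y j)) →
      (∀ lam : ↥(distSet \ {1}), ∀ S ∈ unitSimplices α y,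
        ∑ T ∈ simplicesAt α y lam,
            (volume (convexHull ℝ (y '' ↑S) ∩ convexHull ℝ (y '' ↑T))).toReal ≤
          m (lam : ℝ) * (lam : ℝ) ^ 2 * (volume (convexHull ℝ (y '' ↑S))).toReal) ∧
      (∀ lam : ↥(distSet \ {1}), ∀ S ∈ unitSimplices α y,
        (∀ x ∈ S, ∀ b ∈ defects α y, 28 * (lam : ℝ) < dist (y x) (y b)) →
        m (lam : ℝ) * (lam : ℝ) ^ 2 * (volume (convexHull ℝ (y '' ↑S))).toReal ≤
          ∑ T ∈ simplicesAt α y lam,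
            (volume (convexHull ℝ (y '' ↑S) ∩ convexHull ℝ (y '' ↑T))).toReal))
    (h52 : ∃ α₂ : ℝ, 0 < α₂ ∧ ∀ ⦃α : ℝ⦄, 0 < α → α < α₂ →
      ∀ {N : ℕ} (y : Fin N → Plane), (∀ i j : Fin N, i ≠ j → 1 - α < dist (y i) (y j)) →
      ∀ lam : ↥(distSet \ {1}), ∃ ω : Finset (Fin N) → Finset (Fin N),
        (∀ T ∈ simplicesAt α y lam, ∀ a ∈ ω T, dist (y a) (simplexCentre y T) ≤ 5 * lam) ∧
        (∀ T ∈ simplicesAt α y lam,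
          1 / 2 * ∑ p ∈ T.offDiag, (dist (y p.1) (y p.2) - lam) ^ 2 ≤
            C₅₂ * (lam : ℝ) *
              ∑ p ∈ (shortRangePairs α y).filter (fun p => p.1 ∈ ω T ∧ p.2 ∈ ω T),
                (dist (y p.1) (y p.2) - 1) ^ 2))
    (hexPer : ∃ α₂ : ℝ, 0 < α₂ ∧ ∀ α : ℝ, 0 < α → α < α₂ → ∀ L : ℕ, 0 < L → ∀ V : ℝ → ℝ,
      IsAdmissible α V → ∃ (X₀ : Set (ℤ × ℤ)) (y₀ : ℤ × ℤ → Plane), IsRelaxedMinimizer V L X₀ y₀)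
    (hexDir : ∃ α₃ : ℝ, 0 < α₃ ∧ ∀ α : ℝ, 0 < α → α < α₃ → ∀ V : ℝ → ℝ, IsAdmissible α V →
      ∀ A : Finset (ℤ × ℤ), ∃ (A' : Finset (ℤ × ℤ)) (y : ℤ × ℤ → Plane),
        IsRelaxedDirichletMinimizer V A A' y) :
    Theil2006_groundStateEnergy ∧ Theil2006_periodicGroundStates_upToRotation ∧
      Theil2006_dirichletGroundStates := by
  obtain ⟨α₀, K, hα₀, hK, h48⟩ := h48
  obtain ⟨α₂, hα₂, h72⟩ := h72
  refine Theil2006_mainTheorems_of_referencesW hC₅₂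
    ⟨min α₀ (1 / 200), K, lt_min hα₀ (by norm_num), hK, fun α hα hα0 N y hsep => ?_⟩
    ⟨min α₂ (1 / 200), lt_min hα₂ (by norm_num), fun α hα hα0 N y hsep => ?_⟩ h52 hexPer hexDir
  · have hα1 : α < α₀ := hα0.trans_le (min_le_left _ _)
    have hα200 : α ≤ 1 / 200 := (hα0.trans_le (min_le_right _ _)).le
    exact HasReferences.of_exists_rigid hα hα200 hsep (h48 hα hα1 y hsep)
  · have hα1 : α < α₂ := hα0.trans_le (min_le_left _ _)
    have hα200 : α ≤ 1 / 200 := (hα0.trans_le (min_le_right _ _)).le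
    exact ⟨partition_identity hα hα200 hsep, (h72 hα hα1 y hsep).1, (h72 hα hα1 y hsep).2⟩

open Theil2006 MeasureTheory in
/-- (`W`-twin of `Theil2006_continuous_of_geometry`: identical statement and proof except
that the (34)-clause reads `C₃₄ λ⁻⁴ m(λ) Σ_𝒮(…)²` and the per-simplex rigidity carries the
factor `C λ` in place of the print's `C₃₄ λ⁻⁵ log(λ) m(λ) Σ_𝒮(…)²` / `C log λ` — the elementary
`Theil2006LongSimplexRigidity` input routed through `Theil2006ResummationWeighted`; deviation
from print recorded in the module docstring.)
**For continuous potentials no existence hypothesis is needed.** From the finite Chapter-4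
geometry alone: for all small `α` and every `V` satisfying (1)–(5) that is continuous on `[0, ∞)`,
(a) **Theorem 1.2 (corrected)**: every ground state `y ∈ Y_L^per` of `E_L^per` (`L ≥ 1`)
satisfies (42), (43) and `RΩ + τ = A₂` for a rotation `R` and a translation `τ`
(`exists_rotation_range_eq_of_mainEstimate_of_continuousOn` of the tree with (44) from
`mainEstimate_periodic_of_geometry`); (b) **Corollary 1.3**: every ground state of `E_𝒜` over
`Y_𝒜^Dir` has `{y(x)} = A₂` (`range_eq_triangularLattice_of_mainEstimate_of_continuousOn`).
[cite: Theil2006, §1 Theorem 1.2, Corollary 1.3; §3 (preprint pp. 13–15)] -/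
theorem Theil2006_continuous_of_geometryW {K C₃₄ C₉ K₃ : ℝ} (hK : 0 ≤ K)
    (hC₃₄ : 0 ≤ C₃₄) (hC₉ : 0 ≤ C₉) (hK₃ : 0 ≤ K₃)
    (hgeom : ∃ α₂ : ℝ, 0 < α₂ ∧ ∀ ⦃α : ℝ⦄, 0 < α → α < α₂ → ∀ ⦃V : ℝ → ℝ⦄, IsAdmissible α V →
      ∀ {N : ℕ} (y : Fin N → Plane), (∀ i j : Fin N, i ≠ j → 1 - α < dist (y i) (y j)) →
      ∃ (TLall : Finset (Finset (Fin N))) (lamOf : Finset (Fin N) → ℝ),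
        (∀ T ∈ TLall, lamOf T ∈ distSet \ {1}) ∧ (∀ T ∈ TLall, T.card = 3) ∧
        (∀ T ∈ TLall, ∀ x ∈ T, ∀ x' ∈ T, x ≠ x' →
          |dist (y x) (y x') / lamOf T - 1| ≤ K * α) ∧
        (∀ p ∈ (Finset.univ : Finset (Fin N × Fin N)).filter (fun p => p.1 < p.2) \
            shortRangePairs α y, (TLall.filter fun T => p.1 ∈ T ∧ p.2 ∈ T).card ≤ 2) ∧
        (∀ p ∈ (Finset.univ : Finset (Fin N × Fin N)).filter (fun p => p.1 < p.2) \
            shortRangePairs α y, (TLall.filter fun T => p.1 ∈ T ∧ p.2 ∈ T).card < 2 →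
            ∃ b ∈ defects α y, dist (y p.1) (y b) ≤ K₃ * dist (y p.1) (y p.2)) ∧
        (∀ lam : ↥(distSet \ {1}),
          (0 ≤ ((unitSimplices α y).card : ℝ) -
              1 / (m (lam : ℝ) : ℝ) * (TLall.filter fun T => lamOf T = lam).card ∧
            ((unitSimplices α y).card : ℝ) -
              1 / (m (lam : ℝ) : ℝ) * (TLall.filter fun T => lamOf T = lam).card ≤
              C₉ * (lam : ℝ) ^ 2 * (defects α y).card) ∧
          (0 ≤ ∑ S ∈ unitSimplices α y, (volume (convexHull ℝ (y '' ↑S))).toReal -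
              1 / ((lam : ℝ) ^ 2 * m (lam : ℝ)) *
                ∑ T ∈ TLall.filter (fun T => lamOf T = lam),
                  (volume (convexHull ℝ (y '' ↑T))).toReal ∧
            ∑ S ∈ unitSimplices α y, (volume (convexHull ℝ (y '' ↑S))).toReal -
              1 / ((lam : ℝ) ^ 2 * m (lam : ℝ)) *
                ∑ T ∈ TLall.filter (fun T => lamOf T = lam),
                  (volume (convexHull ℝ (y '' ↑T))).toReal ≤
              C₉ * (lam : ℝ) ^ 2 * (defects α y).card) ∧
          (lam : ℝ)⁻¹ ^ 7 * ∑ T ∈ TLall.filter (fun T => lamOf T = lam),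
              (1 / 2 * ∑ p ∈ T.offDiag, (dist (y p.1) (y p.2) - lam) ^ 2) ≤
            C₃₄ * (lam : ℝ)⁻¹ ^ 4 * m (lam : ℝ) *
              ∑ p ∈ shortRangePairs α y, (dist (y p.1) (y p.2) - 1) ^ 2)) :
    ∃ α₀ : ℝ, 0 < α₀ ∧ ∀ α : ℝ, 0 < α → α < α₀ → ∀ V : ℝ → ℝ, IsAdmissible α V →
      ContinuousOn V (Ici 0) →
      (∀ L : ℕ, 0 < L → ∀ y : ℤ × ℤ → Plane, IsPeriodic L y →
        (∀ y' : ℤ × ℤ → Plane, IsPeriodic L y' → periodicEnergy V L y ≤ periodicEnergy V L y') →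
          (∀ x x', y x ≠ y x' → 1 ≤ dist (y x) (y x')) ∧
            (∀ x, {p ∈ Set.range y | dist (y x) p ≤ 1}.ncard = 7) ∧
              ∃ R : Plane ≃ₗᵢ[ℝ] Plane,
                LinearMap.det (R.toLinearEquiv : Plane →ₗ[ℝ] Plane) = 1 ∧
                  ∃ τ : Plane, Set.range (fun k => R (y k) + τ) = triangularLattice) ∧
      (∀ (A : Finset (ℤ × ℤ)) (y : ℤ × ℤ → Plane), IsClampedOutside A y →
        (∀ y' : ℤ × ℤ → Plane, IsClampedOutside A y' → dirichletEnergy V A y ≤ dirichletEnergy V A y') →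
          Set.range y = triangularLattice) := by
  have h44 := mainEstimate_periodic_of_geometryW hK hC₃₄ hC₉ hK₃ hgeom
  obtain ⟨αD, hαD, -, hDir⟩ := range_eq_triangularLattice_of_mainEstimate_of_continuousOn h44
  obtain ⟨αP, hαP, -, hPer⟩ := exists_rotation_range_eq_of_mainEstimate_of_continuousOn
  obtain ⟨α₁, hα₁, h44'⟩ := h44
  refine ⟨min (min αD αP) α₁, by positivity, fun α hα hαlt V hV hVc => ⟨?_, ?_⟩⟩
  · intro L hL y hy hground
    have hαP' : α < αP := hαlt.trans_le ((min_le_left _ _).trans (min_le_right _ _))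
    have hα1' : α < α₁ := hαlt.trans_le (min_le_right _ _)
    obtain ⟨C, hC, hCmain⟩ := h44' α hα hα1' V hV
    exact hPer α hα hαP' L hL V hV hVc C hC (hCmain L hL) y hy hground
  · intro A y hy hmin
    have hαD' : α < αD := hαlt.trans_le ((min_le_left _ _).trans (min_le_left _ _))
    exact hDir α hα hαD' V hV hVc A y hy hmin

open Theil2006 MeasureTheory in
/-- (`W`-twin of `Theil2006_continuous_of_references`: identical statement and proof except
that the (34)-clause reads `C₃₄ λ⁻⁴ m(λ) Σ_𝒮(…)²` and the per-simplex rigidity carries the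
factor `C λ` in place of the print's `C₃₄ λ⁻⁵ log(λ) m(λ) Σ_𝒮(…)²` / `C log λ` — the elementary
`Theil2006LongSimplexRigidity` input routed through `Theil2006ResummationWeighted`; deviation
from print recorded in the module docstring.)
**For continuous potentials no existence hypothesis is needed**: from (H48) Proposition 4.8 in
ball form, (H27) and (H52) alone, for all small `α` and every `V` satisfying (1)–(5) that is
continuous on `[0, ∞)`: (a) **Theorem 1.2 (corrected)** — every ground state `y ∈ Y_L^per` of
`E_L^per` (`L ≥ 1`) satisfies (42), (43) and `RΩ + τ = A₂` for a rotation `R ∈ SO(2)` and a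
translation `τ`; (b) **Corollary 1.3** — every ground state of `E_𝒜` over `Y_𝒜^Dir` has
`{y(x)} = A₂`.
[cite: Theil2006, §1 Theorem 1.2, Corollary 1.3; §3 (preprint pp. 13–15); Appendix Propositions 4.3, 4.8] -/
theorem Theil2006_continuous_of_referencesW {C₅₂ : ℝ} (hC₅₂ : 0 ≤ C₅₂)
    (h48 : ∃ α₀ K : ℝ, 0 < α₀ ∧ 0 ≤ K ∧ ∀ ⦃α : ℝ⦄, 0 < α → α < α₀ →
      ∀ {N : ℕ} (y : Fin N → Plane), (∀ i j : Fin N, i ≠ j → 1 - α < dist (y i) (y j)) →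
        HasReferences α y K)
    (h27 : ∃ α₂ : ℝ, 0 < α₂ ∧ ∀ ⦃α : ℝ⦄, 0 < α → α < α₂ →
      ∀ {N : ℕ} (y : Fin N → Plane), (∀ i j : Fin N, i ≠ j → 1 - α < dist (y i) (y j)) →
      (∀ lam : ↥(distSet \ {1}), ∀ T ∈ simplicesAt α y lam,
        (volume (convexHull ℝ (y '' ↑T))).toReal =
          ∑ S ∈ unitSimplices α y,
            (volume (convexHull ℝ (y '' ↑S) ∩ convexHull ℝ (y '' ↑T))).toReal) ∧
      (∀ lam : ↥(distSet \ {1}), ∀ S ∈ unitSimplices α y,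
        ∑ T ∈ simplicesAt α y lam,
            (volume (convexHull ℝ (y '' ↑S) ∩ convexHull ℝ (y '' ↑T))).toReal ≤
          m (lam : ℝ) * (lam : ℝ) ^ 2 * (volume (convexHull ℝ (y '' ↑S))).toReal) ∧
      (∀ lam : ↥(distSet \ {1}), ∀ S ∈ unitSimplices α y,
        (∀ x ∈ S, ∀ b ∈ defects α y, 28 * (lam : ℝ) < dist (y x) (y b)) →
        m (lam : ℝ) * (lam : ℝ) ^ 2 * (volume (convexHull ℝ (y '' ↑S))).toReal ≤
          ∑ T ∈ simplicesAt α y lam,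
            (volume (convexHull ℝ (y '' ↑S) ∩ convexHull ℝ (y '' ↑T))).toReal))
    (h52 : ∃ α₂ : ℝ, 0 < α₂ ∧ ∀ ⦃α : ℝ⦄, 0 < α → α < α₂ →
      ∀ {N : ℕ} (y : Fin N → Plane), (∀ i j : Fin N, i ≠ j → 1 - α < dist (y i) (y j)) →
      ∀ lam : ↥(distSet \ {1}), ∃ ω : Finset (Fin N) → Finset (Fin N),
        (∀ T ∈ simplicesAt α y lam, ∀ a ∈ ω T, dist (y a) (simplexCentre y T) ≤ 5 * lam) ∧
        (∀ T ∈ simplicesAt α y lam,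
          1 / 2 * ∑ p ∈ T.offDiag, (dist (y p.1) (y p.2) - lam) ^ 2 ≤
            C₅₂ * (lam : ℝ) *
              ∑ p ∈ (shortRangePairs α y).filter (fun p => p.1 ∈ ω T ∧ p.2 ∈ ω T),
                (dist (y p.1) (y p.2) - 1) ^ 2)) :
    ∃ α₀ : ℝ, 0 < α₀ ∧ ∀ α : ℝ, 0 < α → α < α₀ → ∀ V : ℝ → ℝ, IsAdmissible α V →
      ContinuousOn V (Ici 0) →
      (∀ L : ℕ, 0 < L → ∀ y : ℤ × ℤ → Plane, IsPeriodic L y →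
        (∀ y' : ℤ × ℤ → Plane, IsPeriodic L y' → periodicEnergy V L y ≤ periodicEnergy V L y') →
          (∀ x x', y x ≠ y x' → 1 ≤ dist (y x) (y x')) ∧
            (∀ x, {p ∈ Set.range y | dist (y x) p ≤ 1}.ncard = 7) ∧
              ∃ R : Plane ≃ₗᵢ[ℝ] Plane,
                LinearMap.det (R.toLinearEquiv : Plane →ₗ[ℝ] Plane) = 1 ∧
                  ∃ τ : Plane, Set.range (fun k => R (y k) + τ) = triangularLattice) ∧
      (∀ (A : Finset (ℤ × ℤ)) (y : ℤ × ℤ → Plane), IsClampedOutside A y →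
        (∀ y' : ℤ × ℤ → Plane, IsClampedOutside A y' →
          dirichletEnergy V A y ≤ dirichletEnergy V A y') →
          Set.range y = triangularLattice) := by
  obtain ⟨K, hK, hgeom⟩ := geometry_of_referencesW hC₅₂ h48 h27 h52
  exact Theil2006_continuous_of_geometryW (K₃ := 29) (C₉ := 311904) (C₃₄ := C₅₂ * 4056) hK
    (mul_nonneg hC₅₂ (by norm_num)) (by norm_num) (by norm_num) hgeom

/-! ### The capstones: (H48′) alone, bare existence alone, and the minimizer-existence statements alone -/

open Theil2006 MeasureTheory in
/-- **Theorem 1.1 from the existence of reference charts with (61), ball form (H48′), ALONE.**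
`lim_{N→∞} min_y E(y)/N = −3` for all small `α` and all `V` with (1)–(5): the (27)-inputs are the
partition identity (`Theil2006.partition_identity`) and (72)
(`Theil2006.measureBookkeeping_of_existsRigid`), the (34)-input is the `L²` rigidity with
factor `C λ` (`Theil2006.rigidityL2_of_existsRigid`), the rest of the geometry is
`Theil2006.HasReferences.localGeometry` via `HasReferences.of_exists_rigid` ((60), (62) proved),
and the assembly is `Theil2006_groundStateEnergy_of_geometryW`.
[cite: Theil2006, §1 Theorem 1.1; §2; Appendix Propositions 4.3, 4.8, pp. 23–25 (preprint); factor `λ` in (34) ours] -/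
theorem Theil2006_groundStateEnergy_of_existsRigidReference
    (h48 : ∃ α₀ K : ℝ, 0 < α₀ ∧ 0 ≤ K ∧ ∀ ⦃α : ℝ⦄, 0 < α → α < α₀ →
      ∀ {N : ℕ} (y : Fin N → Plane), (∀ i j : Fin N, i ≠ j → 1 - α < dist (y i) (y j)) →
      ∀ (c : Plane) (r R : ℝ), 2 ≤ r → 4 * r + 2 ≤ R → (∀ b ∈ defects α y, R ≤ dist (y b) c) →
        ∃ Φ : Fin N → ℤ × ℤ, IsDiscreteImbeddingOn α y (y ⁻¹' ball c r) Φ ∧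
          (∀ x x' : Fin N, y x ∈ ball c r → y x' ∈ ball c r → x ≠ x' →
            |dist (triPoint (Φ x)) (triPoint (Φ x')) / dist (y x) (y x') - 1| ≤ K * α)) :
    Theil2006_groundStateEnergy := by
  obtain ⟨C, hC, h52⟩ := rigidityL2_of_existsRigid h48
  obtain ⟨α₂, hα₂, h72⟩ := measureBookkeeping_of_existsRigid h48
  obtain ⟨α₀, K, hα₀, hK, h48⟩ := h48
  obtain ⟨K', hK', hgeom⟩ := geometry_of_referencesW hC.le
    ⟨min α₀ (1 / 200), K, lt_min hα₀ (by norm_num), hK, fun α hα hα0 N y hsep => by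
      have hα1 : α < α₀ := hα0.trans_le (min_le_left _ _)
      have hα200 : α ≤ 1 / 200 := (hα0.trans_le (min_le_right _ _)).le
      exact HasReferences.of_exists_rigid hα hα200 hsep (h48 hα hα1 y hsep)⟩
    ⟨min α₂ (1 / 200), lt_min hα₂ (by norm_num), fun α hα hα0 N y hsep => by
      have hα1 : α < α₂ := hα0.trans_le (min_le_left _ _)
      have hα200 : α ≤ 1 / 200 := (hα0.trans_le (min_le_right _ _)).le
      exact ⟨partition_identity hα hα200 hsep, (h72 hα hα1 y hsep).1, (h72 hα hα1 y hsep).2⟩⟩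
    h52
  exact Theil2006_groundStateEnergy_of_geometryW (K₃ := 29) (C₉ := 311904) (C₃₄ := C * 4056) hK'
    (by positivity) (by norm_num) (by norm_num) (fun lam => lam⁻¹ ^ 4) inv4_weight_le hgeom

open Theil2006 MeasureTheory in
/-- **Theorems 1.1, 1.2 (corrected: up to a rotation) and Corollary 1.3 from (H48′) and the two
minimizer-existence statements alone** — `Theil2006_mainTheorems_of_existsRigidReference` with
its hypotheses (H72) and (H52) discharged by `Theil2006.measureBookkeeping_of_existsRigid` and
`Theil2006.rigidityL2_of_existsRigid` (factor `C λ`, through the `…W` chain).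
[cite: Theil2006, §1 Theorems 1.1, 1.2, Corollary 1.3; §2–§4 (preprint); factor `λ` in (34) ours] -/
theorem Theil2006_mainTheorems_of_existsRigidReference'
    (h48 : ∃ α₀ K : ℝ, 0 < α₀ ∧ 0 ≤ K ∧ ∀ ⦃α : ℝ⦄, 0 < α → α < α₀ →
      ∀ {N : ℕ} (y : Fin N → Plane), (∀ i j : Fin N, i ≠ j → 1 - α < dist (y i) (y j)) →
      ∀ (c : Plane) (r R : ℝ), 2 ≤ r → 4 * r + 2 ≤ R → (∀ b ∈ defects α y, R ≤ dist (y b) c) →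
        ∃ Φ : Fin N → ℤ × ℤ, IsDiscreteImbeddingOn α y (y ⁻¹' ball c r) Φ ∧
          (∀ x x' : Fin N, y x ∈ ball c r → y x' ∈ ball c r → x ≠ x' →
            |dist (triPoint (Φ x)) (triPoint (Φ x')) / dist (y x) (y x') - 1| ≤ K * α))
    (hexPer : ∃ α₂ : ℝ, 0 < α₂ ∧ ∀ α : ℝ, 0 < α → α < α₂ → ∀ L : ℕ, 0 < L → ∀ V : ℝ → ℝ,
      IsAdmissible α V → ∃ (X₀ : Set (ℤ × ℤ)) (y₀ : ℤ × ℤ → Plane), IsRelaxedMinimizer V L X₀ y₀)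
    (hexDir : ∃ α₃ : ℝ, 0 < α₃ ∧ ∀ α : ℝ, 0 < α → α < α₃ → ∀ V : ℝ → ℝ, IsAdmissible α V →
      ∀ A : Finset (ℤ × ℤ), ∃ (A' : Finset (ℤ × ℤ)) (y : ℤ × ℤ → Plane),
        IsRelaxedDirichletMinimizer V A A' y) :
    Theil2006_groundStateEnergy ∧ Theil2006_periodicGroundStates_upToRotation ∧
      Theil2006_dirichletGroundStates := by
  obtain ⟨C, hC, h52⟩ := rigidityL2_of_existsRigid h48
  exact Theil2006_mainTheorems_of_existsRigidReferenceW hC.le h48 (measureBookkeeping_of_existsRigid h48)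
    h52 hexPer hexDir

open Theil2006 MeasureTheory in
/-- **For continuous potentials no existence hypothesis is needed — Theorem 1.2 (corrected) and
Corollary 1.3 from (H48′) alone**: for all small `α` and every `V` satisfying (1)–(5) that is
continuous on `[0, ∞)`, (a) every ground state `y ∈ Y_L^per` of `E_L^per` (`L ≥ 1`) satisfies
(42), (43) and `RΩ + τ = A₂` for a rotation `R ∈ SO(2)` and a translation `τ`; (b) every ground
state of `E_𝒜` over `Y_𝒜^Dir` has `{y(x)} = A₂`. (`Theil2006_continuous_of_references` with (H27),
(H52) discharged as in `Theil2006_mainTheorems_of_existsRigidReference'`.)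
[cite: Theil2006, §1 Theorem 1.2, Corollary 1.3; §3 (preprint pp. 13–15); factor `λ` in (34) ours] -/
theorem Theil2006_continuous_of_existsRigidReference'
    (h48 : ∃ α₀ K : ℝ, 0 < α₀ ∧ 0 ≤ K ∧ ∀ ⦃α : ℝ⦄, 0 < α → α < α₀ →
      ∀ {N : ℕ} (y : Fin N → Plane), (∀ i j : Fin N, i ≠ j → 1 - α < dist (y i) (y j)) →
      ∀ (c : Plane) (r R : ℝ), 2 ≤ r → 4 * r + 2 ≤ R → (∀ b ∈ defects α y, R ≤ dist (y b) c) →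
        ∃ Φ : Fin N → ℤ × ℤ, IsDiscreteImbeddingOn α y (y ⁻¹' ball c r) Φ ∧
          (∀ x x' : Fin N, y x ∈ ball c r → y x' ∈ ball c r → x ≠ x' →
            |dist (triPoint (Φ x)) (triPoint (Φ x')) / dist (y x) (y x') - 1| ≤ K * α)) :
    ∃ α₀ : ℝ, 0 < α₀ ∧ ∀ α : ℝ, 0 < α → α < α₀ → ∀ V : ℝ → ℝ, IsAdmissible α V →
      ContinuousOn V (Ici 0) →
      (∀ L : ℕ, 0 < L → ∀ y : ℤ × ℤ → Plane, IsPeriodic L y →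
        (∀ y' : ℤ × ℤ → Plane, IsPeriodic L y' → periodicEnergy V L y ≤ periodicEnergy V L y') →
          (∀ x x', y x ≠ y x' → 1 ≤ dist (y x) (y x')) ∧
            (∀ x, {p ∈ Set.range y | dist (y x) p ≤ 1}.ncard = 7) ∧
              ∃ R : Plane ≃ₗᵢ[ℝ] Plane,
                LinearMap.det (R.toLinearEquiv : Plane →ₗ[ℝ] Plane) = 1 ∧
                  ∃ τ : Plane, Set.range (fun k => R (y k) + τ) = triangularLattice) ∧
      (∀ (A : Finset (ℤ × ℤ)) (y : ℤ × ℤ → Plane), IsClampedOutside A y →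
        (∀ y' : ℤ × ℤ → Plane, IsClampedOutside A y' →
          dirichletEnergy V A y ≤ dirichletEnergy V A y') →
          Set.range y = triangularLattice) := by
  obtain ⟨C, hC, h52⟩ := rigidityL2_of_existsRigid h48
  obtain ⟨α₂, hα₂, h72⟩ := measureBookkeeping_of_existsRigid h48
  obtain ⟨α₀, K, hα₀, hK, h48⟩ := h48
  exact Theil2006_continuous_of_referencesW hC.le
    ⟨min α₀ (1 / 200), K, lt_min hα₀ (by norm_num), hK, fun α hα hα0 N y hsep => by
      have hα1 : α < α₀ := hα0.trans_le (min_le_left _ _)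
      have hα200 : α ≤ 1 / 200 := (hα0.trans_le (min_le_right _ _)).le
      exact HasReferences.of_exists_rigid hα hα200 hsep (h48 hα hα1 y hsep)⟩
    ⟨min α₂ (1 / 200), lt_min hα₂ (by norm_num), fun α hα hα0 N y hsep => by
      have hα1 : α < α₂ := hα0.trans_le (min_le_left _ _)
      have hα200 : α ≤ 1 / 200 := (hα0.trans_le (min_le_right _ _)).le
      exact ⟨partition_identity hα hα200 hsep, (h72 hα hα1 y hsep).1, (h72 hα hα1 y hsep).2⟩⟩
    h52

end Literature.MathematicalPhysics.StatisticalMechanics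

end

/-! # Part: staged brick `Theil2006MainTheoremsHold` (sha16 49c5727983022d3c) — verbatim -/

/-!
# Theil 2006, Theorem 1.1, Theorem 1.2 (corrected) and Corollary 1.3 — PROVED, for every
admissible potential (the three named facts of `Theil2006.lean` / `Theil2006Periodic.lean`
discharged)

Topic `Literature/MathematicalPhysics/StatisticalMechanics`; companion of `Theil2006.lean`
(F. Theil, *A proof of crystallization in two dimensions*, Comm. Math. Phys. **262** (2006)
209–236, accepted preprint of 26 Aug 2005), §1.

This file only plugs the theorem `Theil2006_existsRigidReference` (Appendix Proposition 4.8,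
existence with (61), ball form; `Theil2006ExistsReference.lean`) into the capstones of
`Theil2006FromExistence.lean`, and the resulting main estimate (44) into
`Theil2006RelaxedMinimizers.lean` (the relaxed minimizers of §3 exist for EVERY admissible `V`:
the lattice is one):

* `Theil2006_mainEstimate_holds` — **(44)** (§3, p. 14) with a universal constant, for all small
  `α`, all `V` with (1)–(5), all `L ≥ 1` and all `L`-periodic `(X, y)` with (13) — PROVED;
* `Theil2006_existsRelaxedMinimizer_holds`, `Theil2006_existsRelaxedDirichletMinimizer_holds` —
  the two existence assertions of §3 (p. 13 «a minimizer `(X_min, y_min)` of `E_L^per` exists»;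
  p. 14 «Let `𝒜_min, y_min` be the minimizer of `E(·, ·)`») — PROVED for every admissible `V`;
* `Theil2006_mainTheorems_holds` — **all three named facts, no hypotheses**;
  `Theil2006_periodicGroundStates_upToRotation_holds : Theil2006_periodicGroundStates_upToRotation`
  (**Theorem 1.2**, in the corrected form its proof establishes — up to a rigid motion; the
  printed translation-only form `Theil2006_periodicGroundStates` is refuted in
  `Theil2006Periodic.lean`) and `Theil2006_dirichletGroundStates_holds :
  Theil2006_dirichletGroundStates` (**Corollary 1.3**), discharging those named facts
  (non-vacuously: the class (1)–(5) is non-empty for every `0 < α ≤ 1/5`,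
  `Theil2006.exists_isAdmissible` of `Theil2006AdmissibleExample.lean`);
* `Theil2006_periodicGroundStates_false : ¬ Theil2006_periodicGroundStates` — the PRINTED
  (translation-only) wording of Theorem 1.2 is formally refuted: at `L = 7` the `Σ7`-rotated
  lattice is a periodic ground state (`Theil2006Periodic.lean`) that is not a translate of `A₂`;

* `Theil2006_groundStateEnergy_holds : Theil2006_groundStateEnergy` — **Theorem 1.1**
  (`lim_{N→∞} min_y E(y)/N = −3` for all `0 < α < α₀` and all `V` with (1)–(5)), discharging the
  named fact of `Theil2006.lean`;
* `Theil2006_continuous_holds` — **Theorem 1.2 (as proved: up to a rotation) and Corollary 1.3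
  for every `V` with (1)–(5) continuous on `[0, ∞)`**, no further hypothesis;
* `Theil2006_mainTheorems_of_minimizers` — the three named facts (`Theil2006_groundStateEnergy`,
  `Theil2006_periodicGroundStates_upToRotation`, `Theil2006_dirichletGroundStates`) from the
  existence of relaxed periodic and Dirichlet minimizers (the print's tacit assumption, p. 13:
  «a minimizer `(X_min, y_min)` of `E_L^per` exists»; not implied by (1)–(5) for discontinuous
  `V`);
* `Theil2006_mainTheorems_of_existsImbedding` — the same from the bare existence of SOME
  discrete imbedding on every defect-free disc ((61) by `Theil2006.exists_rigid_of_exists_imbedding`).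

Deviation from print inherited from `Theil2006FromExistence`: the per-simplex rigidity enters
with factor `C λ` (elementary) instead of `C log λ` (Proposition 4.3 via [FJM]); harmless by (35).
[cite: Theil2006, §1 Theorems 1.1, 1.2, Corollary 1.3 (preprint pp. 2–3); §3 p. 13; Appendix Proposition 4.8 (p. 21)]
-/

noncomputable section

open scoped BigOperators Topology
open Filter Set Metric MeasureTheory

namespace Literature.MathematicalPhysics.StatisticalMechanics

open Theil2006 MeasureTheory in
/-- **The same from the bare existence of discrete imbeddings of defect-free discs**: if for all
small `α`, every finite configuration with (13) and every disc `B(c, ρ)` with no defect within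
`ρ + 2` of `c` admit SOME discrete imbedding of `y⁻¹(B(c, ρ))`, then Theorems 1.1, 1.2
(corrected) and Corollary 1.3 hold given the two minimizer-existence statements — (61) by
`Theil2006.exists_rigid_of_exists_imbedding` (`Theil2006ReferenceRigidity`).
[cite: Theil2006, Appendix Proposition 4.8 (preprint p. 21); §1] -/
theorem Theil2006_mainTheorems_of_existsImbedding
    (hE : ∃ α₂ : ℝ, 0 < α₂ ∧ ∀ ⦃α : ℝ⦄, 0 < α → α < α₂ →
      ∀ {N : ℕ} (y : Fin N → Plane), (∀ i j : Fin N, i ≠ j → 1 - α < dist (y i) (y j)) →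
      ∀ (c : Plane) (ρ : ℝ), 0 < ρ → (∀ b ∈ defects α y, ρ + 2 ≤ dist (y b) c) →
        ∃ Φ : Fin N → ℤ × ℤ, IsDiscreteImbeddingOn α y (y ⁻¹' ball c ρ) Φ)
    (hexPer : ∃ α₂ : ℝ, 0 < α₂ ∧ ∀ α : ℝ, 0 < α → α < α₂ → ∀ L : ℕ, 0 < L → ∀ V : ℝ → ℝ,
      IsAdmissible α V → ∃ (X₀ : Set (ℤ × ℤ)) (y₀ : ℤ × ℤ → Plane), IsRelaxedMinimizer V L X₀ y₀)
    (hexDir : ∃ α₃ : ℝ, 0 < α₃ ∧ ∀ α : ℝ, 0 < α → α < α₃ → ∀ V : ℝ → ℝ, IsAdmissible α V →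
      ∀ A : Finset (ℤ × ℤ), ∃ (A' : Finset (ℤ × ℤ)) (y : ℤ × ℤ → Plane),
        IsRelaxedDirichletMinimizer V A A' y) :
    Theil2006_groundStateEnergy ∧ Theil2006_periodicGroundStates_upToRotation ∧
      Theil2006_dirichletGroundStates :=
  Theil2006_mainTheorems_of_existsRigidReference' (exists_rigid_of_exists_imbedding hE) hexPer hexDir

open Theil2006 MeasureTheory in
/-- **Theil 2006, Theorem 1.1 — proved** (all inputs theorems of the tree: Proposition 4.8's
existence with (61) is `Theil2006_existsRigidReference`). `lim_{N→∞} (1/N) min_y E(y) = −3`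
for all `0 < α < α₀` and all `V` satisfying (1)–(5) (the tree's named fact
`Theil2006_groundStateEnergy`). [cite: Theil2006, §1 Theorem 1.1 (preprint p. 2)] -/
theorem Theil2006_groundStateEnergy_holds : Theil2006_groundStateEnergy :=
  Theil2006_groundStateEnergy_of_existsRigidReference Theil2006_existsRigidReference

open Theil2006 MeasureTheory in
/-- **Theil 2006, Theorem 1.2 (corrected: up to a rotation) and Corollary 1.3 for continuous
potentials — proved, no hypotheses** beyond the standing ones: for all `0 < α < α₀` and every `V`
satisfying (1)–(5) continuous on `[0, ∞)`, every periodic ground state of `E_L^per` is the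
triangular lattice up to a rigid motion, and every Dirichlet ground state IS `A₂`.
[cite: Theil2006, §1 Theorem 1.2, Corollary 1.3 (preprint pp. 2–3); §3 pp. 13–15] -/
theorem Theil2006_continuous_holds :
    ∃ α₀ : ℝ, 0 < α₀ ∧ ∀ α : ℝ, 0 < α → α < α₀ → ∀ V : ℝ → ℝ, IsAdmissible α V →
      ContinuousOn V (Ici 0) →
      (∀ L : ℕ, 0 < L → ∀ y : ℤ × ℤ → Plane, IsPeriodic L y →
        (∀ y' : ℤ × ℤ → Plane, IsPeriodic L y' → periodicEnergy V L y ≤ periodicEnergy V L y') →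
          (∀ x x', y x ≠ y x' → 1 ≤ dist (y x) (y x')) ∧
            (∀ x, {p ∈ Set.range y | dist (y x) p ≤ 1}.ncard = 7) ∧
              ∃ R : Plane ≃ₗᵢ[ℝ] Plane,
                LinearMap.det (R.toLinearEquiv : Plane →ₗ[ℝ] Plane) = 1 ∧
                  ∃ τ : Plane, Set.range (fun k => R (y k) + τ) = triangularLattice) ∧
      (∀ (A : Finset (ℤ × ℤ)) (y : ℤ × ℤ → Plane), IsClampedOutside A y →
        (∀ y' : ℤ × ℤ → Plane, IsClampedOutside A y' →
          dirichletEnergy V A y ≤ dirichletEnergy V A y') →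
          Set.range y = triangularLattice) :=
  Theil2006_continuous_of_existsRigidReference' Theil2006_existsRigidReference

open Theil2006 MeasureTheory in
/-- **Theil 2006, Theorems 1.1, 1.2 (corrected: up to a rotation) and Corollary 1.3 from the
existence of relaxed periodic and Dirichlet minimizers alone** (the print: «since there are only
`2^{L²}` possible `L`-periodic sets `X`, a minimizer `(X_min, y_min)` of `E_L^per` exists», p. 13).
[cite: Theil2006, §1 Theorems 1.1, 1.2, Corollary 1.3; §3 (preprint pp. 2–3, 13–15)] -/
theorem Theil2006_mainTheorems_of_minimizers
    (hexPer : ∃ α₂ : ℝ, 0 < α₂ ∧ ∀ α : ℝ, 0 < α → α < α₂ → ∀ L : ℕ, 0 < L → ∀ V : ℝ → ℝ,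
      IsAdmissible α V → ∃ (X₀ : Set (ℤ × ℤ)) (y₀ : ℤ × ℤ → Plane), IsRelaxedMinimizer V L X₀ y₀)
    (hexDir : ∃ α₃ : ℝ, 0 < α₃ ∧ ∀ α : ℝ, 0 < α → α < α₃ → ∀ V : ℝ → ℝ, IsAdmissible α V →
      ∀ A : Finset (ℤ × ℤ), ∃ (A' : Finset (ℤ × ℤ)) (y : ℤ × ℤ → Plane),
        IsRelaxedDirichletMinimizer V A A' y) :
    Theil2006_groundStateEnergy ∧ Theil2006_periodicGroundStates_upToRotation ∧
      Theil2006_dirichletGroundStates :=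
  Theil2006_mainTheorems_of_existsRigidReference' Theil2006_existsRigidReference hexPer hexDir

open Theil2006 MeasureTheory in
/-- **Theil 2006, §3 (44) — the periodic main estimate, PROVED** (uniformly in `L`): there are
`α₁ > 0` and, for every `0 < α < α₁` and every `V` with (1)–(5), a constant `C > 0` such that for
all `L ≥ 1` and all `L`-periodic `(X, y)` satisfying (13),
`(1/C) ∑_{𝒮̃}(e_* + 1) + ¼ #∂X̃ − 3 #X̃ ≤ ½ E_L^per(X, {y})` (ordered normalisation; "We claim now
that for configurations `X, y` which satisfy the bound (13) a suitably adapted version of (9)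
holds: (44)", p. 14). Assembly: Proposition 4.8 existence with (61)
(`Theil2006_existsRigidReference`) ⇒ the Chapter-4 geometry package (`geometry_of_referencesW`,
with (72) `measureBookkeeping_of_existsRigid` and the `L²` rigidity `rigidityL2_of_existsRigid`)
⇒ (9) for finite `X` ⇒ (44) by the thermodynamic limit (`mainEstimate_periodic_of_geometryW`).
[cite: Theil2006, §3 (44) (preprint p. 14); §2–§4; factor `λ` in (34) ours] -/
theorem Theil2006_mainEstimate_holds :
    ∃ α₁ : ℝ, 0 < α₁ ∧ ∀ α : ℝ, 0 < α → α < α₁ → ∀ V : ℝ → ℝ, IsAdmissible α V →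
      ∃ C : ℝ, 0 < C ∧ ∀ L : ℕ, 0 < L → ∀ (X : Set (ℤ × ℤ)) (y : ℤ × ℤ → Plane),
        IsPeriodicSet L X → IsPeriodic L y →
          (∀ x ∈ X, ∀ x' ∈ X, x ≠ x' → 1 - α < dist (y x) (y x')) →
            mainEstimateRHS C α V L X y ≤ relaxedPeriodicEnergy V L X y / 2 := by
  have h48 := Theil2006_existsRigidReference
  obtain ⟨C, hC, h52⟩ := rigidityL2_of_existsRigid h48
  obtain ⟨α₂, hα₂, h72⟩ := measureBookkeeping_of_existsRigid h48
  obtain ⟨α₀, K, hα₀, hK, h48⟩ := h48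
  obtain ⟨K', hK', hgeom⟩ := geometry_of_referencesW hC.le
    ⟨min α₀ (1 / 200), K, lt_min hα₀ (by norm_num), hK, fun α hα hα0 N y hsep => by
      have hα1 : α < α₀ := hα0.trans_le (min_le_left _ _)
      have hα200 : α ≤ 1 / 200 := (hα0.trans_le (min_le_right _ _)).le
      exact HasReferences.of_exists_rigid hα hα200 hsep (h48 hα hα1 y hsep)⟩
    ⟨min α₂ (1 / 200), lt_min hα₂ (by norm_num), fun α hα hα0 N y hsep => by
      have hα1 : α < α₂ := hα0.trans_le (min_le_left _ _)
      have hα200 : α ≤ 1 / 200 := (hα0.trans_le (min_le_right _ _)).le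
      exact ⟨partition_identity hα hα200 hsep, (h72 hα hα1 y hsep).1, (h72 hα hα1 y hsep).2⟩⟩
    h52
  exact mainEstimate_periodic_of_geometryW (K₃ := 29) (C₉ := 311904) (C₃₄ := C * 4056) hK'
    (by positivity) (by norm_num) (by norm_num) hgeom

open Theil2006 MeasureTheory in
/-- **§3, p. 13: "a minimizer `(X_min, y_min)` of `E_L^per` exists" — PROVED for every admissible
`V`** (for all small `α`, all `L ≥ 1`): by (44) the undeformed lattice is one
(`Theil2006.exists_isRelaxedMinimizer_of_mainEstimate`). The print's reason ("since there are
only `2^{L²}` possible `L`-periodic sets `X`") needs lower semicontinuity in `y`, which (1)–(5) do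
not give; the conclusion holds regardless. [cite: Theil2006, §3 (preprint p. 13)] -/
theorem Theil2006_existsRelaxedMinimizer_holds :
    ∃ α₂ : ℝ, 0 < α₂ ∧ ∀ α : ℝ, 0 < α → α < α₂ → ∀ L : ℕ, 0 < L → ∀ V : ℝ → ℝ,
      IsAdmissible α V →
        ∃ (X₀ : Set (ℤ × ℤ)) (y₀ : ℤ × ℤ → Plane), IsRelaxedMinimizer V L X₀ y₀ :=
  exists_isRelaxedMinimizer_of_mainEstimate
    (Theil2006.mainEstimate_perL_of_uniform Theil2006_mainEstimate_holds)

open Theil2006 MeasureTheory in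
/-- **§3, p. 14: "Let `𝒜_min, y_min` be the minimizer of `E(·, ·)`" — the relaxed Dirichlet
problem HAS a minimizer, PROVED for every admissible `V`** and every finite `𝒜 ⊂ A₂`: by (44)
the clamped lattice is one (`Theil2006.exists_isRelaxedDirichletMinimizer_of_mainEstimate`).
[cite: Theil2006, §3 Proof of Corollary 1.3 (preprint p. 14)] -/
theorem Theil2006_existsRelaxedDirichletMinimizer_holds :
    ∃ α₃ : ℝ, 0 < α₃ ∧ ∀ α : ℝ, 0 < α → α < α₃ → ∀ V : ℝ → ℝ, IsAdmissible α V →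
      ∀ A : Finset (ℤ × ℤ), ∃ (A' : Finset (ℤ × ℤ)) (y : ℤ × ℤ → Plane),
        IsRelaxedDirichletMinimizer V A A' y :=
  exists_isRelaxedDirichletMinimizer_of_mainEstimate Theil2006_mainEstimate_holds

open Theil2006 MeasureTheory in
/-- **Theil 2006, Theorems 1.1, 1.2 (corrected: up to a rigid motion) and Corollary 1.3 — all
PROVED, no hypotheses**, for every `0 < α < α₀` and every `V` satisfying (1)–(5)
(`Theil2006_mainTheorems_of_minimizers` with both existence statements discharged).
[cite: Theil2006, §1 Theorems 1.1, 1.2, Corollary 1.3 (preprint pp. 2–3); §2–§4] -/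
theorem Theil2006_mainTheorems_holds :
    Theil2006_groundStateEnergy ∧ Theil2006_periodicGroundStates_upToRotation ∧
      Theil2006_dirichletGroundStates :=
  Theil2006_mainTheorems_of_minimizers Theil2006_existsRelaxedMinimizer_holds
    Theil2006_existsRelaxedDirichletMinimizer_holds

open Theil2006 MeasureTheory in
/-- **Theil 2006, Theorem 1.2 — proved, in the form its printed proof establishes** (the named
fact `Theil2006_periodicGroundStates_upToRotation` of `Theil2006Periodic.lean`): for all
`0 < α < α₀`, `L ≥ 1`, every `V` with (1)–(5) and every ground state `y ∈ Y_L^per` of `E_L^per`,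
`{R y(x) + τ | x ∈ A₂} = A₂` for a linear isometry `R` and a translation `τ`. (The printed
translation-only conclusion, `Theil2006_periodicGroundStates`, is false for `L` with a prime
factor `≡ 1 (mod 3)`: `Theil2006_periodicGroundStates.no_groundState_seven`.)
[cite: Theil2006, §1 Theorem 1.2 with §3 Proof of Theorem 1.2 (preprint pp. 2–3, 13–14)] -/
theorem Theil2006_periodicGroundStates_upToRotation_holds :
    Theil2006_periodicGroundStates_upToRotation :=
  Theil2006_mainTheorems_holds.2.1

open Theil2006 MeasureTheory in
/-- **Theil 2006, Corollary 1.3 (stability against compactly supported perturbations) — proved**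
(the named fact `Theil2006_dirichletGroundStates` of `Theil2006.lean`): for all `0 < α < α₀`,
every `V` with (1)–(5), every finite `𝒜 ⊂ A₂` and every ground state `y` of `E_𝒜` over
`Y_𝒜^Dir`, `{y(x) | x ∈ A₂} = A₂`. [cite: Theil2006, §1 Corollary 1.3 (preprint p. 3); §3 pp. 14–15] -/
theorem Theil2006_dirichletGroundStates_holds : Theil2006_dirichletGroundStates :=
  Theil2006_mainTheorems_holds.2.2

open Theil2006 MeasureTheory in
/-- **The printed wording of Theorem 1.2 is false** (the named fact
`Theil2006_periodicGroundStates` of `Theil2006.lean`, «there exists a translation vector τ such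
that {y_min(x) + τ} = A₂», flagged MISSTATED there): for `L = 7`, any `0 < α` below all
thresholds and the admissible potential of `Theil2006AdmissibleExample.lean`, every `7`-periodic
configuration has `E_7^per ≥ −6·7²` by (44) (`Theil2006_mainEstimate_holds`,
`Theil2006.le_relaxedPeriodicEnergy_of_mainEstimate`), whereas the printed statement would force
a competitor strictly below the lattice (`Theil2006_periodicGroundStates.exists_lt_lattice`: the
`Σ7`-rotated lattice is periodic with the lattice's energy but is no translate of `A₂`). The
statement the proof establishes, `Theil2006_periodicGroundStates_upToRotation`, is proved above.
[cite: Theil2006, §1 Theorem 1.2 (preprint pp. 2–3) with §3 Proof of Theorem 1.2 (p. 14, «By the periodicity of y_min we can choose R = Id» — the step that fails); our refutation] -/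
theorem Theil2006_periodicGroundStates_false : ¬ Theil2006_periodicGroundStates := by
  intro h
  obtain ⟨α₀, hα₀, hlt⟩ := h.exists_lt_lattice
  obtain ⟨α₁, hα₁, h44⟩ := Theil2006.mainEstimate_perL_of_uniform Theil2006_mainEstimate_holds
  set α : ℝ := min (min α₀ α₁) (1 / 13447168) / 2 with hαdef
  have hm : 0 < min (min α₀ α₁) (1 / 13447168) := lt_min (lt_min hα₀ hα₁) (by norm_num)
  have hα : 0 < α := by rw [hαdef]; positivity
  have hαlt : α < min (min α₀ α₁) (1 / 13447168) := by rw [hαdef]; linarith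
  have hα0 : α < α₀ := hαlt.trans_le ((min_le_left _ _).trans (min_le_left _ _))
  have hα1 : α < α₁ := hαlt.trans_le ((min_le_left _ _).trans (min_le_right _ _))
  have hαW : α < 1 / 13447168 := hαlt.trans_le (min_le_right _ _)
  have hα5 : α ≤ 1 / 5 := by linarith
  obtain ⟨V, hV⟩ := exists_isAdmissible hα hα5
  obtain ⟨y', hy', hE⟩ := hlt α hα hα0 V hV
  obtain ⟨C, hC, h44'⟩ := h44 α hα hα1 7 (by norm_num) V hV
  have hge := le_relaxedPeriodicEnergy_of_mainEstimate hα hαW hV (by norm_num : 0 < 7) hC h44'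
    (isPeriodicSet_univ 7) hy'
  rw [relaxedPeriodicEnergy_univ] at hge
  push_cast at hge
  linarith

end Literature.MathematicalPhysics.StatisticalMechanics

end
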